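import Literature.MathematicalPhysics.QuantumFieldTheory.Balaban1983to89.T4AveragingDeficitWallLocal
import Literature.MathematicalPhysics.QuantumFieldTheory.Balaban1983to89.BlockAveragingFederbushRadius

/-!
# T4AveragingDeficitWallBoundary — the typed VALUE wall (β′) of the NE3 energy route is FALSE on finite block windows: a first-order BOUNDARY-FLUX term in `𝓓_{W(Y)}`; kernel refutation `¬ DeficitValueWall (d+2) N 2 C a₀ R`, hence `¬ ClaimBeta (d+2) N 2`, `¬ ClaimBetaDeriv (d+2) N 2` for EVERY dimension `≥ 2` (in particular `d = 4`), every `N ≥ 1`, every `(C, a₀ > 0, R)`; the repaired walls β′-loc / β′-per (statements only)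

HONEST FRAMING (cell `pub-balaban`, T4-DAG PAGE 1; companion of `T4AveragingDeficitWall` v1.1 and
`T4AveragingDeficitWallLocal` v1, same seat NE3 = U1 (b), lineage `b2b-balaban-t4-ne3-p2`, gen 6, fourth node).  The
cell's T4 target is the finite-torus continuum limit of the unit-scale averaged loop expectations — NOT infinite volume,
NO mass gap, NOT the Clay problem, NOT summit progress.  `T4AveragingDeficitWall` §6 TYPED the value half of CLAIM β
(record Appendix β §0 (β′), (3.3); GAPS G-ne3p2-1) as `DeficitValueWall d N L C a₀ R`: for every `U(N)`-valued `V` on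
`ℤ^d` with `sup |V(∂p′) − 1| ≤ a ≤ a₀` and EVERY FINITE SET `Y` of coarse sites,
`|𝓓_{W(Y)}(V)| ≤ C (‖∇_V F‖²_{ℓ²(N_R(B(Y)))} + a³ #Y)`, where `W(Y) = blockWindow L Y` = (coarse plaquettes based in
`Y`, fine plaquettes based in the blocks `B(Y)`), `𝓓_W(V) = L^{d−4} Σ_{P ∈ W.1}(1 − Re tr V̄(∂P)/N) − Σ_{p′ ∈ W.2}
(1 − Re tr V(∂p′)/N)` and `V̄ = B7Prop1Explicit.bavg L V` is Bałaban's own non-linear average (15)/(42).  THIS FILE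
KERNEL-PROVES `¬ DeficitValueWall (d+2) N 2 C a₀ R` for all `d : ℕ` (every dimension `≥ 2`; `L = 2`), every
`N ≥ 1` and every `C`, `a₀ > 0`, `R` (`not_deficitValueWall`), hence `¬ ClaimBeta (d+2) N 2` and
`¬ ClaimBetaDeriv (d+2) N 2` (`not_claimBeta`, `not_claimBetaDeriv`; the T⁴ instances `not_deficitValueWall_four`,
`not_claimBeta_four`, `not_claimBetaDeriv_four`).  WHAT THIS REFUTES is OUR finite-window TRANSCRIPTION (β′) — the
packaging `ClaimBeta` bundles it with the derivative wall (β), so `ClaimBeta` falls with it; (β) itself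
(`DeficitDerivWall`, the derivative wall the NE3 convexity argument actually consumes) is NOT touched, and nothing is
said about any bound printed by Bałaban.  The two REPAIRED value walls (§4: `DeficitValueWallLoc` with the first-order
term `a·‖∇_V F‖_{ℓ¹(N_R)}` restored, `DeficitValueWallPer` on periodic configurations / whole tori where the first-order
term telescopes away) are STATEMENTS ONLY, asserted nowhere, with `DeficitValueWall → DeficitValueWallLoc` (`C ≥ 0`)
and the consistency of the refuting family with β′-loc recorded.  NE3 stays COND-free (no BetaPertH / (B) / (B^μ)).

MECHANISM (the boundary-flux term).  The average (42) of the bond `[Ly, Ly + Le_κ]` reaches over the contours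
`Γ_{c,x}`, `x ∈ B(Ly)`, i.e. ONE BLOCK BEYOND the block in the directions transverse to `κ`; so the coarse plaquette
`V̄(∂P)`, `P = (y; μ < ν)`, feels the fine flux in `B(Ly) ∪ B(Ly + Le_μ) ∪ B(Ly + Le_ν)`, with (in the abelian,
linearised picture) TENT weights of total mass `L^{4−d}·#(fine plaquettes of the block)` — whereas the fine action of
`W({y})` counts the block's own plaquettes with weight one.  The difference of the two weight systems has ZERO MASS but
NON-ZERO FIRST MOMENT across the block boundary.  On a whole torus (or for periodic `V`, summing over all blocks) the
first moments telescope to zero, which is why the torus heuristics of Appendix β §3 (and the linear model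
`T4AveragingDeficit`) see a deficit quadratic in `∇F`; on a FINITE window they do not, and `𝓓_{W(Y)}` acquires a term
LINEAR in the flux gradient times the flux, `≍ a·δ`, against the right-hand side `C(δ² + a³)` of (β′).  WITNESS
(§2, abelian = centre-valued configurations, where (9)/(42)/(44) are evaluated EXACTLY by §1): on `ℤ^{d+2}`,
`V_{b,δ}(x, e₁) = e^{iΦ(x₀)}·1`, `V_{b,δ}(x, e_μ) = 1` (`μ ≠ 1`), `Φ(t) = bt + δ(t−2)₊`, so the only non-trivial
plaquettes are the `(e₀,e₁)`-plaquettes, with angle `θ(x₀) = b + δ·1_{x₀ ≥ 2}`: constant flux `b` inside the block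
`{0,1}^{d+2}` of the origin, `b + δ` from the next block on.  CLOSED FORM (§2 `deficit_fam`):
`𝓓_{W({0})}(V_{b,δ}) = 2^{d+2}·[(1 − cos(4b+δ))/16 − (1 − cos b)]` (coarse angle `4b + δ` = tent weights `(1,2,1)` on
`θ(0), θ(1), θ(2) = b, b, b+δ`; `2^{d+2}` fine plaquettes of angle `b`; `L^{d−4} = 2^{d+2}/16`)
`= 2^{d+2}[bδ/4 + δ²/32 − O((b+δ)⁴)]`, while `‖∇_V F‖²_{ℓ²(N_R)} ≤ K δ²`, `K = 2^{d+2}(2R+1)^{d+2}(d+2)³`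
(§2 `gradFluxSq_fam_le`), and `V_{b,δ}` is unitary and in `SmallField V a` as soon as `b + δ ≤ a`.  ENDGAME (§3): with
`C⁺ = max(C,1)`, `s = 1/(8C⁺K)`, `a = min(a₀, s/(8C⁺), 1/4)`, `b = a/2`, `δ = sa`:
`𝓓 ≥ (3s/8)a² > (s/4)a² ≥ C(‖∇F‖² + a³·1)` — contradiction (`Real.cos_bound`, `Real.one_sub_sq_div_two_le_cos`,
`linarith`).  Two-engine numerics of the same family and of generic non-abelian data preceded the kernel proof (record
§0 (v); evidence `wall_probe.py` / `.out` in the unit scratch).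

CITATION HEADER (lean-in-tree rule 2026-08-18).  No sentence of any paper is used as a hypothesis; the manuscripts under
audit are not cited for any disputed step; every declaration is [folklore] (elementary bookkeeping, explicit families,
real inequalities) or a kernel-checked identity.  The `[cite:]` tags of §1 mark the printed FORMULAS — B7 (9) p. 18 with
the path conventions of p. 24 (parallel transport along a contour), (42) p. 23 (the average `V̄ = exp[Σ_x L^{−d} log
(V(Γ_{c,x})V(c)⁻¹)]·V(c)`), (44) p. 24 (the `L`-plaquette variable) — whose TREE TRANSCRIPTIONS (`B7Prop1Explicit.hol`,
`Wcx`, `Xavg`, `bavg`, `cplaq`; kernel definitions, not quotations) are EVALUATED here, by name, on centre-valued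
configurations: context, not hypotheses.  Source: T. Bałaban, *Averaging operations for lattice gauge theories*, Commun.
Math. Phys. **98** (1985) 17–51 [Balaban1985Averaging] («B7»).  Companions, used BY NAME: `T4AveragingDeficitWall`
(v1.1 p190545: `Plane`, `Plaq`, `Bond`, `nReTr`, `wt`, `wt_one`, `fhol`, `chol`, `fineAction`, `coarseAction`,
`deficit`, `Ad`, `flux`, `covGrad`, `gradFluxSq`, `box`, `nbhd`, `IsUnitaryCfg`, `SmallField`, `block`, `blockSites`,
`blockWindow`, `DeficitDerivWall`, `DeficitValueWall`, `ClaimBeta`), `T4AveragingDeficitWallLocal` (v1 p190671: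
`ClaimBetaDeriv`), `BlockAveragingFederbushRadius` (`FederbushMean.cexp_smul_one` : `e^c·1 = exp (c·1)`,
`FederbushMean.norm_smul_one_eq` : `‖c·1‖ = |c|` — reused, not restated), `B7Prop1Explicit` (`Site`, `e`, `e_apply`, `Letter`, `Letter.vec`, `stepHol`, `hol`, `hol_cons`,
`stepA`, `stepA_true`, `stepA_false`, `asum`, `asum_cons`, `asum_append`, `asum_gammaWord`, `asum_plaqWord`, `rectWord`,
`corner_cancellation` ((48), first equality), `stokes` ((48), second equality), `seg`, `seg_natCast`, `disp`,
`disp_replicate`, `treeWord`, `gammaWord`, `plaqWord`, `boxVec`, `Wcx`, `Xavg`, `bavg`, `cplaq`, `expUnit`,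
`val_expUnit`, `val_inv_expUnit`, `units_val_inv_eq_exp_neg`), `B7Prop2Explicit` (`unitaryUnits`,
`mem_unitaryUnits`), `B7BlockAvgLog` (`mlog_exp`: the series log inverts `exp` on `‖C‖ < ln 2`), `MatrixLog` (`mlog`),
Mathlib (`NormedSpace.exp_add_of_commute`, `Complex.exp_ofReal_mul_I_re`,
`Complex.norm_exp_ofReal_mul_I`, `Real.norm_exp_I_mul_ofReal_sub_one_le`, `Real.cos_bound`,
`Real.one_sub_sq_div_two_le_cos`, `sq_sum_le_card_mul_sum_sq` (Cauchy–Schwarz / Jensen), `Int.induction_on`,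
`Int.mul_ediv_add_emod` / `Int.emod_emod_of_…`-family (division with remainder, wrap-around), `Real.log_two_gt_d9`, `Fin.insertNthEquiv`, `Pi.card_Icc`, `Int.card_Icc`,
`Fintype.card_fun`, `Fintype.card_subtype_le`, `List.finRange_succ`).
[cite: Balaban1985Averaging, (9) p.18, (42) p.23, (44) p.24 (the averaging formulas — context; tree transcriptions
`B7Prop1Explicit.hol` / `bavg` / `cplaq` evaluated by name)]

DICTIONARY (scale-free setting of the companions: unit fine lattice `ℤ^{d}`, here `ℤ^{d+2}` so that every dimension
`≥ 2` is covered by one proof; coarse spacing `L = 2`).  `scalarCfg f` ↔ the centre-valued configuration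
`V(x,κ) = e^{f(x,κ)}·1`; `asum f x w` (tree) ↔ the additive path functional `A(Γ)` with `V(Γ) = e^{A(Γ)}·1`
(`val_hol_scalarCfg`); `Xi L f q κ` ↔ the scalar `Ξ(q,κ) = Σ_r L^{−d}(A(Γ_{c,x_r}) − A(c))` with `X_c = Ξ·1`
(`Xavg_scalarCfg`, inside the log branch `|A(Γ_{c,x_r}) − A(c)| < ln 2`) and `V̄(q,κ) = e^{Ξ + A(c)}·1`
(`bavg_scalarCfg`); `prof b δ` ↔ `Φ`, `theta b δ` ↔ `θ`, `famF`/`famV b δ` ↔ `V_{b,δ}`; `π₀` ↔ the plane `(e₀,e₁)`;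
`cflux`, `ccoarse` ↔ the fine / coarse plaquette angles of the family; `Kconst d R` ↔ `K`; `gradFluxL1` ↔
`‖∇_V F‖_{ℓ¹}`; `IsPeriodicCfg V P` ↔ `P`-periodicity in every lattice direction; `periodBox M` ↔ the coarse sites
`[0,M)^{d}` of the torus of coarse side `M`.

WHAT IS PROVED (all [folklore], sorry-free).  §1 (centre-valued calculus, any `d`, `L`): `exp_add_smul_one`,
`mlog_exp_smul_one`, `Ad_smul_one`, `wt_expUnit_smul_one` (`1 − Re tr e^{it}·1/N = 1 − cos t`),
`smul_one_mem_unitary`, def `scalarCfg`, `val_hol_scalarCfg` ((9): `V(Γ) = e^{A(Γ)}·1`), `val_Wcx_scalarCfg`, def `Xi`,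
`Xavg_scalarCfg`, `bavg_scalarCfg` ((42)), `val_cplaq_of_scalar` ((44)).  §2 (the family on `ℤ^{d+2}`, `L = 2`): defs
`prof`, `theta`, `famF`, `famV`, `phiR`, `xiR`, `gR`, `famG`, `π₀`, `pq`, `cflux`, `ccoarse`, `Kconst`; the path sums
`asum_replicate_fam`, `asum_flatMap_seg_fam`, `asum_treeWord_fam`, `phi_fam` ((42)'s contour exponents in closed form),
`abs_phiR_le`, `phi_fam_small` (log branch), `sum_pi_fin_two`, `Xi_fam`, `bavg_fam` (`V̄ = e^{ig}·1`), `gR_plaq`,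
`chol_fam` (coarse angle `4b+δ` in `(e₀,e₁)`, `0` elsewhere), `asum_plaqWord_fam`, `abs_pq_le`, `pq_plane`, `fhol_fam`,
`isUnitaryCfg_fam`, `smallField_fam` (`b + δ ≤ a ⇒ SmallField`), `flux_fam`, `norm_covGrad_fam_le` (`≤ δ`), `card_box`,
`card_nbhd_block_le`, `card_plane_le`, `eight_le_Kconst`, `gradFluxSq_fam_le` (`≤ Kδ²`), `two_zpow_sub_four`,
`deficit_fam` (THE CLOSED FORM).  §3 `not_deficitValueWall`, `not_claimBeta`, `not_claimBetaDeriv`,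
`not_deficitValueWall_four`, `not_claimBeta_four`, `not_claimBetaDeriv_four`.  §4 defs `gradFluxL1`,
`DeficitValueWallLoc`, `IsPeriodicCfg`, `periodBox`, `DeficitValueWallPer`, `ClaimBetaLoc`, `ClaimBetaPer` (STATEMENTS
ONLY); `DeficitValueWall.loc` (β′ ⇒ β′-loc for `C ≥ 0`, so β′-loc is the weaker wall), `ClaimBeta.loc`,
`isPeriodicCfg_flat`, `two_mul_delta_le_gradFluxL1_fam` (on the refuting family the restored first-order term is
`≥ 2δ`, matching the deficit's `≍ aδ`: the family does NOT refute β′-loc).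
§5 [v1.1] (THE EXACT ABELIAN STENCIL, any `d`, `L ≥ 1`, any window pair): defs `SmallExp` (the log branch of
(42) on all bonds), `bondExp`, `stencilExp`, `imCfg` (`iA`), `stencilAngle`, `plaqAngle`, `stencilDeficit`, `famA`;
`sum_weights_complex`, `bondExp_eq`, `bondExp_plaq` ((48) averaged: tree `corner_cancellation`), `bavg_scalarCfg_eq`,
`val_cplaq_bavg_scalarCfg` (`V̄(∂P) = e^{Σ_r L^{−d}A(∂(P)_{Lz+r})}·1` — the non-linear average (42)/(44) restricted to
small-exponent scalar configurations IS the linear block stencil, no corrections), `chol_scalarCfg`,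
`stencilExp_eq_sum_plaq` / `stencilAngle_eq_sum_plaq` (Stokes form, tree `stokes`), `stepA_imCfg`, `asum_imCfg`,
`isUnitaryCfg_imCfg`, `smallExp_imCfg_iff`, `stencilExp_imCfg`, `wt_chol_imCfg` (`= 1 − cos Θ_P`), `wt_fhol_imCfg`
(`= 1 − cos θ_{p′}`), `deficit_imCfg` (`𝓓_W(e^{iA}·1) = stencilDeficit L A W` EXACTLY: the abelian sector of β′-loc / β′-per
is thereby reduced to inequalities for a real functional of cosines of stencil averages — the kernel form of the
identity «engine A = engine C» of the record's numerics), `famF_eq_imCfg`, `smallExp_famF` (the refuting family is in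
the class), `stencilDeficit_zero`.
§6 [v1.2] (THE QUADRATIC / QUARTIC SPLIT of the real functional, any `d`, `L`, window pair): defs `cosRem`
(`r(x) = x²/2 − (1 − cos x)`), `quadDeficit` (the functional of the LINEAR stencil model), `coarseQuartic`, `fineQuartic`;
`one_sub_cos_eq`, `cosRem_nonneg`, `cosRem_le` / `abs_cosRem_le` (`≤ 5x⁴/96` on `|x| ≤ 1`, Mathlib `Real.cos_bound`),
`stencilDeficit_eq_quad_sub` (exact split), `stencilDeficit_le_quad`, `quad_sub_le_stencilDeficit`,
`abs_stencilDeficit_sub_quad_le` (`|stencilDeficit − quadDeficit| ≤ (5/96)(coarseQuartic + fineQuartic)` when the window's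
angles are `≤ 1`), `abs_stencilAngle_le` (`|Θ_P| ≤ L²·max|θ|`), `abs_stencilAngle_le_one`, `fineQuartic_le`,
`coarseQuartic_le` (quartic budgets `≤ #W·a⁴`-type), `sq_sum_range_le`, `sq_sum_box_le`, `sq_stencilAngle_le` (JENSEN:
`L^d Θ_P² ≤ L² Σ_{r,i,j} θ²`), `zpow_sub_four_eq`, `coarse_quad_term_le` (`L^{d−4}Θ_P²/2 ≤ L^{−2}/2 · Σ_{r,i,j} θ²`: the
coarse quadratic density is dominated by the tent-weighted fine one, pointwise — the heart of the one-sided stability of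
the quadratic stencil deficit).
§7 [v1.3] (WINDOW-LEVEL JENSEN, any `d`, `L ≥ 1`, any finite `Y`): `blockMap_injective` / `blockSites_eq_image` /
`sum_blocks_eq` (the blocks of distinct coarse sites tile `B(Y)` injectively), def `reach` (fine corners reached by the
stencils of `Y` in a plane), `sum_shift_le_sum_reach`, `coarse_plane_le`, `plane_quad_le`, `quadDeficit_blockWindow_le`
(`quadDeficit L A (blockWindow L Y) ≤ ½ Σ_π Σ_{x ∈ reach_π(Y) ∖ B(Y)} θ²_{(x,π)}`: the quadratic stencil deficit of a block
window is at most the fine quadratic action of its OVERHANG plaquettes — one-sided and boundary-located),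
`stencilDeficit_blockWindow_le`, `deficit_imCfg_blockWindow_le` (the same + `(5/96)·fineQuartic` for Bałaban's deficit of
`e^{iA}·1`).  §8 [v1.3] (TORUS-LEVEL JENSEN): def `IsPeriodicForm`, `isPeriodicCfg_imCfg`, `mem_periodBox`,
`blockSites_periodBox` (`B([0,M)^d) = [0,LM)^d`), `asum_add_period`, `periodic_zmul`, `periodic_vec`, `sum_periodBox_shift`
(wrap-around invariance of periodic sums), `plane_quad_torus_le`, `quadDeficit_torus_le` (`≤ 0`: block averaging does not
increase the quadratic action on the torus), `stencilDeficit_torus_le`, `deficit_imCfg_torus_le` /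
`deficit_imCfg_torus_le_quartic` (for a periodic small-exponent abelian `e^{iA}·1` with fine angles `≤ a ≤ 1`, Bałaban's
deficit of the full period window is `≤ (5/96)·Σθ⁴ ≤ (5/96)·#plaquettes·a⁴` — the inequality of `DeficitValueWallPer` ON
THE ABELIAN CLASS, upper half, with no positive part of order `a`, `a²`, `a³`).
§9 [v1.4] (THE EXACT VARIANCE FORM): `sum_sum_sub_sq` (finite variance identity), defs `stencilIdx` (`card_stencilIdx`:
`L^{d+2}`), `stencilOff`, `stencilPVar` (the stencil pair variance `Σ_{k,k'}(θ_{z+off k} − θ_{z+off k'})²`),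
`stencilAngle_eq_sum_idx`, `coarse_quad_term_eq` (`L^{d−4}Θ_P²/2 = (L^{−2}/2)Σ_kθ² − (L^{−(d+4)}/4)·stencilPVar`, exact),
`sum_periodBox_stencilIdx` (block-and-shift resummation on the torus), `quadDeficit_torus_eq` (for a form of period `LM`:
`quadDeficit L A (blockWindow L [0,M)^d) = −(L^{−(d+4)}/4)·Σ_πΣ_y stencilPVar` EXACTLY — Federbush's abelian identity for
Bałaban's own average).  §10 [v1.4] (THE STENCIL POINCARÉ INEQUALITY AND THE LOWER HALF): def `fdiff`, `sq_sub_le_line`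
(1-D telescoping + Cauchy–Schwarz), `sum_line_le_periodBox`, `boxVec_update_add`, `sq_sub_block_le` (block telescoping by
induction on the coordinate support, constant `2^{#s}·L`), defs `gradSq`, `poincareConst` (`12·L^{d+2}(L²+L³+2^dL^{d+3})`),
`sq_sub_corner_le`, `sum_sum_sub_sq_le`, `sum_stencilIdx_eq`, `sumK_nu_eq`, `sumK_mu_le`,
`sumK_block_le`, `stencil_poincare` (`Σ_{k,k'}(g(off k) − g(off k'))² ≤ C_P·Σ_k gradSq g (off k)`), `stencilPVar_le`,
the def `lowerConst` (`3(L²+L³+2^dL^{d+3})`), `gradSq_periodic`, `quadDeficit_torus_ge` (`≥ −C_low·Σ_πΣ_{x∈[0,LM)^d} gradSq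
θ_π`), `deficit_imCfg_torus_ge`, `abs_deficit_imCfg_torus_le` (THE TWO-SIDED ABELIAN β′-per in angle variables).  §11 [v1.4]
(THE DICTIONARY): `card_periodBox`, `flux_imCfg` (`F = iθ·1` on the principal branch `|θ| < ln 2`), `covGrad_flux_imCfg`,
`gradFluxSq_imCfg` (`gradFluxSq (e^{iA}·1) N = Σ_πΣ_{x∈N} gradSq θ_π x`), def `wallConst`
(`C_low + (5/96)·#planes·(L^d + L^{d+4})`), `deficit_imCfg_wallPer`: for every `L, M ≥ 1` and every real form `A` of period
`LM` with small exponents, `|θ| ≤ a`, `0 ≤ a`, `L²a ≤ 1`, `a < ln 2`: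
`|𝓓_{(42)}(e^{iA}·1; blockWindow L [0,M)^d)| ≤ C_{β′}(d,L)·(gradFluxSq (e^{iA}·1) (blockSites L [0,M)^d) + a³M^d)` — THE
INEQUALITY OF `DeficitValueWallPer` ON THE ABELIAN CLASS, BOTH HALVES, IN THE WALL'S OWN CURRENCY, explicit constant.

NOT CLAIMED.  Anything about (β) = `DeficitDerivWall` / `DeficitDerivWallAt` / `DeficitDerivBoundAt` (the derivative
wall is untouched and remains the open analytic input of NE3, GAPS G-ne3p2-1); anything about a bound printed by
Bałaban (the refuted statement is OUR finite-window transcription, which dropped the boundary term that the torus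
bookkeeping of Appendix β §3 cancels by telescoping); β′-loc / β′-per themselves (`DeficitValueWallLoc`,
`DeficitValueWallPer`, `ClaimBetaLoc`, `ClaimBetaPer` — [analysis], asserted nowhere, hypotheses of no theorem); `L ≥ 3`
(the same family with `Φ(t) = bt + δ(t−L)₊` gives `𝓓 ≍ L^{d−1}·bδ` by the same computation — [analysis], record
Appendix β §9; kernel: `L = 2` only); dimension `d = 1` (no planes: vacuous); §5, §9, §11 are IDENTITIES on the
small-exponent abelian class (§11 on the principal branch); §6–§8, §10 are elementary real analysis of the resulting
functional (Taylor split, Jensen, block tiling, wrap-around, staircase telescoping) and bound Bałaban's deficit ONLY for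
abelian `e^{iA}·1`: on the TORUS two-sidedly — `deficit_imCfg_wallPer` is the inequality of `DeficitValueWallPer` on the
abelian class under FORM-LEVEL hypotheses (small exponents `SmallExp`, true plaquette angles `|θ| ≤ a`, `0 ≤ a`, `L²a ≤ 1`,
`a < ln 2` — NOT the gauge-invariant `SmallField V a` of the wall, whose angles are determined mod `2π` only; crude
polynomial constant `wallConst d L`, no optimisation); on BLOCK WINDOWS of `ℤ^d` one-sidedly from ABOVE and in OVERHANG
currency only (§7; the β′-loc currency `a·‖∇F‖₁` needs a pairing bound NOT proved here, and the lower half on block windows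
is NOT proved); everything NON-ABELIAN (the commutator corrections of (42) at order `a·‖∇F‖`) is NOT claimed;
`DeficitValueWallLoc`, `DeficitValueWallPer`, `ClaimBetaLoc`, `ClaimBetaPer` remain asserted nowhere).  Record: HOME/t4/T4-EST-NE3-P2.md v1.29
§0 (v)–(viii), Appendix β v0.16 §9; GAPS G-ne3p2-1.  Version: v1.4 = v1.3 (p192396, commit ab8c3459dd2d; §7–§8 window-level and torus-level Jensen; v1.2 = p192230 commit 8457bfff410a §6;
v1.1 = p191870 commit cb150f8e09ae §5; v1 = p191520 commit 0aa9d9aa3379 §1–§4) + §9–§11 APPEND-ONLY (exact variance form,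
stencil Poincaré inequality and lower half on the torus, dictionary to `gradFluxSq` and the abelian β′-per in the wall's
currency; nothing about non-abelian configurations; §1–§8 unchanged byte for byte; companions unchanged; resubmission of
p192655, which bounced `dedup.landed` on a restated `boxVec_injective` — the copy is deleted and injectivity of `boxVec` is
used inline, cf. `T4TermwiseTorus.boxVec_injective`).
-/

set_option autoImplicit false

open scoped BigOperators Matrix.Norms.L2Operator
open NormedSpace Finset

namespace Literature.MathematicalPhysics.QuantumFieldTheory.Balaban1983to89.T4AveragingDeficitWallBoundary

open B7Prop1Explicit B7Prop2Explicit MatrixLog UnitaryModel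
open FederbushMean (cexp_smul_one norm_smul_one_eq)
open T4AveragingDeficitWall hiding Site Plane Plaq Bond
open T4AveragingDeficitWallLocal hiding Site Plaq

noncomputable section

variable {d : ℕ} {n : Type*} [Fintype n] [DecidableEq n]

/-- Sites of `ℤ^d` (restated to beat the `Setup.Site` shadowing, as in the companions). [folklore] -/
abbrev Site (d : ℕ) : Type := Fin d → ℤ
/-- Planes `μ < ν`. [folklore] -/
abbrev Plane (d : ℕ) : Type := T4AveragingDeficitWall.Plane d
/-- Plaquettes. [folklore] -/
abbrev Plaq (d : ℕ) : Type := T4AveragingDeficitWall.Plaq d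
/-- Bonds. [folklore] -/
abbrev Bond (d : ℕ) : Type := T4AveragingDeficitWall.Bond d

/-! ## §1 Centre-valued («scalar», abelian) configurations: the exact calculus of (9), (42), (44) (any `d`, `L`) -/

/-- Scalars commute. [folklore] -/
theorem commute_smul_one (a b : ℂ) : Commute (a • (1 : Matrix n n ℂ)) (b • (1 : Matrix n n ℂ)) :=
  ((Commute.refl (1 : Matrix n n ℂ)).smul_left a).smul_right b

/-- `e^{(a+b)·1} = e^{a·1} e^{b·1}`. [folklore] -/
theorem exp_add_smul_one (a b : ℂ) :
    exp ((a + b) • (1 : Matrix n n ℂ)) = exp (a • (1 : Matrix n n ℂ)) * exp (b • (1 : Matrix n n ℂ)) := by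
  letI : NormedAlgebra ℚ (Matrix n n ℂ) := NormedAlgebra.restrictScalars ℚ ℂ (Matrix n n ℂ)
  rw [add_smul, exp_add_of_commute (commute_smul_one a b)]

/-- `log e^{z·1} = z·1` for `|z| < ln 2` (the series log (21) inverts `exp` near `1`: tree `B7BlockAvgLog.mlog_exp`).
[folklore] -/
theorem mlog_exp_smul_one [Nonempty n] {z : ℂ} (hz : ‖z‖ < Real.log 2) :
    mlog (exp (z • (1 : Matrix n n ℂ))) = z • (1 : Matrix n n ℂ) :=
  B7BlockAvgLog.mlog_exp (by rwa [norm_smul_one_eq])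

/-- `Ad_u (c·1) = c·1`. [folklore] -/
theorem Ad_smul_one (u : (Matrix n n ℂ)ˣ) (c : ℂ) : Ad u (c • (1 : Matrix n n ℂ)) = c • (1 : Matrix n n ℂ) := by
  rw [Ad, mul_smul_comm, mul_one, smul_mul_assoc, Units.mul_inv]

/-- The Wilson weight of a scalar: `1 − Re tr e^{it}·1 / N = 1 − cos t`. [folklore] -/
theorem wt_expUnit_smul_one [Nonempty n] (t : ℝ) :
    wt (expUnit ((((t : ℂ) * Complex.I)) • (1 : Matrix n n ℂ))) = 1 - Real.cos t := by
  have hk : (Fintype.card n : ℝ) ≠ 0 := by exact_mod_cast Fintype.card_ne_zero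
  rw [wt, val_expUnit, ← cexp_smul_one, nReTr, Matrix.trace_smul, Matrix.trace_one, smul_eq_mul,
    Complex.mul_re, Complex.exp_ofReal_mul_I_re]
  simp only [Complex.natCast_re, Complex.natCast_im, mul_zero, sub_zero]
  field_simp

/-- A unit-modulus scalar is unitary. [folklore] -/
theorem smul_one_mem_unitary {c : ℂ} (hc : ‖c‖ = 1) : c • (1 : Matrix n n ℂ) ∈ unitary (Matrix n n ℂ) := by
  have h1 : (starRingEnd ℂ) c * c = 1 := by
    rw [Complex.conj_mul', hc]; norm_num
  have h2 : c * (starRingEnd ℂ) c = 1 := by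
    rw [Complex.mul_conj', hc]; norm_num
  rw [Unitary.mem_iff, star_smul, star_one, smul_mul_smul_comm, smul_mul_smul_comm, mul_one]
  exact ⟨by rw [show star c = (starRingEnd ℂ) c from rfl, h1, one_smul],
    by rw [show star c = (starRingEnd ℂ) c from rfl, h2, one_smul]⟩

/-- THE SCALAR CONFIGURATION with exponents `f`: `V(x, κ) = e^{f(x,κ)} · 1`. [folklore] -/
def scalarCfg (f : Site d → Fin d → ℂ) : Site d → Fin d → (Matrix n n ℂ)ˣ :=
  fun x μ => expUnit (f x μ • (1 : Matrix n n ℂ))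

/-- One step of transport: `e^{± f}`. [folklore] -/
theorem val_stepHol_scalarCfg (f : Site d → Fin d → ℂ) (x : Site d) (l : Letter d) :
    ((stepHol (scalarCfg (n := n) f) x l : (Matrix n n ℂ)ˣ) : Matrix n n ℂ)
      = exp (stepA f x l • (1 : Matrix n n ℂ)) := by
  rcases l with ⟨μ, _ | _⟩
  · simp only [stepHol_false, stepA_false, scalarCfg, val_inv_expUnit, val_expUnit, neg_smul]
  · simp only [stepHol_true, stepA_true, scalarCfg, val_expUnit]

/-- **(9) FOR A SCALAR CONFIGURATION**: `V(Γ) = e^{A(Γ)} · 1` with the additive path functional `A(Γ)` of p. 24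
(tree `asum`). [cite: Balaban1985Averaging, (9) p.18, p.24] -/
theorem val_hol_scalarCfg (f : Site d → Fin d → ℂ) :
    ∀ (x : Site d) (w : List (Letter d)),
      ((hol (scalarCfg (n := n) f) x w : (Matrix n n ℂ)ˣ) : Matrix n n ℂ) = exp (asum f x w • (1 : Matrix n n ℂ))
  | x, [] => by simp
  | x, l :: w => by
    rw [hol_cons, Units.val_mul, val_stepHol_scalarCfg, val_hol_scalarCfg f (x + l.vec) w, asum_cons,
      exp_add_smul_one]

/-- `hol` as a unit: `V(Γ) = expUnit (A(Γ)·1)`. [folklore] -/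
theorem hol_scalarCfg (f : Site d → Fin d → ℂ) (x : Site d) (w : List (Letter d)) :
    hol (scalarCfg (n := n) f) x w = expUnit (asum f x w • (1 : Matrix n n ℂ)) :=
  Units.ext (val_hol_scalarCfg f x w)

/-- **(42), the contour variable, for a scalar configuration**: `V(Γ_{c,x})V(c)⁻¹ = e^{A(Γ_{c,x}) − A(c)} · 1`.
[cite: Balaban1985Averaging, (42) p.23] -/
theorem val_Wcx_scalarCfg (L : ℕ) (f : Site d → Fin d → ℂ) (q : Site d) (κ : Fin d) (r : Site d) :
    ((Wcx L (scalarCfg (n := n) f) q κ r : (Matrix n n ℂ)ˣ) : Matrix n n ℂ)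
      = exp ((asum f q (gammaWord L κ r) - asum f q (seg κ L)) • (1 : Matrix n n ℂ)) := by
  rw [Wcx, Units.val_mul, val_hol_scalarCfg, units_val_inv_eq_exp_neg (val_hol_scalarCfg f q (seg κ L)),
    ← neg_smul, ← exp_add_smul_one, ← sub_eq_add_neg]

/-- The scalar exponent of (42): `Ξ(q,κ) = Σ_r L^{−d}(A(Γ_{c,x_r}) − A(c))`. [folklore] -/
def Xi (L : ℕ) (f : Site d → Fin d → ℂ) (q : Site d) (κ : Fin d) : ℂ :=
  ∑ r : Fin d → Fin L, ((L : ℂ) ^ d)⁻¹ * (asum f q (gammaWord L κ (boxVec L r)) - asum f q (seg κ L))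

/-- **(42), the exponent, for a scalar configuration inside the log branch**: `X_c = Ξ(q,κ) · 1`.
[cite: Balaban1985Averaging, (42) p.23] -/
theorem Xavg_scalarCfg [Nonempty n] (L : ℕ) (f : Site d → Fin d → ℂ) (q : Site d) (κ : Fin d)
    (h : ∀ r : Fin d → Fin L, ‖asum f q (gammaWord L κ (boxVec L r)) - asum f q (seg κ L)‖ < Real.log 2) :
    Xavg L (scalarCfg (n := n) f) q κ = Xi L f q κ • (1 : Matrix n n ℂ) := by
  unfold Xavg Xi
  rw [Finset.sum_smul]
  refine Finset.sum_congr rfl fun r _ => ?_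
  rw [val_Wcx_scalarCfg, mlog_exp_smul_one (h r), ← Complex.coe_smul, smul_smul]
  congr 1
  push_cast
  ring

/-- **(42) FOR A SCALAR CONFIGURATION**: `V̄(q,κ) = e^{Ξ(q,κ) + A([q, q + Le_κ])} · 1`. [cite: Balaban1985Averaging, (42) p.23] -/
theorem bavg_scalarCfg [Nonempty n] (L : ℕ) (f : Site d → Fin d → ℂ) (q : Site d) (κ : Fin d)
    (h : ∀ r : Fin d → Fin L, ‖asum f q (gammaWord L κ (boxVec L r)) - asum f q (seg κ L)‖ < Real.log 2) :
    bavg L (scalarCfg (n := n) f) q κ = expUnit ((Xi L f q κ + asum f q (seg κ L)) • (1 : Matrix n n ℂ)) := by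
  ext1
  rw [bavg]
  simp only [Units.val_mul, val_expUnit]
  rw [Xavg_scalarCfg L f q κ h, val_hol_scalarCfg, ← exp_add_smul_one]

/-- **(44) FOR SCALAR BOND VARIABLES**: if `W(x,κ) = e^{g(x,κ)}·1` on all bonds then
`W(∂P) = e^{g(z,μ) + g(z+Le_μ,ν) − g(z+Le_ν,μ) − g(z,ν)} · 1`. [cite: Balaban1985Averaging, (44) p.24] -/
theorem val_cplaq_of_scalar (L : ℕ) {W : Site d → Fin d → (Matrix n n ℂ)ˣ} {g : Site d → Fin d → ℂ}
    (hW : ∀ x κ, W x κ = expUnit (g x κ • (1 : Matrix n n ℂ))) (z : Site d) (μ ν : Fin d) :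
    ((cplaq L W z μ ν : (Matrix n n ℂ)ˣ) : Matrix n n ℂ)
      = exp ((g z μ + g (z + (L : ℤ) • e μ) ν - g (z + (L : ℤ) • e ν) μ - g z ν) • (1 : Matrix n n ℂ)) := by
  rw [cplaq]
  simp only [Units.val_mul, hW, val_inv_expUnit, val_expUnit, ← neg_smul]
  rw [← exp_add_smul_one, ← exp_add_smul_one, ← exp_add_smul_one]
  congr 2


/-! ## §2 The boundary-layer family on `ℤ^{d+2}` (every dimension `≥ 2`; `L = 2`): potential
`Φ(t) = bt + δ(t−2)₊`, flux angle `θ(t) = Φ(t+1) − Φ(t) = b + δ·1_{t ≥ 2}`, `V(x,e₁) = e^{iΦ(x₀)}·1`, all other bonds `1` -/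

section Family

variable (b δ : ℝ)

/-- The potential `Φ(t) = bt + δ(t − 2)₊`. [folklore] -/
def prof (t : ℤ) : ℝ := b * t + if 2 ≤ t then δ * ((t : ℝ) - 2) else 0

/-- The plaquette angle `θ(t) = Φ(t+1) − Φ(t) = b + δ·1_{t ≥ 2}`. [folklore] -/
def theta (t : ℤ) : ℝ := b + if 2 ≤ t then δ else 0

/-- `Φ(t+1) − Φ(t) = θ(t)`. [folklore] -/
theorem prof_succ_sub (t : ℤ) : prof b δ (t + 1) - prof b δ t = theta b δ t := by
  unfold prof theta
  by_cases h2 : (2 : ℤ) ≤ t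
  · rw [if_pos (show (2 : ℤ) ≤ t + 1 by omega), if_pos h2, if_pos h2]; push_cast; ring
  · by_cases h1 : (2 : ℤ) ≤ t + 1
    · have ht : t = 1 := by omega
      subst ht
      rw [if_pos h1, if_neg h2, if_neg h2]; push_cast; ring
    · rw [if_neg h1, if_neg h2, if_neg h2]; push_cast; ring

/-- `Φ(t+2) − Φ(t) = θ(t) + θ(t+1)`. [folklore] -/
theorem prof_add_two_sub (t : ℤ) : prof b δ (t + 2) - prof b δ t = theta b δ t + theta b δ (t + 1) := by
  have h1 := prof_succ_sub b δ t
  have h2 := prof_succ_sub b δ (t + 1)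
  rw [show t + 1 + 1 = t + 2 by ring] at h2
  linarith

/-- `Φ(0) = 0`. [folklore] -/
theorem prof_zero : prof b δ 0 = 0 := by simp [prof]
/-- `Φ(1) = b`. [folklore] -/
theorem prof_one : prof b δ 1 = b := by norm_num [prof]
/-- `Φ(2) = 2b`. [folklore] -/
theorem prof_two : prof b δ 2 = 2 * b := by norm_num [prof]; ring
/-- `Φ(3) = 3b + δ`. [folklore] -/
theorem prof_three : prof b δ 3 = 3 * b + δ := by norm_num [prof]; ring

/-- `θ(t) = b` below the step. [folklore] -/
theorem theta_of_lt {t : ℤ} (h : t < 2) : theta b δ t = b := by simp [theta, not_le.mpr h]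

/-- `|θ(t)| ≤ b + δ` for `b, δ ≥ 0`. [folklore] -/
theorem abs_theta_le (hb : 0 ≤ b) (hδ : 0 ≤ δ) (t : ℤ) : |theta b δ t| ≤ b + δ := by
  unfold theta; rw [abs_le]; split_ifs <;> constructor <;> linarith

/-- `|θ(t) − θ(t′)| ≤ δ` for `δ ≥ 0`. [folklore] -/
theorem abs_theta_sub_le (hδ : 0 ≤ δ) (t t' : ℤ) : |theta b δ t - theta b δ t'| ≤ δ := by
  unfold theta; rw [abs_le]; split_ifs <;> constructor <;> linarith

/-- `|x·i| = |x|`. [folklore] -/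
theorem norm_real_mul_I (x : ℝ) : ‖((x : ℂ)) * Complex.I‖ = |x| := by
  rw [norm_mul, Complex.norm_I, mul_one, Complex.norm_real, Real.norm_eq_abs]

/-! ### Coordinates `0 ≠ 1` of `ℤ^{d+2}` -/

/-- `1 ≠ 0` in `Fin (d+2)`. [folklore] -/
theorem fin_one_ne_zero : (1 : Fin (d + 2)) ≠ 0 := by simp

/-- `0 ≠ 1` in `Fin (d+2)`. [folklore] -/
theorem fin_zero_ne_one : (0 : Fin (d + 2)) ≠ 1 := fin_one_ne_zero.symm

/-- Moving along `e_ν`, `ν ≠ 0`, does not change the `0`-th coordinate. [folklore] -/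
theorem add_zsmul_e_apply_zero {ν : Fin (d + 2)} (hν : ν ≠ 0) (x : Site (d + 2)) (c : ℤ) :
    (x + c • e ν) 0 = x 0 := by
  simp [e_apply, Ne.symm hν]

/-- Moving along `e_ν`, `ν ≠ 0`, does not change the `0`-th coordinate. [folklore] -/
theorem add_e_apply_zero {ν : Fin (d + 2)} (hν : ν ≠ 0) (x : Site (d + 2)) : (x + e ν) 0 = x 0 := by
  simp [e_apply, Ne.symm hν]

/-- Moving along `e₀` shifts the `0`-th coordinate. [folklore] -/
theorem add_zsmul_e_zero_apply_zero (x : Site (d + 2)) (c : ℤ) : (x + c • e (0 : Fin (d + 2))) 0 = x 0 + c := by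
  simp [e_apply]

/-- Moving along `e₀` shifts the `0`-th coordinate. [folklore] -/
theorem add_e_zero_apply_zero (x : Site (d + 2)) : (x + e (0 : Fin (d + 2))) 0 = x 0 + 1 := by
  simp [e_apply]

/-! ### The family and its path functional -/

/-- The exponents of the family: `f(x,e₁) = iΦ(x₀)`, `f(x,e_μ) = 0` (`μ ≠ 1`). [folklore] -/
def famF : Site (d + 2) → Fin (d + 2) → ℂ :=
  fun x μ => if μ = 1 then ((prof b δ (x 0) : ℝ) : ℂ) * Complex.I else 0

/-- THE FAMILY `V_{b,δ}(x,e₁) = e^{iΦ(x₀)}·1`, `V_{b,δ}(x,e_μ) = 1` (`μ ≠ 1`), on `ℤ^{d+2}`. [folklore] -/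
def famV : Site (d + 2) → Fin (d + 2) → (Matrix n n ℂ)ˣ := scalarCfg (famF b δ)

/-- `f(x,e₁) = iΦ(x₀)`. [folklore] -/
@[simp] theorem famF_one (x : Site (d + 2)) : famF b δ x 1 = ((prof b δ (x 0) : ℝ) : ℂ) * Complex.I := by
  simp [famF]

/-- `f(x,e_μ) = 0` for `μ ≠ 1`. [folklore] -/
theorem famF_of_ne_one (x : Site (d + 2)) {μ : Fin (d + 2)} (hμ : μ ≠ 1) : famF b δ x μ = 0 := by
  simp [famF, hμ]

/-- `A` along `m` steps in direction `κ` from `p`: `m·iΦ(p₀)` if `κ = 1`, else `0`. [folklore] -/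
theorem asum_replicate_fam (κ : Fin (d + 2)) (m : ℕ) : ∀ p : Site (d + 2),
    asum (famF b δ) p (List.replicate m ((κ, true) : Letter (d + 2)))
      = if κ = 1 then (m : ℂ) * (((prof b δ (p 0) : ℝ) : ℂ) * Complex.I) else 0 := by
  induction m with
  | zero => intro p; simp
  | succ m ih =>
    intro p
    rw [List.replicate_succ, asum_cons, ih, stepA_true]
    by_cases hκ : κ = 1
    · subst hκ
      rw [if_pos rfl, if_pos rfl, famF_one]
      have : (p + Letter.vec (((1 : Fin (d + 2)), true) : Letter (d + 2))) 0 = p 0 := by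
        simp [e_apply]
      rw [this]; push_cast; ring
    · rw [if_neg hκ, if_neg hκ, famF_of_ne_one b δ p hκ, add_zero]

/-- `A([p, p + 2e_κ])`. [folklore] -/
theorem asum_seg_two_fam (κ : Fin (d + 2)) (p : Site (d + 2)) :
    asum (famF b δ) p (seg κ ((2 : ℕ) : ℤ))
      = if κ = 1 then (2 : ℂ) * (((prof b δ (p 0) : ℝ) : ℂ) * Complex.I) else 0 := by
  rw [seg_natCast, asum_replicate_fam]; push_cast; rfl

/-- The tree part: along a duplicate-free list of directions avoiding `e₀`, only the `e₁`-segment contributes, and it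
sees the ORIGINAL `0`-th coordinate. [folklore] -/
theorem asum_flatMap_seg_fam (r : Fin (d + 2) → Fin 2) : ∀ (l : List (Fin (d + 2))) (q : Site (d + 2)),
    (0 : Fin (d + 2)) ∉ l → l.Nodup →
    asum (famF b δ) q (l.flatMap fun κ => seg κ (boxVec 2 r κ))
      = if (1 : Fin (d + 2)) ∈ l then ((r 1 : ℕ) : ℂ) * (((prof b δ (q 0) : ℝ) : ℂ) * Complex.I) else 0 := by
  intro l
  induction l with
  | nil => intro q _ _; simp
  | cons κ l ih =>
    intro q h0 hnd
    have hκ0 : κ ≠ 0 := fun h => h0 (h ▸ List.mem_cons_self)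
    have h0l : (0 : Fin (d + 2)) ∉ l := fun h => h0 (List.mem_cons_of_mem _ h)
    have hndl : l.Nodup := (List.nodup_cons.mp hnd).2
    have hκl : κ ∉ l := (List.nodup_cons.mp hnd).1
    rw [List.flatMap_cons, asum_append, ih _ h0l hndl]
    have hbv : boxVec 2 r κ = ((r κ : ℕ) : ℤ) := rfl
    rw [hbv, seg_natCast, asum_replicate_fam, disp_replicate]
    have hq : (q + ((r κ : ℕ) : ℤ) • Letter.vec (((κ, true)) : Letter (d + 2))) 0 = q 0 := by
      simp [e_apply, Ne.symm hκ0]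
    rw [hq]
    by_cases hκ1 : κ = 1
    · subst hκ1
      rw [if_pos rfl, if_neg hκl, if_pos List.mem_cons_self, add_zero]
    · rw [if_neg hκ1, zero_add]
      have : ((1 : Fin (d + 2)) ∈ κ :: l) ↔ (1 : Fin (d + 2)) ∈ l := by
        rw [List.mem_cons]; exact ⟨fun h => h.resolve_left (fun h1 => hκ1 h1.symm), Or.inr⟩
      simp only [this]

/-- `A(Γ^{tree}_{q, q + r}) = r₁ · iΦ(q₀)` for `r ∈ {0,1}^{d+2}`. [folklore] -/
theorem asum_treeWord_fam (q : Site (d + 2)) (r : Fin (d + 2) → Fin 2) :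
    asum (famF b δ) q (treeWord (boxVec 2 r)) = ((r 1 : ℕ) : ℂ) * (((prof b δ (q 0) : ℝ) : ℂ) * Complex.I) := by
  rw [treeWord, List.finRange_succ, List.reverse_cons, List.flatMap_append, asum_append, List.flatMap_cons,
    List.flatMap_nil, List.append_nil]
  have hbv : boxVec 2 r 0 = ((r 0 : ℕ) : ℤ) := rfl
  rw [hbv, seg_natCast, asum_replicate_fam, if_neg fin_zero_ne_one, add_zero]
  have h0 : (0 : Fin (d + 2)) ∉ ((List.finRange (d + 1)).map Fin.succ).reverse := by
    rw [List.mem_reverse, List.mem_map]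
    rintro ⟨j, _, hj⟩
    exact Fin.succ_ne_zero j hj
  have hnd : (((List.finRange (d + 1)).map Fin.succ).reverse).Nodup :=
    List.nodup_reverse.mpr ((List.nodup_finRange _).map (Fin.succ_injective _))
  have h1 : (1 : Fin (d + 2)) ∈ ((List.finRange (d + 1)).map Fin.succ).reverse := by
    rw [List.mem_reverse, List.mem_map]
    exact ⟨0, List.mem_finRange 0, rfl⟩
  rw [asum_flatMap_seg_fam b δ r _ q h0 hnd, if_pos h1]

/-- The contour exponents (42) of the family (real part before `·i`): `r₁(Φ(q₀) − Φ(q₀+2))` on `e₀`-bonds,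
`2(Φ(q₀+r₀) − Φ(q₀))` on `e₁`-bonds, `0` otherwise. [folklore] -/
def phiR (t : ℤ) (κ : Fin (d + 2)) (r : Fin (d + 2) → Fin 2) : ℝ :=
  if κ = 0 then (r 1 : ℕ) * (prof b δ t - prof b δ (t + 2))
  else if κ = 1 then 2 * (prof b δ (t + (r 0 : ℕ)) - prof b δ t) else 0

/-- **(42) ON THE FAMILY**: `A(Γ_{c,x_r}) − A(c) = i·phiR`. [folklore] -/
theorem phi_fam (q : Site (d + 2)) (κ : Fin (d + 2)) (r : Fin (d + 2) → Fin 2) :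
    asum (famF b δ) q (gammaWord 2 κ (boxVec 2 r)) - asum (famF b δ) q (seg κ ((2 : ℕ) : ℤ))
      = ((phiR b δ (q 0) κ r : ℝ) : ℂ) * Complex.I := by
  rw [asum_gammaWord, asum_treeWord_fam, asum_seg_two_fam, asum_seg_two_fam, asum_treeWord_fam, phiR]
  have hq : (q + boxVec 2 r) 0 = q 0 + ((r 0 : ℕ) : ℤ) := by simp [boxVec]
  have hq0 : (q + ((2 : ℕ) : ℤ) • e (0 : Fin (d + 2))) 0 = q 0 + 2 := by
    rw [add_zsmul_e_zero_apply_zero]; push_cast; ring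
  by_cases hκ0 : κ = 0
  · subst hκ0
    simp only [fin_zero_ne_one, if_false, if_true, hq0]
    push_cast; ring
  · by_cases hκ1 : κ = 1
    · subst hκ1
      simp only [fin_one_ne_zero, if_false, if_true, hq, add_zsmul_e_apply_zero fin_one_ne_zero]
      push_cast; ring
    · simp only [hκ0, hκ1, if_false, add_zsmul_e_apply_zero hκ0]
      push_cast; ring

/-- `|phiR| ≤ 2(b + δ)`. [folklore] -/
theorem abs_phiR_le (hb : 0 ≤ b) (hδ : 0 ≤ δ) (t : ℤ) (κ : Fin (d + 2)) (r : Fin (d + 2) → Fin 2) :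
    |phiR b δ t κ r| ≤ 2 * (b + δ) := by
  have hθ := abs_theta_le b δ hb hδ
  unfold phiR
  by_cases hκ0 : κ = 0
  · rw [if_pos hκ0]
    have hd : prof b δ t - prof b δ (t + 2) = -(theta b δ t + theta b δ (t + 1)) := by
      have := prof_add_two_sub b δ t; linarith
    have hr : ((r 1 : ℕ) : ℝ) ≤ 1 := by
      have := (r 1).is_lt
      exact_mod_cast (by omega : (r 1 : ℕ) ≤ 1)
    have hr0 : (0 : ℝ) ≤ ((r 1 : ℕ) : ℝ) := by positivity
    rw [hd, abs_mul, abs_of_nonneg hr0, abs_neg]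
    calc ((r 1 : ℕ) : ℝ) * |theta b δ t + theta b δ (t + 1)|
        ≤ 1 * (|theta b δ t| + |theta b δ (t + 1)|) :=
          mul_le_mul hr (abs_add_le _ _) (abs_nonneg _) zero_le_one
      _ ≤ 1 * ((b + δ) + (b + δ)) := by gcongr <;> exact hθ _
      _ = 2 * (b + δ) := by ring
  · rw [if_neg hκ0]
    by_cases hκ1 : κ = 1
    · rw [if_pos hκ1]
      have hr : (r 0 : ℕ) = 0 ∨ (r 0 : ℕ) = 1 := by have := (r 0).is_lt; omega
      rcases hr with hr | hr
      · rw [hr]; simp; positivity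
      · rw [hr]
        have hd : prof b δ (t + ((1 : ℕ) : ℤ)) - prof b δ t = theta b δ t := by
          have := prof_succ_sub b δ t; push_cast; linarith
        rw [hd, abs_mul, abs_two]
        gcongr; exact hθ _
    · rw [if_neg hκ1, abs_zero]; positivity

/-- All contour exponents of the family are inside the log branch when `b + δ ≤ 1/4`. [folklore] -/
theorem phi_fam_small (hb : 0 ≤ b) (hδ : 0 ≤ δ) (hsm : b + δ ≤ 1 / 4) (q : Site (d + 2)) (κ : Fin (d + 2))
    (r : Fin (d + 2) → Fin 2) :
    ‖asum (famF b δ) q (gammaWord 2 κ (boxVec 2 r)) - asum (famF b δ) q (seg κ ((2 : ℕ) : ℤ))‖ < Real.log 2 := by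
  have hlog : (1 : ℝ) / 2 < Real.log 2 := by have := Real.log_two_gt_d9; linarith
  rw [phi_fam, norm_real_mul_I]
  linarith [abs_phiR_le b δ hb hδ (q 0) κ r]

/-- Sums over `{0,1}^{d+2}` of a function of ONE coordinate. [folklore] -/
theorem sum_pi_fin_two (i : Fin (d + 2)) (g : Fin 2 → ℂ) :
    ∑ r : Fin (d + 2) → Fin 2, g (r i) = 2 ^ (d + 1) * ∑ j : Fin 2, g j := by
  rw [← Fintype.sum_equiv (Fin.insertNthEquiv (fun _ => Fin 2) i) (fun p => g p.1) (fun r => g (r i))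
    (fun p => by simp [Fin.insertNthEquiv, Fin.insertNth_apply_same])]
  simp only [Fintype.sum_prod_type, Finset.sum_const, Finset.card_univ, Fintype.card_fun, Fintype.card_fin,
    nsmul_eq_mul, Nat.cast_pow, Nat.cast_ofNat, Finset.mul_sum]

/-- The averaged exponents `Ξ(q,κ)` of the family (real part before `·i`): `(Φ(q₀) − Φ(q₀+2))/2` for `κ = 0`,
`θ(q₀)` for `κ = 1`, `0` otherwise. [folklore] -/
def xiR (t : ℤ) (κ : Fin (d + 2)) : ℝ :=
  if κ = 0 then (prof b δ t - prof b δ (t + 2)) / 2 else if κ = 1 then theta b δ t else 0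

/-- `Ξ` of the family. [folklore] -/
theorem Xi_fam (q : Site (d + 2)) (κ : Fin (d + 2)) :
    Xi 2 (famF b δ) q κ = ((xiR b δ (q 0) κ : ℝ) : ℂ) * Complex.I := by
  unfold Xi
  simp_rw [phi_fam]
  rw [← Finset.mul_sum, ← Finset.sum_mul, ← mul_assoc]
  congr 1
  unfold phiR xiR
  by_cases hκ0 : κ = 0
  · simp_rw [if_pos hκ0]
    push_cast
    rw [← Finset.sum_mul, sum_pi_fin_two 1 (fun j : Fin 2 => ((j : ℕ) : ℂ)), Fin.sum_univ_two]
    simp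
    field_simp
    ring
  · simp_rw [if_neg hκ0]
    by_cases hκ1 : κ = 1
    · simp_rw [if_pos hκ1]
      push_cast
      rw [← Finset.mul_sum,
        sum_pi_fin_two 0 (fun j : Fin 2 => ((prof b δ (q 0 + ((j : ℕ) : ℤ)) : ℝ) : ℂ) - ((prof b δ (q 0) : ℝ) : ℂ)),
        Fin.sum_univ_two, ← prof_succ_sub]
      simp
      field_simp
      ring
    · simp_rw [if_neg hκ1]
      simp

/-- The averaged bond exponents `g(q,κ) = Ξ(q,κ) + A([q, q+2e_κ])` of the family (real part before `·i`):
`(Φ(q₀) − Φ(q₀+2))/2` (`κ = 0`), `Φ(q₀+1) + Φ(q₀)` (`κ = 1`), `0` otherwise. [folklore] -/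
def gR (t : ℤ) (κ : Fin (d + 2)) : ℝ :=
  if κ = 0 then (prof b δ t - prof b δ (t + 2)) / 2 else if κ = 1 then prof b δ (t + 1) + prof b δ t else 0

/-- The averaged bond exponents as a configuration of scalars. [folklore] -/
def famG : Site (d + 2) → Fin (d + 2) → ℂ := fun q κ => ((gR b δ (q 0) κ : ℝ) : ℂ) * Complex.I

/-- **(42) EVALUATED ON THE FAMILY**: `V̄(q,κ) = e^{i g(q₀,κ)}·1`. [folklore] -/
theorem bavg_fam [Nonempty n] (hb : 0 ≤ b) (hδ : 0 ≤ δ) (hsm : b + δ ≤ 1 / 4) (q : Site (d + 2)) (κ : Fin (d + 2)) :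
    bavg 2 (famV (n := n) b δ) q κ = expUnit (famG b δ q κ • (1 : Matrix n n ℂ)) := by
  rw [famV, bavg_scalarCfg 2 (famF b δ) q κ (phi_fam_small b δ hb hδ hsm q κ), Xi_fam, asum_seg_two_fam, famG]
  congr 2
  unfold xiR gR
  by_cases hκ0 : κ = 0
  · rw [if_pos hκ0, if_pos hκ0, if_neg (hκ0 ▸ fin_zero_ne_one), add_zero]
  · rw [if_neg hκ0, if_neg hκ0]
    by_cases hκ1 : κ = 1
    · rw [if_pos hκ1, if_pos hκ1, if_pos hκ1, ← prof_succ_sub]; push_cast; ring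
    · rw [if_neg hκ1, if_neg hκ1, if_neg hκ1]; simp

/-! ### Planes: only the `(0,1)`-plane carries flux -/

/-- The plane `(e₀, e₁)`. [folklore] -/
def π₀ : Plane (d + 2) := ⟨((0 : Fin (d + 2)), (1 : Fin (d + 2))), by
  show (0 : Fin (d + 2)) < 1
  rw [Fin.lt_def]; simp⟩

/-- A plane other than `(e₀,e₁)` has second direction `≠ e₁`. [folklore] -/
theorem snd_ne_one_of_ne {π : Plane (d + 2)} (h : π ≠ π₀) : π.1.2 ≠ 1 := by
  intro h1
  apply h
  have h0 : π.1.1 = 0 := by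
    have hlt : π.1.1 < 1 := h1 ▸ π.2
    exact (Fin.lt_one_iff _).mp hlt
  exact Subtype.ext (Prod.ext h0 h1)

/-- The second direction of a plane is never `e₀`. [folklore] -/
theorem snd_ne_zero (π : Plane (d + 2)) : π.1.2 ≠ 0 :=
  ((Fin.zero_le _).trans_lt π.2).ne'

/-- The plaquette exponent of the family for an arbitrary ordered pair of directions (real part before `·i`).
[folklore] -/
def pq (x : Site (d + 2)) (κ κ' : Fin (d + 2)) : ℝ :=
  (if κ' = 1 then prof b δ ((x + e κ) 0) - prof b δ (x 0) else 0)
    - (if κ = 1 then prof b δ ((x + e κ') 0) - prof b δ (x 0) else 0)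

/-- `A(∂p)` on the family. [folklore] -/
theorem asum_plaqWord_fam (x : Site (d + 2)) (κ κ' : Fin (d + 2)) :
    asum (famF b δ) x (plaqWord κ κ') = ((pq b δ x κ κ' : ℝ) : ℂ) * Complex.I := by
  rw [asum_plaqWord, pq, famF, famF, famF, famF]
  by_cases h1 : κ' = 1 <;> by_cases h2 : κ = 1 <;> simp only [h1, h2, if_true, if_false] <;> push_cast <;> ring

/-- `|A(∂p)| ≤ |θ(x₀)|` on the family for `κ ≠ κ′`. [folklore] -/
theorem abs_pq_le (x : Site (d + 2)) {κ κ' : Fin (d + 2)} (hκ : κ ≠ κ') : |pq b δ x κ κ'| ≤ |theta b δ (x 0)| := by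
  unfold pq
  by_cases h1 : κ' = 1
  · have h2 : κ ≠ 1 := fun h => hκ (h.trans h1.symm)
    rw [if_pos h1, if_neg h2, sub_zero]
    by_cases h0 : κ = 0
    · rw [h0, add_e_zero_apply_zero, prof_succ_sub]
    · rw [add_e_apply_zero h0, sub_self, abs_zero]; exact abs_nonneg _
  · rw [if_neg h1, zero_sub, abs_neg]
    by_cases h2 : κ = 1
    · rw [if_pos h2]
      by_cases h0 : κ' = 0
      · rw [h0, add_e_zero_apply_zero, prof_succ_sub]
      · rw [add_e_apply_zero h0, sub_self, abs_zero]; exact abs_nonneg _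
    · rw [if_neg h2, abs_zero]; exact abs_nonneg _

/-- The fine fluxes of the family (real part before `·i`): `θ(x₀)` in the plane `(e₀,e₁)`, `0` elsewhere. [folklore] -/
def cflux (t : ℤ) (π : Plane (d + 2)) : ℝ := if π = π₀ then theta b δ t else 0

/-- `A(∂p)` on the family, by planes. [folklore] -/
theorem pq_plane (x : Site (d + 2)) (π : Plane (d + 2)) : pq b δ x π.1.1 π.1.2 = cflux b δ (x 0) π := by
  unfold cflux
  by_cases hπ : π = π₀
  · rw [if_pos hπ, hπ]
    show pq b δ x 0 1 = theta b δ (x 0)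
    rw [pq, if_pos rfl, if_neg fin_zero_ne_one, sub_zero, add_e_zero_apply_zero, prof_succ_sub]
  · rw [if_neg hπ, pq, if_neg (snd_ne_one_of_ne hπ), zero_sub, neg_eq_zero]
    by_cases h1 : π.1.1 = 1
    · rw [if_pos h1, add_e_apply_zero (snd_ne_zero π), sub_self]
    · rw [if_neg h1]

/-- **THE FINE PLAQUETTES OF THE FAMILY**: `V(∂p′_{x,π}) = e^{i·cflux}·1`. [folklore] -/
theorem fhol_fam (x : Site (d + 2)) (π : Plane (d + 2)) :
    fhol (famV (n := n) b δ) (x, π) = expUnit (((((cflux b δ (x 0) π) : ℝ) : ℂ) * Complex.I) • (1 : Matrix n n ℂ)) := by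
  rw [fhol, famV, hol_scalarCfg, asum_plaqWord_fam, pq_plane]

/-- The coarse plaquette exponents of the family at the origin block (real part before `·i`): `4b + δ` in the plane
`(e₀,e₁)` (tent weights `(1,2,1)` against `θ(0), θ(1), θ(2)`), `0` elsewhere. [folklore] -/
def ccoarse (π : Plane (d + 2)) : ℝ := if π = π₀ then 4 * b + δ else 0

/-- The coarse plaquette exponent at the origin, from the bond exponents `g`. [folklore] -/
theorem gR_plaq (π : Plane (d + 2)) :
    gR b δ ((0 : Site (d + 2)) 0) π.1.1 + gR b δ (((0 : Site (d + 2)) + ((2 : ℕ) : ℤ) • e π.1.1) 0) π.1.2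
      - gR b δ (((0 : Site (d + 2)) + ((2 : ℕ) : ℤ) • e π.1.2) 0) π.1.1 - gR b δ ((0 : Site (d + 2)) 0) π.1.2
      = ccoarse b δ π := by
  by_cases hπ : π = π₀
  · rw [hπ, ccoarse, if_pos rfl]
    simp only [π₀, gR, if_true, fin_one_ne_zero, fin_zero_ne_one, if_false, Pi.zero_apply,
      add_zsmul_e_zero_apply_zero, add_zsmul_e_apply_zero (fin_one_ne_zero (d := d))]
    push_cast
    rw [prof_three, prof_two, prof_one, prof_zero]
    ring
  · have h2 := snd_ne_one_of_ne hπ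
    have h3 := snd_ne_zero π
    rw [ccoarse, if_neg hπ]
    have hν : ∀ t, gR b δ t π.1.2 = 0 := fun t => by rw [gR, if_neg h3, if_neg h2]
    rw [hν, hν, add_zsmul_e_apply_zero h3]
    ring

/-- **THE COARSE PLAQUETTES OF THE FAMILY AT THE ORIGIN**: `V̄(∂P_{0,π}) = e^{i·ccoarse}·1`. [folklore] -/
theorem chol_fam [Nonempty n] (hb : 0 ≤ b) (hδ : 0 ≤ δ) (hsm : b + δ ≤ 1 / 4) (π : Plane (d + 2)) :
    chol 2 (famV (n := n) b δ) ((0 : Site (d + 2)), π)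
      = expUnit (((((ccoarse b δ π : ℝ)) : ℂ) * Complex.I) • (1 : Matrix n n ℂ)) := by
  apply Units.ext
  rw [chol, val_expUnit, show ((2 : ℕ) : ℤ) • ((0 : Site (d + 2)), π).1 = 0 from smul_zero _,
    val_cplaq_of_scalar 2 (bavg_fam b δ hb hδ hsm)]
  show exp ((famG b δ 0 π.1.1 + famG b δ (0 + ((2 : ℕ) : ℤ) • e π.1.1) π.1.2
      - famG b δ (0 + ((2 : ℕ) : ℤ) • e π.1.2) π.1.1 - famG b δ 0 π.1.2) • (1 : Matrix n n ℂ)) = _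
  rw [← gR_plaq b δ π]
  simp only [famG]
  push_cast
  ring_nf

/-- The family is `U(N)`-valued. [folklore] -/
theorem isUnitaryCfg_fam : IsUnitaryCfg (famV (d := d) (n := n) b δ) := by
  intro x κ
  rw [mem_unitaryUnits, famV, scalarCfg, val_expUnit, ← cexp_smul_one]
  apply smul_one_mem_unitary
  by_cases hκ : κ = 1
  · rw [hκ, famF_one, Complex.norm_exp_ofReal_mul_I]
  · rw [famF_of_ne_one b δ x hκ]; simp

/-- The family lies in the small-field class `|V(∂p) − 1| ≤ a` as soon as `b + δ ≤ a`. [folklore] -/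
theorem smallField_fam [Nonempty n] (hb : 0 ≤ b) (hδ : 0 ≤ δ) {a : ℝ} (ha : b + δ ≤ a) :
    SmallField (famV (d := d) (n := n) b δ) a := by
  intro x κ κ' hκ
  rw [famV, val_hol_scalarCfg, asum_plaqWord_fam, ← cexp_smul_one, ← one_smul ℂ (1 : Matrix n n ℂ), smul_smul,
    mul_one, ← sub_smul, norm_smul_one_eq, mul_comm]
  calc ‖Complex.exp (Complex.I * (pq b δ x κ κ' : ℂ)) - 1‖ ≤ ‖pq b δ x κ κ'‖ := Real.norm_exp_I_mul_ofReal_sub_one_le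
    _ ≤ |theta b δ (x 0)| := by rw [Real.norm_eq_abs]; exact abs_pq_le b δ x hκ
    _ ≤ b + δ := abs_theta_le b δ hb hδ _
    _ ≤ a := ha

/-- `|cflux| ≤ |θ|`. [folklore] -/
theorem abs_cflux_le (t : ℤ) (π : Plane (d + 2)) : |cflux b δ t π| ≤ |theta b δ t| := by
  unfold cflux; split_ifs
  · exact le_rfl
  · rw [abs_zero]; exact abs_nonneg _

/-- `|cflux(t) − cflux(t′)| ≤ δ`. [folklore] -/
theorem abs_cflux_sub_le (hδ : 0 ≤ δ) (t t' : ℤ) (π : Plane (d + 2)) :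
    |cflux b δ t π - cflux b δ t' π| ≤ δ := by
  unfold cflux; split_ifs
  · exact abs_theta_sub_le b δ hδ t t'
  · rw [sub_zero, abs_zero]; exact hδ

/-- The fluxes of the family: `F(x; π) = i·cflux·1` (inside the log branch). [folklore] -/
theorem flux_fam [Nonempty n] (hb : 0 ≤ b) (hδ : 0 ≤ δ) (hsm : b + δ ≤ 1 / 4) (x : Site (d + 2))
    (π : Plane (d + 2)) :
    flux (famV (n := n) b δ) (x, π) = ((((cflux b δ (x 0) π) : ℝ) : ℂ) * Complex.I) • (1 : Matrix n n ℂ) := by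
  rw [flux, fhol_fam, val_expUnit]
  apply mlog_exp_smul_one
  rw [norm_real_mul_I]
  have hlog : (1 : ℝ) / 2 < Real.log 2 := by have := Real.log_two_gt_d9; linarith
  linarith [abs_theta_le b δ hb hδ (x 0), abs_cflux_le b δ (x 0) π]

/-- The covariant flux gradient of the family is bounded by the step `δ`. [folklore] -/
theorem norm_covGrad_fam_le [Nonempty n] (hb : 0 ≤ b) (hδ : 0 ≤ δ) (hsm : b + δ ≤ 1 / 4) (x : Site (d + 2))
    (κ : Fin (d + 2)) (π : Plane (d + 2)) : ‖covGrad (famV (n := n) b δ) (flux (famV b δ)) x κ π‖ ≤ δ := by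
  rw [covGrad, flux_fam b δ hb hδ hsm, flux_fam b δ hb hδ hsm, Ad_smul_one, ← sub_smul, norm_smul_one_eq,
    ← sub_mul, ← Complex.ofReal_sub, norm_real_mul_I]
  exact abs_cflux_sub_le b δ hδ _ _ _

/-! ### Counting: boxes, blocks, planes -/

/-- `#box_R(y) = (2R+1)^{d+2}`. [folklore] -/
theorem card_box (R : ℕ) (y : Site (d + 2)) : (box R y).card = (2 * R + 1) ^ (d + 2) := by
  unfold T4AveragingDeficitWall.box
  rw [Pi.card_Icc]
  have h : ∀ i : Fin (d + 2),
      (Finset.Icc ((y - fun _ : Fin (d + 2) => (R : ℤ)) i) ((y + fun _ : Fin (d + 2) => (R : ℤ)) i)).card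
        = 2 * R + 1 := by
    intro i
    rw [Int.card_Icc]
    simp only [Pi.add_apply, Pi.sub_apply]
    omega
  simp_rw [h]
  rw [Finset.prod_const, Finset.card_univ, Fintype.card_fin]

/-- The block of the origin has at most `2^{d+2}` sites; its `R`-neighbourhood at most `2^{d+2}(2R+1)^{d+2}`.
[folklore] -/
theorem card_nbhd_block_le (R : ℕ) :
    ((nbhd R (blockSites 2 ({0} : Finset (Site (d + 2))))).card : ℝ) ≤ 2 ^ (d + 2) * (2 * R + 1) ^ (d + 2) := by
  have hT : (blockSites 2 ({0} : Finset (Site (d + 2)))).card ≤ 2 ^ (d + 2) := by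
    unfold blockSites
    rw [Finset.singleton_biUnion]
    unfold T4AveragingDeficitWall.block
    refine (Finset.card_image_le).trans ?_
    rw [Finset.card_univ, Fintype.card_fun, Fintype.card_fin, Fintype.card_fin]
  have h1 : (nbhd R (blockSites 2 ({0} : Finset (Site (d + 2))))).card ≤ 2 ^ (d + 2) * (2 * R + 1) ^ (d + 2) := by
    rw [nbhd]
    refine Finset.card_biUnion_le.trans ?_
    simp_rw [card_box]
    rw [Finset.sum_const, smul_eq_mul]
    exact Nat.mul_le_mul_right _ hT
  exact_mod_cast h1

/-- `#planes ≤ (d+2)²`. [folklore] -/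
theorem card_plane_le : (Fintype.card (Plane (d + 2)) : ℝ) ≤ ((d : ℝ) + 2) ^ 2 := by
  have h : Fintype.card (Plane (d + 2)) ≤ (d + 2) ^ 2 := by
    refine (Fintype.card_subtype_le _).trans ?_
    rw [Fintype.card_prod, Fintype.card_fin, sq]
  exact_mod_cast h

/-- The constant `K(d,R) = 2^{d+2}(2R+1)^{d+2}(d+2)³` bounding `‖∇F‖²/δ²` on the family. [folklore] -/
def Kconst (d R : ℕ) : ℝ := 2 ^ (d + 2) * (2 * R + 1) ^ (d + 2) * ((d : ℝ) + 2) ^ 3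

/-- `K ≥ 8`. [folklore] -/
theorem eight_le_Kconst (d R : ℕ) : 8 ≤ Kconst d R := by
  unfold Kconst
  have h1 : (4 : ℝ) ≤ 2 ^ (d + 2) := by
    rw [show (4 : ℝ) = 2 ^ 2 by norm_num]
    exact pow_le_pow_right₀ one_le_two (by omega)
  have hR : (0 : ℝ) ≤ R := by positivity
  have hd : (0 : ℝ) ≤ d := by positivity
  have h2 : (1 : ℝ) ≤ (2 * R + 1) ^ (d + 2) := one_le_pow₀ (by linarith)
  have h3 : (8 : ℝ) ≤ ((d : ℝ) + 2) ^ 3 := by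
    rw [show (8 : ℝ) = 2 ^ 3 by norm_num]
    exact pow_le_pow_left₀ zero_le_two (by linarith) 3
  calc (8 : ℝ) = 4 * 1 * 2 := by norm_num
    _ ≤ 2 ^ (d + 2) * (2 * R + 1) ^ (d + 2) * 2 := by gcongr
    _ ≤ 2 ^ (d + 2) * (2 * R + 1) ^ (d + 2) * ((d : ℝ) + 2) ^ 3 := by gcongr; linarith

/-- **THE RIGHT-HAND SIDE ON THE FAMILY**: `‖∇_V F‖²_{ℓ²(N_R(block))} ≤ K(d,R) δ²`. [folklore] -/
theorem gradFluxSq_fam_le [Nonempty n] (hb : 0 ≤ b) (hδ : 0 ≤ δ) (hsm : b + δ ≤ 1 / 4) (R : ℕ) :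
    gradFluxSq (famV (n := n) b δ) (nbhd R (blockSites 2 ({0} : Finset (Site (d + 2))))) ≤ Kconst d R * δ ^ 2 := by
  unfold gradFluxSq Kconst
  have hterm : ∀ x (κ : Fin (d + 2)) (π : Plane (d + 2)),
      ‖covGrad (famV (n := n) b δ) (flux (famV b δ)) x κ π‖ ^ 2 ≤ δ ^ 2 :=
    fun x κ π => pow_le_pow_left₀ (norm_nonneg _) (norm_covGrad_fam_le b δ hb hδ hsm x κ π) 2
  have hd : (0 : ℝ) ≤ d := by positivity
  calc ∑ x ∈ nbhd R (blockSites 2 {0}), ∑ κ : Fin (d + 2), ∑ π : Plane (d + 2),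
          ‖covGrad (famV (n := n) b δ) (flux (famV b δ)) x κ π‖ ^ 2
      ≤ ∑ x ∈ nbhd R (blockSites 2 {0}), ∑ κ : Fin (d + 2), ∑ π : Plane (d + 2), δ ^ 2 :=
        Finset.sum_le_sum fun x _ => Finset.sum_le_sum fun κ _ => Finset.sum_le_sum fun π _ => hterm x κ π
    _ = (nbhd R (blockSites 2 ({0} : Finset (Site (d + 2))))).card
          * (((d : ℝ) + 2) * ((Fintype.card (Plane (d + 2)) : ℝ) * δ ^ 2)) := by
        simp [Finset.sum_const, Finset.card_univ, Fintype.card_fin]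
    _ ≤ (2 ^ (d + 2) * (2 * R + 1) ^ (d + 2)) * (((d : ℝ) + 2) * (((d : ℝ) + 2) ^ 2 * δ ^ 2)) := by
        gcongr
        · exact card_nbhd_block_le R
        · exact card_plane_le
    _ = 2 ^ (d + 2) * (2 * R + 1) ^ (d + 2) * ((d : ℝ) + 2) ^ 3 * δ ^ 2 := by ring

/-- `2^{m−4} = 2^m/16` (the factor `L^{d−4}` of the deficit at `L = 2`). [folklore] -/
theorem two_zpow_sub_four (m : ℕ) : ((2 : ℕ) : ℝ) ^ ((m : ℤ) - 4) = (2 : ℝ) ^ m / 16 := by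
  rw [Nat.cast_ofNat, zpow_sub₀ (two_ne_zero), zpow_natCast]
  norm_num

/-- **THE DEFICIT OF THE FAMILY ON THE BLOCK WINDOW OF THE ORIGIN, IN CLOSED FORM**:
`𝓓_{W({0})}(V_{b,δ}) = 2^{d+2} · [ (1 − cos(4b+δ))/16 − (1 − cos b) ]`. [folklore] -/
theorem deficit_fam [Nonempty n] (hb : 0 ≤ b) (hδ : 0 ≤ δ) (hsm : b + δ ≤ 1 / 4) :
    deficit 2 (famV (n := n) b δ) (blockWindow 2 ({0} : Finset (Site (d + 2))))
      = (2 : ℝ) ^ (d + 2) / 16 * (1 - Real.cos (4 * b + δ)) - (2 : ℝ) ^ (d + 2) * (1 - Real.cos b) := by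
  have hcoarse : coarseAction 2 (famV (n := n) b δ) (({0} : Finset (Site (d + 2))) ×ˢ Finset.univ)
      = 1 - Real.cos (4 * b + δ) := by
    rw [coarseAction, Finset.sum_product, Finset.sum_singleton]
    simp_rw [chol_fam b δ hb hδ hsm, wt_expUnit_smul_one]
    rw [Finset.sum_eq_single π₀ (fun π _ hπ => by rw [ccoarse, if_neg hπ, Real.cos_zero, sub_self])
      (fun h => absurd (Finset.mem_univ _) h), ccoarse, if_pos rfl]
  have hinj : Set.InjOn (fun r : Fin (d + 2) → Fin 2 => ((2 : ℕ) : ℤ) • (0 : Site (d + 2)) + boxVec 2 r)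
      ((Finset.univ : Finset (Fin (d + 2) → Fin 2)) : Set (Fin (d + 2) → Fin 2)) := by
    intro r _ r' _ h
    funext κ
    have := congr_fun h κ
    simp only [boxVec, Pi.add_apply, add_right_inj, Nat.cast_inj] at this
    exact Fin.ext this
  have hfine : fineAction (famV (n := n) b δ) (blockSites 2 ({0} : Finset (Site (d + 2))) ×ˢ Finset.univ)
      = (2 : ℝ) ^ (d + 2) * (1 - Real.cos b) := by
    unfold blockSites
    rw [fineAction, Finset.sum_product, Finset.singleton_biUnion]
    unfold T4AveragingDeficitWall.block
    rw [Finset.sum_image hinj]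
    simp_rw [fhol_fam, wt_expUnit_smul_one]
    have hθ : ∀ r : Fin (d + 2) → Fin 2, ∑ π : Plane (d + 2),
        (1 - Real.cos (cflux b δ ((((2 : ℕ) : ℤ) • (0 : Site (d + 2)) + boxVec 2 r) 0) π)) = 1 - Real.cos b := by
      intro r
      rw [Finset.sum_eq_single π₀ (fun π _ hπ => by rw [cflux, if_neg hπ, Real.cos_zero, sub_self])
        (fun h => absurd (Finset.mem_univ _) h), cflux, if_pos rfl, theta_of_lt]
      have := (r 0).is_lt
      simp [boxVec]
      omega
    simp_rw [hθ]
    rw [Finset.sum_const, Finset.card_univ, Fintype.card_fun, Fintype.card_fin, Fintype.card_fin, nsmul_eq_mul]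
    push_cast; ring
  rw [deficit, blockWindow, two_zpow_sub_four, hcoarse, hfine]

end Family

/-! ## §3 THE TYPED VALUE WALL β′ IS FALSE in every dimension `d + 2 ≥ 2` (`L = 2`, every `N ≥ 1`, every
`(C, a₀ > 0, R)`) — in particular for `d + 2 = 4` -/

/-- **`¬ DeficitValueWall (d+2) N 2 C a₀ R`**: the finite-window value wall of `T4AveragingDeficitWall` §6 fails for
every dimension `≥ 2`, every constant `C`, every threshold `a₀ > 0` and every neighbourhood radius `R` — witnessed by
the boundary-layer family `V_{a/2, sa}` on the block window of the origin: `𝓓 ≥ (3s/8)a²` against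
`C(‖∇F‖² + a³) ≤ (s/4)a²` for `s = 1/(8·max(C,1)·K(d,R))`, `a = min(a₀, s/(8 max(C,1)), 1/4)`. [folklore] -/
theorem not_deficitValueWall [Nonempty n] (C a₀ : ℝ) (R : ℕ) (ha₀ : 0 < a₀) :
    ¬ DeficitValueWall (d + 2) n 2 C a₀ R := by
  intro hW
  -- constants
  set K : ℝ := Kconst d R with hK
  set Cp : ℝ := max C 1 with hCp
  have hK8 : 8 ≤ K := eight_le_Kconst d R
  have hK0 : 0 < K := by linarith
  have hCp1 : 1 ≤ Cp := le_max_right _ _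
  have hCp0 : 0 < Cp := by linarith
  have hCC : C ≤ Cp := le_max_left _ _
  set s : ℝ := 1 / (8 * Cp * K) with hs
  have hs0 : 0 < s := by rw [hs]; positivity
  have hCKs : Cp * K * s = 1 / 8 := by rw [hs]; field_simp
  have hCK : 1 * 8 ≤ Cp * K := mul_le_mul hCp1 hK8 (by norm_num) hCp0.le
  have hs64 : s ≤ 1 / 64 := by
    rw [hs, div_le_div_iff₀ (by positivity) (by norm_num)]
    linarith
  set a : ℝ := min (min a₀ (s / (8 * Cp))) (1 / 4) with ha
  have ha0 : 0 < a := by rw [ha]; positivity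
  have haa₀ : a ≤ a₀ := (min_le_left _ _).trans (min_le_left _ _)
  have has : a ≤ s / (8 * Cp) := (min_le_left _ _).trans (min_le_right _ _)
  have ha4 : a ≤ 1 / 4 := min_le_right _ _
  have has8 : a ≤ s / 8 := has.trans (div_le_div_of_nonneg_left hs0.le (by norm_num) (by linarith))
  have hCpa : Cp * a ≤ s / 8 := by
    calc Cp * a ≤ Cp * (s / (8 * Cp)) := mul_le_mul_of_nonneg_left has hCp0.le
      _ = s / 8 := by field_simp
  -- parameters of the family
  have hb : (0 : ℝ) ≤ a / 2 := by positivity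
  have hδ : (0 : ℝ) ≤ s * a := by positivity
  have hsa : s * a ≤ 1 / 64 * a := mul_le_mul_of_nonneg_right hs64 ha0.le
  have hsm : a / 2 + s * a ≤ 1 / 4 := by linarith
  have hsmA : a / 2 + s * a ≤ a := by linarith
  -- the wall on the datum
  have hV := hW (famV (a / 2) (s * a)) (isUnitaryCfg_fam _ _) a ha0.le haa₀
    (smallField_fam (a / 2) (s * a) hb hδ hsmA) {0}
  rw [deficit_fam (a / 2) (s * a) hb hδ hsm, Finset.card_singleton, Nat.cast_one, mul_one] at hV
  have hG := gradFluxSq_fam_le (n := n) (d := d) (a / 2) (s * a) hb hδ hsm R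
  have hG0 : 0 ≤ gradFluxSq (famV (n := n) (a / 2) (s * a)) (nbhd R (blockSites 2 ({0} : Finset (Site (d + 2))))) := by
    unfold gradFluxSq; positivity
  -- upper bound of the right-hand side
  have hup : C * (gradFluxSq (famV (n := n) (a / 2) (s * a)) (nbhd R (blockSites 2 ({0} : Finset (Site (d + 2)))))
      + a ^ 3) ≤ s / 4 * a ^ 2 := by
    calc C * (gradFluxSq (famV (n := n) (a / 2) (s * a)) (nbhd R (blockSites 2 ({0} : Finset (Site (d + 2))))) + a ^ 3)
        ≤ Cp * (gradFluxSq (famV (n := n) (a / 2) (s * a)) (nbhd R (blockSites 2 ({0} : Finset (Site (d + 2)))))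
            + a ^ 3) := mul_le_mul_of_nonneg_right hCC (by positivity)
      _ ≤ Cp * (K * (s * a) ^ 2 + a ^ 3) := by
          apply mul_le_mul_of_nonneg_left _ hCp0.le
          rw [hK]; linarith
      _ = (Cp * K * s) * (s * a ^ 2) + (Cp * a) * a ^ 2 := by ring
      _ ≤ 1 / 8 * (s * a ^ 2) + s / 8 * a ^ 2 := by
          rw [hCKs]
          have := mul_le_mul_of_nonneg_right hCpa (sq_nonneg a)
          linarith
      _ = s / 4 * a ^ 2 := by ring
  -- lower bound of the deficit
  set x : ℝ := 4 * (a / 2) + s * a with hx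
  have hx' : x = (2 + s) * a := by rw [hx]; ring
  have hx0 : 0 ≤ x := by rw [hx']; positivity
  have hx1 : x ≤ 1 := by rw [hx]; linarith
  have hcx : Real.cos x ≤ 1 - x ^ 2 / 2 + x ^ 4 * (5 / 96) := by
    have h := Real.cos_bound (show |x| ≤ 1 by rw [abs_of_nonneg hx0]; exact hx1)
    rw [abs_of_nonneg hx0] at h
    linarith [(abs_le.mp h).2]
  have hcb : 1 - (a / 2) ^ 2 / 2 ≤ Real.cos (a / 2) := Real.one_sub_sq_div_two_le_cos
  have e1 : x ^ 2 / 8 - (a / 2) ^ 2 * 2 = s * a ^ 2 / 2 + s ^ 2 * a ^ 2 / 8 := by rw [hx']; ring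
  have e2 : x ^ 4 = (2 + s) ^ 4 * a ^ 4 := by rw [hx']; ring
  have hs4 : (2 + s) ^ 4 ≤ 18 := by
    have hss' : s ^ 2 ≤ 1 / 64 * s := by rw [sq]; exact mul_le_mul_of_nonneg_right hs64 hs0.le
    have h2 : (2 + s) ^ 2 ≤ 33 / 8 := by
      have : (2 + s) ^ 2 = 4 + 4 * s + s ^ 2 := by ring
      rw [this]; linarith
    have h0 : 0 ≤ (2 + s) ^ 2 := sq_nonneg _
    calc (2 + s) ^ 4 = ((2 + s) ^ 2) ^ 2 := by ring
      _ ≤ (33 / 8) ^ 2 := pow_le_pow_left₀ h0 h2 2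
      _ ≤ 18 := by norm_num
  have i1 : (2 + s) ^ 4 * a ^ 4 ≤ 18 * a ^ 4 := mul_le_mul_of_nonneg_right hs4 (by positivity)
  have ha2' : a ^ 2 ≤ s / 32 := by
    have h1 : a * a ≤ s / 8 * a := mul_le_mul_of_nonneg_right has8 ha0.le
    have h2 : s / 8 * a ≤ s / 8 * (1 / 4) := mul_le_mul_of_nonneg_left ha4 (by positivity)
    rw [sq]; linarith
  have i2 : a ^ 4 ≤ s / 32 * a ^ 2 := by
    have : a ^ 4 = a ^ 2 * a ^ 2 := by ring
    rw [this]
    exact mul_le_mul_of_nonneg_right ha2' (sq_nonneg a)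
  have hss : 0 ≤ s ^ 2 * a ^ 2 := by positivity
  have hsa2 : 0 ≤ s * a ^ 2 := by positivity
  have hE : 3 * s / 32 * a ^ 2 ≤ (1 - Real.cos x) / 16 - (1 - Real.cos (a / 2)) := by
    linarith [hcx, hcb, e1, e2, i1, i2, hss, hsa2]
  have h4 : (4 : ℝ) ≤ 2 ^ (d + 2) := by
    rw [show (4 : ℝ) = 2 ^ 2 by norm_num]
    exact pow_le_pow_right₀ one_le_two (by omega)
  have hlow : 3 * s / 8 * a ^ 2
      ≤ (2 : ℝ) ^ (d + 2) / 16 * (1 - Real.cos x) - (2 : ℝ) ^ (d + 2) * (1 - Real.cos (a / 2)) := by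
    have hE0 : 0 ≤ (1 - Real.cos x) / 16 - (1 - Real.cos (a / 2)) := le_trans (by positivity) hE
    calc 3 * s / 8 * a ^ 2 = 4 * (3 * s / 32 * a ^ 2) := by ring
      _ ≤ 4 * ((1 - Real.cos x) / 16 - (1 - Real.cos (a / 2))) := by linarith
      _ ≤ (2 : ℝ) ^ (d + 2) * ((1 - Real.cos x) / 16 - (1 - Real.cos (a / 2))) :=
          mul_le_mul_of_nonneg_right h4 hE0
      _ = _ := by ring
  -- contradiction
  have hle := (abs_le.mp hV).2
  have hpos : 0 < s * a ^ 2 := by positivity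
  linarith

/-- **`¬ ClaimBeta (d+2) N 2`**: the one-statement claim of `T4AveragingDeficitWall` §6 is false as typed in every
dimension `≥ 2` (its value conjunct is). [folklore] -/
theorem not_claimBeta [Nonempty n] : ¬ ClaimBeta (d + 2) n 2 :=
  fun ⟨C, a₀, R, _, ha₀, _, _, hW⟩ => not_deficitValueWall C a₀ R ha₀ hW

/-- **`¬ ClaimBetaDeriv (d+2) N 2`**: likewise for the plain-derivative packaging of `T4AveragingDeficitWallLocal` §4.
[folklore] -/
theorem not_claimBetaDeriv [Nonempty n] : ¬ ClaimBetaDeriv (d + 2) n 2 :=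
  fun ⟨C, a₀, R, _, ha₀, _, _, hW⟩ => not_deficitValueWall C a₀ R ha₀ hW

/-- **THE T⁴ CASE**: `¬ DeficitValueWall 4 N 2 C a₀ R`. [folklore] -/
theorem not_deficitValueWall_four [Nonempty n] (C a₀ : ℝ) (R : ℕ) (ha₀ : 0 < a₀) :
    ¬ DeficitValueWall 4 n 2 C a₀ R :=
  not_deficitValueWall (d := 2) C a₀ R ha₀

/-- **THE T⁴ CASE**: `¬ ClaimBeta 4 N 2`. [folklore] -/
theorem not_claimBeta_four [Nonempty n] : ¬ ClaimBeta 4 n 2 := not_claimBeta (d := 2)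

/-- **THE T⁴ CASE**: `¬ ClaimBetaDeriv 4 N 2`. [folklore] -/
theorem not_claimBetaDeriv_four [Nonempty n] : ¬ ClaimBetaDeriv 4 n 2 := not_claimBetaDeriv (d := 2)

/-! ## §4 The REPAIRED value walls — STATEMENTS ONLY, asserted nowhere: β′-local (with the first-order boundary flux
term `a·‖∇_V F‖_{ℓ¹}` that the window weights' first moment forces) and β′-periodic (full period torus, no boundary) -/

section Repaired

/-- `‖∇_V F‖_{ℓ¹(N)} = Σ_{x ∈ N} Σ_κ Σ_{μ<ν} |∇_V F(x; κ; μν)|` — the FIRST-ORDER gradient sum the finite-window value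
wall must carry (Appendix β §9 (ix)). [folklore] -/
def gradFluxL1 (V : Site d → Fin d → (Matrix n n ℂ)ˣ) (N : Finset (Site d)) : ℝ :=
  ∑ x ∈ N, ∑ κ : Fin d, ∑ π : Plane d, ‖covGrad V (flux V) x κ π‖

/-- `‖∇_V F‖_{ℓ¹(N)} ≥ 0`. [folklore] -/
theorem gradFluxL1_nonneg (V : Site d → Fin d → (Matrix n n ℂ)ˣ) (N : Finset (Site d)) : 0 ≤ gradFluxL1 V N := by
  unfold gradFluxL1; positivity

/-- `‖∇_V F‖²_{ℓ²(N)} ≥ 0`. [folklore] -/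
theorem gradFluxSq_nonneg' (V : Site d → Fin d → (Matrix n n ℂ)ˣ) (N : Finset (Site d)) : 0 ≤ gradFluxSq V N := by
  unfold gradFluxSq; positivity

variable (d n) in
/-- **THE REPAIRED LOCAL VALUE WALL β′-loc (Appendix β §9 (ix)), TYPED — ASSERTED NOWHERE**: for every `U(N)`-valued
`V` in `SmallField V a`, `0 ≤ a ≤ a₀`, and every finite set `Y` of coarse sites,
`|𝓓_{W(Y)}(V)| ≤ C · [ a·‖∇_V F‖_{ℓ¹(N_R(blocks of Y))} + ‖∇_V F‖²_{ℓ²(N_R(blocks of Y))} + a³ · #Y ]`.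
The new first term is the boundary flux term of a finite window (zero-mass, non-zero-first-moment window weights pair
the mean flux `|F̄| ≤ a` with ONE gradient); it is invisible on a torus and in the derivative wall (β).  Whether β′-loc
holds is [analysis] (Appendix β §9), NOT claimed here. [folklore] -/
def DeficitValueWallLoc (L : ℕ) (C a₀ : ℝ) (R : ℕ) : Prop :=
  ∀ (V : Site d → Fin d → (Matrix n n ℂ)ˣ), IsUnitaryCfg V →
  ∀ (a : ℝ), 0 ≤ a → a ≤ a₀ → SmallField V a →
  ∀ (Y : Finset (Site d)),
    |deficit L V (blockWindow L Y)|
      ≤ C * (a * gradFluxL1 V (nbhd R (blockSites L Y)) + gradFluxSq V (nbhd R (blockSites L Y)) + a ^ 3 * Y.card)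

/-- Periodicity of a bond configuration with period `P` in every coordinate direction (a configuration on the torus
`(ℤ/Pℤ)^d` read on its universal cover). [folklore] -/
def IsPeriodicCfg (V : Site d → Fin d → (Matrix n n ℂ)ˣ) (P : ℤ) : Prop :=
  ∀ (x : Site d) (κ μ : Fin d), V (x + P • e κ) μ = V x μ

/-- The period box of coarse sites `[0, M)^d` (one fundamental domain of the coarse torus). [folklore] -/
def periodBox (M : ℕ) : Finset (Site d) := Finset.univ.image (boxVec (d := d) M)

variable (d n) in
/-- **THE REPAIRED PERIODIC VALUE WALL β′-per (Appendix β §9 (ix)), TYPED — ASSERTED NOWHERE**: for every `M ≥ 1`, every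
`U(N)`-valued `V` of period `L·M` in `SmallField V a`, `0 ≤ a ≤ a₀`, the deficit of the FULL PERIOD WINDOW (all `M^d`
coarse plaquette bases of one fundamental domain and their blocks — the toroidal action difference, no boundary) obeys
`|𝓓_{W([0,M)^d)}(V)| ≤ C · [ ‖∇_V F‖²_{ℓ²(blocks)} + a³ · M^d ]` (no neighbourhood radius: the torus has no outside).
Whether β′-per holds is [analysis] (Appendix β §3–§6, §9), NOT claimed here. [folklore] -/
def DeficitValueWallPer (L : ℕ) (C a₀ : ℝ) : Prop :=
  ∀ (M : ℕ), 1 ≤ M →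
  ∀ (V : Site d → Fin d → (Matrix n n ℂ)ˣ), IsUnitaryCfg V → IsPeriodicCfg V ((L : ℤ) * M) →
  ∀ (a : ℝ), 0 ≤ a → a ≤ a₀ → SmallField V a →
    |deficit L V (blockWindow L (periodBox M))|
      ≤ C * (gradFluxSq V (blockSites L (periodBox M)) + a ^ 3 * (M : ℝ) ^ d)

variable (d n) in
/-- CLAIM β + β′-loc as ONE typed statement (the local repair of `ClaimBeta`) — ASSERTED NOWHERE. [folklore] -/
def ClaimBetaLoc (L : ℕ) : Prop :=
  ∃ C a₀ : ℝ, ∃ R : ℕ, 0 ≤ C ∧ 0 < a₀ ∧ a₀ ≤ 1 ∧ DeficitDerivWall d n L C a₀ R ∧ DeficitValueWallLoc d n L C a₀ R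

variable (d n) in
/-- CLAIM β + β′-per as ONE typed statement (the periodic repair of `ClaimBeta`) — ASSERTED NOWHERE. [folklore] -/
def ClaimBetaPer (L : ℕ) : Prop :=
  ∃ C a₀ : ℝ, ∃ R : ℕ, 0 ≤ C ∧ 0 < a₀ ∧ a₀ ≤ 1 ∧ DeficitDerivWall d n L C a₀ R ∧ DeficitValueWallPer d n L C a₀

/-- MONOTONICITY: the refuted typing β′ was STRONGER than β′-loc (`C ≥ 0`): dropping the boundary flux term is what
made it false. [folklore] -/
theorem DeficitValueWall.loc {L : ℕ} {C a₀ : ℝ} {R : ℕ} (hC : 0 ≤ C) (h : DeficitValueWall d n L C a₀ R) :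
    DeficitValueWallLoc d n L C a₀ R := by
  intro V hV a ha haa hVa Y
  refine (h V hV a ha haa hVa Y).trans (mul_le_mul_of_nonneg_left ?_ hC)
  have := mul_nonneg ha (gradFluxL1_nonneg V (nbhd R (blockSites L Y)))
  linarith

/-- `ClaimBeta → ClaimBetaLoc`. [folklore] -/
theorem ClaimBeta.loc {L : ℕ} (h : ClaimBeta d n L) : ClaimBetaLoc d n L := by
  obtain ⟨C, a₀, R, hC, ha₀, ha₁, hβ, hβ'⟩ := h
  exact ⟨C, a₀, R, hC, ha₀, ha₁, hβ, DeficitValueWall.loc hC hβ'⟩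

/-- The flat configuration is periodic with every period. [folklore] -/
theorem isPeriodicCfg_flat (P : ℤ) : IsPeriodicCfg (fun (_ : Site d) (_ : Fin d) => (1 : (Matrix n n ℂ)ˣ)) P :=
  fun _ _ _ => rfl

/-- THE FAMILY IS CONSISTENT WITH β′-loc AT THE POINT WHERE IT KILLS β′: on `V_{b,δ}` the new first-order term sees
the two transition bonds `x₀ = 1`, `κ = 0` of the block itself, so `2δ ≤ ‖∇_V F‖_{ℓ¹(N_R)}` — against the deficit's
leading term `bδ·2^{d+2}/4 ≍ aδ`. [folklore] -/
theorem two_mul_delta_le_gradFluxL1_fam [Nonempty n] (b δ : ℝ) (hb : 0 ≤ b) (hδ : 0 ≤ δ) (hsm : b + δ ≤ 1 / 4)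
    (R : ℕ) : 2 * δ ≤ gradFluxL1 (famV (n := n) b δ) (nbhd R (blockSites 2 ({0} : Finset (Site (d + 2))))) := by
  have hterm : ∀ x : Site (d + 2), x 0 = 1 →
      δ ≤ ∑ κ : Fin (d + 2), ∑ π : Plane (d + 2), ‖covGrad (famV (n := n) b δ) (flux (famV b δ)) x κ π‖ := by
    intro x hx
    have h0 : δ ≤ ∑ π : Plane (d + 2), ‖covGrad (famV (n := n) b δ) (flux (famV b δ)) x 0 π‖ := by
      have h1 : δ ≤ ‖covGrad (famV (n := n) b δ) (flux (famV b δ)) x 0 π₀‖ := by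
        rw [covGrad, flux_fam b δ hb hδ hsm, flux_fam b δ hb hδ hsm, Ad_smul_one, ← sub_smul, norm_smul_one_eq,
          ← sub_mul, ← Complex.ofReal_sub, norm_real_mul_I, add_e_zero_apply_zero, hx, cflux, cflux, if_pos rfl,
          if_pos rfl]
        have h2 : theta b δ (1 + 1) - theta b δ 1 = δ := by simp [theta]
        simp only [h2, abs_of_nonneg hδ, le_refl]
      exact h1.trans (Finset.single_le_sum (fun _ _ => norm_nonneg _) (Finset.mem_univ π₀))
    exact h0.trans (Finset.single_le_sum (fun κ _ => Finset.sum_nonneg fun _ _ => norm_nonneg _)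
      (Finset.mem_univ (0 : Fin (d + 2))))
  have hmem : ∀ r : Fin (d + 2) → Fin 2,
      (boxVec 2 r : Site (d + 2)) ∈ nbhd R (blockSites 2 ({0} : Finset (Site (d + 2)))) := by
    intro r
    unfold nbhd blockSites
    rw [Finset.singleton_biUnion, Finset.mem_biUnion]
    refine ⟨boxVec 2 r, ?_, ?_⟩
    · unfold T4AveragingDeficitWall.block
      exact Finset.mem_image.mpr ⟨r, Finset.mem_univ _, by simp⟩
    · unfold T4AveragingDeficitWall.box
      simp only [Finset.mem_Icc]
      constructor <;> intro i <;> simp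
  -- two distinct sites of the block with `x₀ = 1`
  set rA : Fin (d + 2) → Fin 2 := fun i => if i = 0 then 1 else 0 with hrA
  set rB : Fin (d + 2) → Fin 2 := fun i => if i = 1 then 1 else if i = 0 then 1 else 0 with hrB
  have hA0 : (boxVec 2 rA : Site (d + 2)) 0 = 1 := by simp [boxVec, hrA]
  have hB0 : (boxVec 2 rB : Site (d + 2)) 0 = 1 := by simp [boxVec, hrB]
  have hne : (boxVec 2 rA : Site (d + 2)) ≠ boxVec 2 rB := by
    intro h
    have := congr_fun h 1
    simp [boxVec, hrA, hrB] at this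
  unfold gradFluxL1
  calc 2 * δ = δ + δ := by ring
    _ ≤ (∑ κ : Fin (d + 2), ∑ π : Plane (d + 2), ‖covGrad (famV (n := n) b δ) (flux (famV b δ)) (boxVec 2 rA) κ π‖)
        + ∑ κ : Fin (d + 2), ∑ π : Plane (d + 2), ‖covGrad (famV (n := n) b δ) (flux (famV b δ)) (boxVec 2 rB) κ π‖ :=
        add_le_add (hterm _ hA0) (hterm _ hB0)
    _ = ∑ x ∈ ({boxVec 2 rA, boxVec 2 rB} : Finset (Site (d + 2))),
          ∑ κ : Fin (d + 2), ∑ π : Plane (d + 2), ‖covGrad (famV (n := n) b δ) (flux (famV b δ)) x κ π‖ := by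
        rw [Finset.sum_pair hne]
    _ ≤ ∑ x ∈ nbhd R (blockSites 2 ({0} : Finset (Site (d + 2)))),
          ∑ κ : Fin (d + 2), ∑ π : Plane (d + 2), ‖covGrad (famV (n := n) b δ) (flux (famV b δ)) x κ π‖ := by
        apply Finset.sum_le_sum_of_subset_of_nonneg
        · intro x hx
          simp only [Finset.mem_insert, Finset.mem_singleton] at hx
          rcases hx with rfl | rfl <;> exact hmem _
        · exact fun _ _ _ => Finset.sum_nonneg fun _ _ => Finset.sum_nonneg fun _ _ => norm_nonneg _

end Repaired

/-! ## §5 [v1.1] THE EXACT ABELIAN STENCIL: on small-exponent scalar configurations Bałaban's NON-LINEAR average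
(42)/(44) reproduces the LINEAR stencil of plaquette angles EXACTLY (tree `corner_cancellation` + `stokes` = B7 (48) p. 25),
for every dimension `d`, block side `L ≥ 1`, window pair and potential -/

section AbelianStencil

/-- The log-branch hypothesis of (42) for the scalar configuration `e^{f}·1` at block side `L`: every contour exponent
`A(Γ_{c,x}) − A(c)` has modulus `< ln 2` (so the series log (21) returns the exponent itself). [folklore] -/
def SmallExp (L : ℕ) (f : Site d → Fin d → ℂ) : Prop :=
  ∀ (q : Site d) (κ : Fin d) (r : Fin d → Fin L),
    ‖asum f q (gammaWord L κ (boxVec L r)) - asum f q (seg κ L)‖ < Real.log 2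

/-- The exponent of the averaged bond variable: `g(q,κ) = Ξ(q,κ) + A(c_{q,κ})` (`bavg_scalarCfg`). [folklore] -/
def bondExp (L : ℕ) (f : Site d → Fin d → ℂ) (q : Site d) (κ : Fin d) : ℂ := Xi L f q κ + asum f q (seg κ L)

/-- THE STENCIL EXPONENT of the coarse plaquette with fine corner `z` in the plane `(μ,ν)`:
`Σ_r L^{−d} A(∂(P)_{z+r})`, `(P)_{z+r}` the `L × L` square with corner `z + r`, `r ∈ [0,L)^d`. [folklore] -/
def stencilExp (L : ℕ) (f : Site d → Fin d → ℂ) (z : Site d) (μ ν : Fin d) : ℂ :=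
  ∑ r : Fin d → Fin L, ((L : ℂ) ^ d)⁻¹ * asum f (z + boxVec L r) (rectWord L L μ ν)

/-- The averaging weights sum to one (complex form of tree `sum_weights`). [folklore] -/
theorem sum_weights_complex (L : ℕ) (hL : 1 ≤ L) : ∑ _r : Fin d → Fin L, ((L : ℂ) ^ d)⁻¹ = 1 := by
  rw [Finset.sum_const, Finset.card_univ, Fintype.card_fun, Fintype.card_fin, Fintype.card_fin, nsmul_eq_mul]
  have : ((L : ℂ)) ^ d ≠ 0 := pow_ne_zero _ (by exact_mod_cast (by omega : L ≠ 0))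
  rw [Nat.cast_pow, mul_inv_cancel₀ this]

/-- The bond exponent is the plain average of the contour functionals: `g(q,κ) = Σ_r L^{−d} A(Γ_{c,x_r})`
(the `−A(c)` inside `Ξ` and the `+A(c)` cancel because the weights sum to one). [folklore] -/
theorem bondExp_eq (L : ℕ) (hL : 1 ≤ L) (f : Site d → Fin d → ℂ) (q : Site d) (κ : Fin d) :
    bondExp L f q κ = ∑ r : Fin d → Fin L, ((L : ℂ) ^ d)⁻¹ * asum f q (gammaWord L κ (boxVec L r)) := by
  unfold bondExp Xi
  simp_rw [mul_sub, Finset.sum_sub_distrib, ← Finset.sum_mul, sum_weights_complex L hL, one_mul, sub_add_cancel]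

/-- **THE CORNER CANCELLATION, AVERAGED** (B7 (48), first equality, summed over the block with weights `L^{−d}`):
`g(z,μ) + g(z+Le_μ,ν) − g(z+Le_ν,μ) − g(z,ν) = Σ_r L^{−d} A(∂(P)_{z+r})`. [cite: Balaban1985Averaging, (48) p.25] -/
theorem bondExp_plaq (L : ℕ) (hL : 1 ≤ L) (f : Site d → Fin d → ℂ) (z : Site d) (μ ν : Fin d) :
    bondExp L f z μ + bondExp L f (z + (L : ℤ) • e μ) ν - bondExp L f (z + (L : ℤ) • e ν) μ - bondExp L f z ν
      = stencilExp L f z μ ν := by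
  simp_rw [bondExp_eq L hL, stencilExp, ← Finset.sum_add_distrib, ← Finset.sum_sub_distrib]
  refine Finset.sum_congr rfl fun r _ => ?_
  rw [← mul_add, ← mul_sub, ← mul_sub, corner_cancellation]

/-- (42) on a small-exponent scalar configuration, all bonds: `V̄(q,κ) = e^{g(q,κ)}·1`. [cite: Balaban1985Averaging, (42) p.23] -/
theorem bavg_scalarCfg_eq [Nonempty n] (L : ℕ) {f : Site d → Fin d → ℂ} (hf : SmallExp L f) (q : Site d) (κ : Fin d) :
    bavg L (scalarCfg (n := n) f) q κ = expUnit (bondExp L f q κ • (1 : Matrix n n ℂ)) :=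
  bavg_scalarCfg L f q κ (hf q κ)

/-- **THE EXACT ABELIAN STENCIL** (B7 (42) + (44) + (48) on a small-exponent scalar configuration): the averaged
plaquette variable is `e^{Σ_r L^{−d} A(∂(P)_{z+r})}·1` — Bałaban's non-linear average, restricted to scalar
configurations inside the log branch, IS the linear block-stencil average of B5 (1.18)/(48), with NO transverse or
higher-order corrections. [cite: Balaban1985Averaging, (42) p.23, (44) p.24, (48) p.25] -/
theorem val_cplaq_bavg_scalarCfg [Nonempty n] (L : ℕ) (hL : 1 ≤ L) {f : Site d → Fin d → ℂ} (hf : SmallExp L f)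
    (z : Site d) (μ ν : Fin d) :
    ((cplaq L (bavg L (scalarCfg (n := n) f)) z μ ν : (Matrix n n ℂ)ˣ) : Matrix n n ℂ)
      = exp (stencilExp L f z μ ν • (1 : Matrix n n ℂ)) := by
  rw [val_cplaq_of_scalar L (fun x κ => bavg_scalarCfg_eq L hf x κ), bondExp_plaq L hL]

/-- The coarse plaquette variable of the window bookkeeping (`chol`, corner `L • y`). [folklore] -/
theorem chol_scalarCfg [Nonempty n] (L : ℕ) (hL : 1 ≤ L) {f : Site d → Fin d → ℂ} (hf : SmallExp L f) (P : Plaq d) :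
    chol L (scalarCfg (n := n) f) P = expUnit (stencilExp L f ((L : ℤ) • P.1) P.2.1.1 P.2.1.2 • (1 : Matrix n n ℂ)) := by
  apply Units.ext
  rw [chol, val_cplaq_bavg_scalarCfg L hL hf, val_expUnit]

/-- **STOKES FORM of the stencil exponent** (B7 (48), second equality): `Σ_r L^{−d} Σ_{i,j<L} A(∂p′_{z+r+ie_μ+je_ν})` —
the `L^{d}·L²` fine plaquettes of the stencil with the tent multiplicities. [cite: Balaban1985Averaging, (48) p.25] -/
theorem stencilExp_eq_sum_plaq (L : ℕ) (f : Site d → Fin d → ℂ) (z : Site d) (μ ν : Fin d) :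
    stencilExp L f z μ ν = ∑ r : Fin d → Fin L, ((L : ℂ) ^ d)⁻¹ *
      ∑ i ∈ Finset.range L, ∑ j ∈ Finset.range L,
        asum f (z + boxVec L r + (i : ℤ) • e μ + (j : ℤ) • e ν) (plaqWord μ ν) := by
  unfold stencilExp
  simp_rw [stokes]

/-! ### Unitary scalar configurations: purely imaginary exponents `f = iA`, and the deficit as a REAL functional -/

/-- The purely imaginary exponent field `iA` of a `U(1) ⊂ U(N)`-valued scalar configuration. [folklore] -/
def imCfg (A : Site d → Fin d → ℝ) : Site d → Fin d → ℂ := fun x κ => ((A x κ : ℝ) : ℂ) * Complex.I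

/-- One step: `stepA (iA) = i·stepA A`. [folklore] -/
theorem stepA_imCfg (A : Site d → Fin d → ℝ) (x : Site d) (l : Letter d) :
    stepA (imCfg A) x l = ((stepA A x l : ℝ) : ℂ) * Complex.I := by
  rcases l with ⟨μ, _ | _⟩
  · rw [stepA_false, stepA_false, imCfg]; push_cast; ring
  · rw [stepA_true, stepA_true, imCfg]

/-- Path functional: `asum (iA) = i·asum A`. [folklore] -/
theorem asum_imCfg (A : Site d → Fin d → ℝ) :
    ∀ (x : Site d) (w : List (Letter d)), asum (imCfg A) x w = ((asum A x w : ℝ) : ℂ) * Complex.I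
  | x, [] => by simp
  | x, l :: w => by
    rw [asum_cons, asum_cons, stepA_imCfg, asum_imCfg A _ w]; push_cast; ring

/-- `iA`-configurations are `U(N)`-valued. [folklore] -/
theorem isUnitaryCfg_imCfg (A : Site d → Fin d → ℝ) : IsUnitaryCfg (scalarCfg (n := n) (imCfg A)) := by
  intro x κ
  rw [mem_unitaryUnits, scalarCfg, val_expUnit, ← cexp_smul_one]
  exact smul_one_mem_unitary (by rw [imCfg, Complex.norm_exp_ofReal_mul_I])

/-- The log-branch hypothesis for `iA` in real terms. [folklore] -/
theorem smallExp_imCfg_iff (L : ℕ) (A : Site d → Fin d → ℝ) :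
    SmallExp L (imCfg A) ↔ ∀ (q : Site d) (κ : Fin d) (r : Fin d → Fin L),
      |asum A q (gammaWord L κ (boxVec L r)) - asum A q (seg κ L)| < Real.log 2 := by
  unfold SmallExp
  simp_rw [asum_imCfg, ← sub_mul, ← Complex.ofReal_sub, norm_real_mul_I]

/-- THE STENCIL ANGLE `Θ_P = Σ_r L^{−d} A(∂(P)_{Lz... + r})` (real). [folklore] -/
def stencilAngle (L : ℕ) (A : Site d → Fin d → ℝ) (z : Site d) (μ ν : Fin d) : ℝ :=
  ∑ r : Fin d → Fin L, ((L : ℝ) ^ d)⁻¹ * asum A (z + boxVec L r) (rectWord L L μ ν)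

/-- THE FINE PLAQUETTE ANGLE `θ_{p′} = A(∂p′)`. [folklore] -/
def plaqAngle (A : Site d → Fin d → ℝ) (p : Plaq d) : ℝ := asum A p.1 (plaqWord p.2.1.1 p.2.1.2)

/-- `stencilExp (iA) = i·stencilAngle A`. [folklore] -/
theorem stencilExp_imCfg (L : ℕ) (A : Site d → Fin d → ℝ) (z : Site d) (μ ν : Fin d) :
    stencilExp L (imCfg A) z μ ν = ((stencilAngle L A z μ ν : ℝ) : ℂ) * Complex.I := by
  unfold stencilExp stencilAngle
  push_cast
  rw [Finset.sum_mul]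
  refine Finset.sum_congr rfl fun r _ => ?_
  rw [asum_imCfg]
  ring

/-- Stokes form of the stencil angle: the tent-weighted sum of the fine plaquette angles. [cite: Balaban1985Averaging, (48) p.25] -/
theorem stencilAngle_eq_sum_plaq (L : ℕ) (A : Site d → Fin d → ℝ) (z : Site d) (μ ν : Fin d) :
    stencilAngle L A z μ ν = ∑ r : Fin d → Fin L, ((L : ℝ) ^ d)⁻¹ *
      ∑ i ∈ Finset.range L, ∑ j ∈ Finset.range L,
        asum A (z + boxVec L r + (i : ℤ) • e μ + (j : ℤ) • e ν) (plaqWord μ ν) := by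
  unfold stencilAngle
  simp_rw [stokes]

/-- **THE COARSE WILSON WEIGHT, EXACTLY**: `1 − Re tr V̄(∂P)/N = 1 − cos Θ_P`. [folklore] -/
theorem wt_chol_imCfg [Nonempty n] (L : ℕ) (hL : 1 ≤ L) {A : Site d → Fin d → ℝ} (hA : SmallExp L (imCfg A))
    (P : Plaq d) :
    wt (chol L (scalarCfg (n := n) (imCfg A)) P)
      = 1 - Real.cos (stencilAngle L A ((L : ℤ) • P.1) P.2.1.1 P.2.1.2) := by
  rw [chol_scalarCfg L hL hA, stencilExp_imCfg, wt_expUnit_smul_one]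

/-- **THE FINE WILSON WEIGHT, EXACTLY**: `1 − Re tr V(∂p′)/N = 1 − cos θ_{p′}`. [folklore] -/
theorem wt_fhol_imCfg [Nonempty n] (A : Site d → Fin d → ℝ) (p : Plaq d) :
    wt (fhol (scalarCfg (n := n) (imCfg A)) p) = 1 - Real.cos (plaqAngle A p) := by
  rw [fhol, hol_scalarCfg, asum_imCfg, wt_expUnit_smul_one, plaqAngle]

/-- The real stencil deficit functional of a potential `A` on a window pair (no matrices, no logarithms). [folklore] -/
def stencilDeficit (L : ℕ) (A : Site d → Fin d → ℝ) (W : Finset (Plaq d) × Finset (Plaq d)) : ℝ :=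
  (L : ℝ) ^ ((d : ℤ) - 4) * ∑ P ∈ W.1, (1 - Real.cos (stencilAngle L A ((L : ℤ) • P.1) P.2.1.1 P.2.1.2))
    - ∑ p ∈ W.2, (1 - Real.cos (plaqAngle A p))

/-- **THE AVERAGING DEFICIT OF A SMALL-EXPONENT ABELIAN CONFIGURATION IS THE REAL STENCIL FUNCTIONAL, EXACTLY** —
every dimension, every `L ≥ 1`, every window pair: `𝓓_W(e^{iA}·1) = L^{d−4} Σ_{P∈W_c}(1 − cos Θ_P) − Σ_{p′∈W_f}(1 − cos θ_{p′})`.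
This is the kernel form of the identity «engine A = engine C» of the record's numerics, and it reduces the abelian
sector of the repaired walls β′-loc / β′-per to inequalities for `stencilDeficit`. [folklore] -/
theorem deficit_imCfg [Nonempty n] (L : ℕ) (hL : 1 ≤ L) {A : Site d → Fin d → ℝ} (hA : SmallExp L (imCfg A))
    (W : Finset (Plaq d) × Finset (Plaq d)) :
    deficit L (scalarCfg (n := n) (imCfg A)) W = stencilDeficit L A W := by
  rw [deficit, coarseAction, fineAction, stencilDeficit]
  simp_rw [wt_chol_imCfg L hL hA, wt_fhol_imCfg]

/-- The refuting family of §2 is such a configuration: `famF = i·A_fam`. [folklore] -/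
def famA (b δ : ℝ) : Site (d + 2) → Fin (d + 2) → ℝ := fun x μ => if μ = 1 then prof b δ (x 0) else 0

/-- `famF b δ = imCfg (famA b δ)`. [folklore] -/
theorem famF_eq_imCfg (b δ : ℝ) : famF (d := d) b δ = imCfg (famA b δ) := by
  funext x μ
  by_cases hμ : μ = 1
  · rw [hμ, famF_one, imCfg, famA, if_pos rfl]
  · rw [famF_of_ne_one b δ x hμ, imCfg, famA, if_neg hμ]; push_cast; ring

/-- … and it lies inside the log branch for `b + δ ≤ 1/4` (`phi_fam_small`), so `deficit_imCfg` recomputes `deficit_fam`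
through the stencil functional. [folklore] -/
theorem smallExp_famF {b δ : ℝ} (hb : 0 ≤ b) (hδ : 0 ≤ δ) (hsm : b + δ ≤ 1 / 4) : SmallExp 2 (famF (d := d) b δ) :=
  fun q κ r => phi_fam_small b δ hb hδ hsm q κ r

/-- Sanity (non-vacuity of the class beyond the family): the FLAT potential is in the class and has zero stencil deficit. [folklore] -/
theorem stencilDeficit_zero (L : ℕ) (W : Finset (Plaq d) × Finset (Plaq d)) :
    stencilDeficit L (fun (_ : Site d) (_ : Fin d) => (0 : ℝ)) W = 0 := by
  have h1 : ∀ (x : Site d) (w : List (Letter d)), asum (fun (_ : Site d) (_ : Fin d) => (0 : ℝ)) x w = 0 := by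
    intro x w
    induction w generalizing x with
    | nil => simp
    | cons l w ih =>
      rw [asum_cons, ih]
      rcases l with ⟨μ, _ | _⟩
      · simp [stepA_false]
      · simp [stepA_true]
  simp [stencilDeficit, stencilAngle, plaqAngle, h1]

end AbelianStencil

/-! ## §6 [v1.2] The quadratic / quartic split of the real stencil functional: `1 − cos x = x²/2 − r(x)`,
`0 ≤ r(x) ≤ 5x⁴/96` (`|x| ≤ 1`), so `stencilDeficit = quadDeficit −` (signed quartic remainders); the quadratic part is
the functional of the linear stencil model, the remainders are fourth order in the angles -/

section QuadQuartic

/-- The Taylor remainder of the Wilson weight of an angle: `r(x) = x²/2 − (1 − cos x)`. [folklore] -/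
def cosRem (x : ℝ) : ℝ := x ^ 2 / 2 - (1 - Real.cos x)

/-- `1 − cos x = x²/2 − r(x)`. [folklore] -/
theorem one_sub_cos_eq (x : ℝ) : 1 - Real.cos x = x ^ 2 / 2 - cosRem x := by
  unfold cosRem; ring

/-- `r(x) ≥ 0` (`cos x ≥ 1 − x²/2`, Mathlib `Real.one_sub_sq_div_two_le_cos`). [folklore] -/
theorem cosRem_nonneg (x : ℝ) : 0 ≤ cosRem x := by
  have h : 1 - x ^ 2 / 2 ≤ Real.cos x := Real.one_sub_sq_div_two_le_cos
  unfold cosRem; linarith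

/-- `r(x) ≤ 5x⁴/96` for `|x| ≤ 1` (Mathlib `Real.cos_bound`). [folklore] -/
theorem cosRem_le {x : ℝ} (hx : |x| ≤ 1) : cosRem x ≤ 5 / 96 * x ^ 4 := by
  have h := (abs_le.mp (Real.cos_bound hx)).2
  have h4 : |x| ^ 4 = x ^ 4 := by
    rw [show (4 : ℕ) = 2 * 2 from rfl, pow_mul, sq_abs, ← pow_mul]
  rw [h4] at h
  unfold cosRem; linarith

/-- `|r(x)| ≤ 5x⁴/96` for `|x| ≤ 1`. [folklore] -/
theorem abs_cosRem_le {x : ℝ} (hx : |x| ≤ 1) : |cosRem x| ≤ 5 / 96 * x ^ 4 := by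
  rw [abs_of_nonneg (cosRem_nonneg x)]; exact cosRem_le hx

/-- THE QUADRATIC STENCIL DEFICIT `𝓓^{(2)}_W(A) = L^{d−4} Σ_{P∈W_c} Θ_P²/2 − Σ_{p′∈W_f} θ_{p′}²/2` — the functional of the
linear block-stencil model (B5 (1.18); tree `T4AveragingDeficit`, record §3). [folklore] -/
def quadDeficit (L : ℕ) (A : Site d → Fin d → ℝ) (W : Finset (Plaq d) × Finset (Plaq d)) : ℝ :=
  (L : ℝ) ^ ((d : ℤ) - 4) * ∑ P ∈ W.1, (stencilAngle L A ((L : ℤ) • P.1) P.2.1.1 P.2.1.2) ^ 2 / 2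
    - ∑ p ∈ W.2, (plaqAngle A p) ^ 2 / 2

/-- The coarse quartic budget `L^{d−4} Σ_{P∈W_c} Θ_P⁴`. [folklore] -/
def coarseQuartic (L : ℕ) (A : Site d → Fin d → ℝ) (W : Finset (Plaq d) × Finset (Plaq d)) : ℝ :=
  (L : ℝ) ^ ((d : ℤ) - 4) * ∑ P ∈ W.1, (stencilAngle L A ((L : ℤ) • P.1) P.2.1.1 P.2.1.2) ^ 4

/-- The fine quartic budget `Σ_{p′∈W_f} θ_{p′}⁴`. [folklore] -/
def fineQuartic (A : Site d → Fin d → ℝ) (W : Finset (Plaq d) × Finset (Plaq d)) : ℝ :=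
  ∑ p ∈ W.2, (plaqAngle A p) ^ 4

/-- **THE SPLIT**: `stencilDeficit = quadDeficit − (L^{d−4} Σ_P r(Θ_P) − Σ_{p′} r(θ_{p′}))`, exactly. [folklore] -/
theorem stencilDeficit_eq_quad_sub (L : ℕ) (A : Site d → Fin d → ℝ) (W : Finset (Plaq d) × Finset (Plaq d)) :
    stencilDeficit L A W = quadDeficit L A W
      - ((L : ℝ) ^ ((d : ℤ) - 4) * ∑ P ∈ W.1, cosRem (stencilAngle L A ((L : ℤ) • P.1) P.2.1.1 P.2.1.2)
          - ∑ p ∈ W.2, cosRem (plaqAngle A p)) := by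
  unfold stencilDeficit quadDeficit
  simp_rw [one_sub_cos_eq, Finset.sum_sub_distrib]
  ring

/-- `0 ≤ L^{d−4}`. [folklore] -/
theorem zpow_weight_nonneg (L : ℕ) : 0 ≤ (L : ℝ) ^ ((d : ℤ) - 4) := zpow_nonneg (Nat.cast_nonneg L) _

/-- **UPPER HALF**: `stencilDeficit ≤ quadDeficit + (5/96) Σ_{p′∈W_f} θ_{p′}⁴` whenever the fine angles of the window
are `≤ 1` in modulus (the coarse remainders only help: `−L^{d−4} Σ r(Θ_P) ≤ 0`). [folklore] -/
theorem stencilDeficit_le_quad (L : ℕ) (A : Site d → Fin d → ℝ) (W : Finset (Plaq d) × Finset (Plaq d))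
    (hθ : ∀ p ∈ W.2, |plaqAngle A p| ≤ 1) :
    stencilDeficit L A W ≤ quadDeficit L A W + 5 / 96 * fineQuartic A W := by
  rw [stencilDeficit_eq_quad_sub]
  have h1 : 0 ≤ (L : ℝ) ^ ((d : ℤ) - 4) * ∑ P ∈ W.1, cosRem (stencilAngle L A ((L : ℤ) • P.1) P.2.1.1 P.2.1.2) :=
    mul_nonneg (zpow_weight_nonneg L) (Finset.sum_nonneg fun P _ => cosRem_nonneg _)
  have h2 : ∑ p ∈ W.2, cosRem (plaqAngle A p) ≤ ∑ p ∈ W.2, 5 / 96 * plaqAngle A p ^ 4 :=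
    Finset.sum_le_sum fun p hp => cosRem_le (hθ p hp)
  have h3 : ∑ p ∈ W.2, 5 / 96 * plaqAngle A p ^ 4 = 5 / 96 * fineQuartic A W := by
    rw [fineQuartic, Finset.mul_sum]
  linarith

/-- **LOWER HALF**: `quadDeficit − (5/96) L^{d−4} Σ_{P∈W_c} Θ_P⁴ ≤ stencilDeficit` whenever the coarse stencil angles of
the window are `≤ 1` in modulus (the fine remainders only help). [folklore] -/
theorem quad_sub_le_stencilDeficit (L : ℕ) (A : Site d → Fin d → ℝ) (W : Finset (Plaq d) × Finset (Plaq d))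
    (hΘ : ∀ P ∈ W.1, |stencilAngle L A ((L : ℤ) • P.1) P.2.1.1 P.2.1.2| ≤ 1) :
    quadDeficit L A W - 5 / 96 * coarseQuartic L A W ≤ stencilDeficit L A W := by
  rw [stencilDeficit_eq_quad_sub, coarseQuartic]
  have h1 : 0 ≤ ∑ p ∈ W.2, cosRem (plaqAngle A p) := Finset.sum_nonneg fun p _ => cosRem_nonneg _
  have h2 : ∑ P ∈ W.1, cosRem (stencilAngle L A ((L : ℤ) • P.1) P.2.1.1 P.2.1.2)
      ≤ ∑ P ∈ W.1, 5 / 96 * (stencilAngle L A ((L : ℤ) • P.1) P.2.1.1 P.2.1.2) ^ 4 :=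
    Finset.sum_le_sum fun P hP => cosRem_le (hΘ P hP)
  have h3 : (L : ℝ) ^ ((d : ℤ) - 4) * ∑ P ∈ W.1, cosRem (stencilAngle L A ((L : ℤ) • P.1) P.2.1.1 P.2.1.2)
      ≤ (L : ℝ) ^ ((d : ℤ) - 4) * ∑ P ∈ W.1, 5 / 96 * (stencilAngle L A ((L : ℤ) • P.1) P.2.1.1 P.2.1.2) ^ 4 :=
    mul_le_mul_of_nonneg_left h2 (zpow_weight_nonneg L)
  have h4 : (L : ℝ) ^ ((d : ℤ) - 4) * ∑ P ∈ W.1, 5 / 96 * (stencilAngle L A ((L : ℤ) • P.1) P.2.1.1 P.2.1.2) ^ 4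
      = 5 / 96 * ((L : ℝ) ^ ((d : ℤ) - 4) * ∑ P ∈ W.1, (stencilAngle L A ((L : ℤ) • P.1) P.2.1.1 P.2.1.2) ^ 4) := by
    rw [← Finset.mul_sum]; ring
  linarith

/-- **TWO-SIDED**: `|stencilDeficit − quadDeficit| ≤ (5/96)(L^{d−4} Σ Θ_P⁴ + Σ θ_{p′}⁴)` on windows whose fine and coarse
angles are `≤ 1` in modulus: the abelian averaging deficit is the linear-model deficit up to FOURTH order in the angles
(for `|θ| ≤ a ≤ 1` the remainder is `≤ (5/96)(L^{d+4}·#W_c + #W_f)·a⁴`, inside the `a³·volume` slot of the walls). [folklore] -/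
theorem abs_stencilDeficit_sub_quad_le (L : ℕ) (A : Site d → Fin d → ℝ) (W : Finset (Plaq d) × Finset (Plaq d))
    (hθ : ∀ p ∈ W.2, |plaqAngle A p| ≤ 1)
    (hΘ : ∀ P ∈ W.1, |stencilAngle L A ((L : ℤ) • P.1) P.2.1.1 P.2.1.2| ≤ 1) :
    |stencilDeficit L A W - quadDeficit L A W| ≤ 5 / 96 * (coarseQuartic L A W + fineQuartic A W) := by
  have hu := stencilDeficit_le_quad L A W hθ
  have hl := quad_sub_le_stencilDeficit L A W hΘ
  have hc : 0 ≤ coarseQuartic L A W :=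
    mul_nonneg (zpow_weight_nonneg L) (Finset.sum_nonneg fun P _ => by positivity)
  have hf : 0 ≤ fineQuartic A W := Finset.sum_nonneg fun p _ => by positivity
  rw [abs_le]; constructor <;> linarith

/-- The stencil angle is a weighted average with total weight `L²`: `|Θ_P| ≤ L²·t` if every fine angle is `≤ t`. [folklore] -/
theorem abs_stencilAngle_le (L : ℕ) (hL : 1 ≤ L) (A : Site d → Fin d → ℝ) (z : Site d) (μ ν : Fin d) {t : ℝ}
    (h : ∀ x : Site d, |asum A x (plaqWord μ ν)| ≤ t) :
    |stencilAngle L A z μ ν| ≤ (L : ℝ) ^ 2 * t := by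
  rw [stencilAngle_eq_sum_plaq]
  have hw : 0 ≤ ((L : ℝ) ^ d)⁻¹ := by positivity
  have hin : ∀ r : Fin d → Fin L, |((L : ℝ) ^ d)⁻¹ * ∑ i ∈ Finset.range L, ∑ j ∈ Finset.range L,
      asum A (z + boxVec L r + (i : ℤ) • e μ + (j : ℤ) • e ν) (plaqWord μ ν)| ≤ ((L : ℝ) ^ d)⁻¹ * ((L : ℝ) ^ 2 * t) := by
    intro r
    rw [abs_mul, abs_of_nonneg hw]
    refine mul_le_mul_of_nonneg_left ?_ hw
    refine (Finset.abs_sum_le_sum_abs _ _).trans ?_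
    have : ∑ i ∈ Finset.range L, |∑ j ∈ Finset.range L,
        asum A (z + boxVec L r + (i : ℤ) • e μ + (j : ℤ) • e ν) (plaqWord μ ν)| ≤ ∑ _i ∈ Finset.range L, (L : ℝ) * t := by
      refine Finset.sum_le_sum fun i _ => ?_
      refine (Finset.abs_sum_le_sum_abs _ _).trans ?_
      have : ∑ j ∈ Finset.range L, |asum A (z + boxVec L r + (i : ℤ) • e μ + (j : ℤ) • e ν) (plaqWord μ ν)|
          ≤ ∑ _j ∈ Finset.range L, t := Finset.sum_le_sum fun j _ => h _
      rw [Finset.sum_const, Finset.card_range, nsmul_eq_mul] at this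
      exact this
    rw [Finset.sum_const, Finset.card_range, nsmul_eq_mul] at this
    refine this.trans (le_of_eq ?_)
    ring
  refine (Finset.abs_sum_le_sum_abs _ _).trans ?_
  refine (Finset.sum_le_sum fun r _ => hin r).trans (le_of_eq ?_)
  rw [Finset.sum_const, Finset.card_univ, Fintype.card_fun, Fintype.card_fin, Fintype.card_fin, nsmul_eq_mul]
  have : ((L : ℝ)) ^ d ≠ 0 := pow_ne_zero _ (by exact_mod_cast (by omega : L ≠ 0))
  rw [Nat.cast_pow, ← mul_assoc, mul_inv_cancel₀ this, one_mul]

/-- … so `|θ| ≤ a` everywhere with `L²·a ≤ 1` puts every window inside the hypotheses of the split. [folklore] -/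
theorem abs_stencilAngle_le_one (L : ℕ) (hL : 1 ≤ L) (A : Site d → Fin d → ℝ) {a : ℝ}
    (h : ∀ (x : Site d) (μ ν : Fin d), |asum A x (plaqWord μ ν)| ≤ a) (ha : (L : ℝ) ^ 2 * a ≤ 1)
    (z : Site d) (μ ν : Fin d) : |stencilAngle L A z μ ν| ≤ 1 :=
  (abs_stencilAngle_le L hL A z μ ν (fun x => h x μ ν)).trans ha

/-- The quartic budgets under `|θ| ≤ a`, `L²a ≤ 1`: `Σ_{W_f} θ⁴ ≤ #W_f·a⁴`, `L^{d−4}Σ_{W_c} Θ⁴ ≤ L^{d−4}·#W_c·(L²a)⁴`. [folklore] -/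
theorem fineQuartic_le (A : Site d → Fin d → ℝ) (W : Finset (Plaq d) × Finset (Plaq d)) {a : ℝ}
    (h : ∀ (x : Site d) (μ ν : Fin d), |asum A x (plaqWord μ ν)| ≤ a) :
    fineQuartic A W ≤ W.2.card * a ^ 4 := by
  unfold fineQuartic
  have : ∀ p ∈ W.2, plaqAngle A p ^ 4 ≤ a ^ 4 := by
    intro p _
    rw [show plaqAngle A p ^ 4 = |plaqAngle A p| ^ 4 by
      rw [show (4 : ℕ) = 2 * 2 from rfl, pow_mul, pow_mul, sq_abs]]
    exact pow_le_pow_left₀ (abs_nonneg _) (h p.1 p.2.1.1 p.2.1.2) 4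
  refine (Finset.sum_le_sum this).trans (le_of_eq ?_)
  rw [Finset.sum_const, nsmul_eq_mul]

/-- The coarse quartic budget under `|θ| ≤ a`: `L^{d−4}Σ_{W_c} Θ⁴ ≤ L^{d−4}·#W_c·(L²a)⁴`. [folklore] -/
theorem coarseQuartic_le (L : ℕ) (hL : 1 ≤ L) (A : Site d → Fin d → ℝ) (W : Finset (Plaq d) × Finset (Plaq d))
    {a : ℝ} (h : ∀ (x : Site d) (μ ν : Fin d), |asum A x (plaqWord μ ν)| ≤ a) :
    coarseQuartic L A W ≤ (L : ℝ) ^ ((d : ℤ) - 4) * (W.1.card * ((L : ℝ) ^ 2 * a) ^ 4) := by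
  unfold coarseQuartic
  refine mul_le_mul_of_nonneg_left ?_ (zpow_weight_nonneg L)
  have : ∀ P ∈ W.1, stencilAngle L A ((L : ℤ) • P.1) P.2.1.1 P.2.1.2 ^ 4 ≤ ((L : ℝ) ^ 2 * a) ^ 4 := by
    intro P _
    rw [show stencilAngle L A ((L : ℤ) • P.1) P.2.1.1 P.2.1.2 ^ 4 = |stencilAngle L A ((L : ℤ) • P.1) P.2.1.1 P.2.1.2| ^ 4 by
      rw [show (4 : ℕ) = 2 * 2 from rfl, pow_mul, pow_mul, sq_abs]]
    exact pow_le_pow_left₀ (abs_nonneg _) (abs_stencilAngle_le L hL A _ _ _ (fun x => h x _ _)) 4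
  refine (Finset.sum_le_sum this).trans (le_of_eq ?_)
  rw [Finset.sum_const, nsmul_eq_mul]

/-! ### Jensen / Cauchy–Schwarz for the stencil: the coarse quadratic term is dominated by the tent-weighted fine one -/

/-- Cauchy–Schwarz on `range L`: `(Σ_{i<L} f i)² ≤ L·Σ_{i<L} (f i)²`. [folklore] -/
theorem sq_sum_range_le (L : ℕ) (f : ℕ → ℝ) :
    (∑ i ∈ Finset.range L, f i) ^ 2 ≤ (L : ℝ) * ∑ i ∈ Finset.range L, (f i) ^ 2 := by
  have h := sq_sum_le_card_mul_sum_sq (s := Finset.range L) (f := f)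
  rwa [Finset.card_range] at h

/-- Cauchy–Schwarz on the block `[0,L)^d`: `(Σ_r f r)² ≤ L^d·Σ_r (f r)²`. [folklore] -/
theorem sq_sum_box_le (L : ℕ) (f : (Fin d → Fin L) → ℝ) :
    (∑ r, f r) ^ 2 ≤ (L : ℝ) ^ d * ∑ r, (f r) ^ 2 := by
  have h := sq_sum_le_card_mul_sum_sq (s := (Finset.univ : Finset (Fin d → Fin L))) (f := f)
  rwa [Finset.card_univ, Fintype.card_fun, Fintype.card_fin, Fintype.card_fin, Nat.cast_pow] at h

/-- **JENSEN FOR THE STENCIL** (the averaging weights `L^{−d}` over `(r,i,j)` have total mass `L²`):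
`L^{d}·Θ_P² ≤ L²·Σ_{r,i,j} θ²_{z+r+ie_μ+je_ν}`. This is the pointwise heart of the one-sided (Federbush-type) stability of
the quadratic stencil deficit: summed over a window it bounds the coarse quadratic action by the tent-weighted fine one.
[folklore] -/
theorem sq_stencilAngle_le (L : ℕ) (hL : 1 ≤ L) (A : Site d → Fin d → ℝ) (z : Site d) (μ ν : Fin d) :
    (L : ℝ) ^ d * (stencilAngle L A z μ ν) ^ 2 ≤ (L : ℝ) ^ 2 * ∑ r : Fin d → Fin L,
      ∑ i ∈ Finset.range L, ∑ j ∈ Finset.range L,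
        (asum A (z + boxVec L r + (i : ℤ) • e μ + (j : ℤ) • e ν) (plaqWord μ ν)) ^ 2 := by
  have h0 : (L : ℝ) ≠ 0 := by exact_mod_cast (by omega : L ≠ 0)
  have hLd : (0 : ℝ) < (L : ℝ) ^ d := by positivity
  rw [stencilAngle_eq_sum_plaq, ← Finset.mul_sum, mul_pow, ← mul_assoc,
    show (L : ℝ) ^ d * ((L : ℝ) ^ d)⁻¹ ^ 2 = ((L : ℝ) ^ d)⁻¹ by field_simp]
  have h1 := sq_sum_box_le L (fun r : Fin d → Fin L => ∑ i ∈ Finset.range L, ∑ j ∈ Finset.range L,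
    asum A (z + boxVec L r + (i : ℤ) • e μ + (j : ℤ) • e ν) (plaqWord μ ν))
  have h2 : ∀ r : Fin d → Fin L, (∑ i ∈ Finset.range L, ∑ j ∈ Finset.range L,
      asum A (z + boxVec L r + (i : ℤ) • e μ + (j : ℤ) • e ν) (plaqWord μ ν)) ^ 2
        ≤ (L : ℝ) * ∑ i ∈ Finset.range L, ((L : ℝ) * ∑ j ∈ Finset.range L,
          (asum A (z + boxVec L r + (i : ℤ) • e μ + (j : ℤ) • e ν) (plaqWord μ ν)) ^ 2) := by
    intro r
    refine (sq_sum_range_le L _).trans ?_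
    refine mul_le_mul_of_nonneg_left ?_ (Nat.cast_nonneg L)
    exact Finset.sum_le_sum fun i _ => sq_sum_range_le L _
  have h3 : ∑ r : Fin d → Fin L, (∑ i ∈ Finset.range L, ∑ j ∈ Finset.range L,
      asum A (z + boxVec L r + (i : ℤ) • e μ + (j : ℤ) • e ν) (plaqWord μ ν)) ^ 2
        ≤ (L : ℝ) ^ 2 * ∑ r : Fin d → Fin L, ∑ i ∈ Finset.range L, ∑ j ∈ Finset.range L,
          (asum A (z + boxVec L r + (i : ℤ) • e μ + (j : ℤ) • e ν) (plaqWord μ ν)) ^ 2 := by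
    refine (Finset.sum_le_sum fun r _ => h2 r).trans (le_of_eq ?_)
    rw [Finset.mul_sum]
    refine Finset.sum_congr rfl fun r _ => ?_
    rw [Finset.mul_sum, Finset.mul_sum]
    refine Finset.sum_congr rfl fun i _ => ?_
    ring
  calc ((L : ℝ) ^ d)⁻¹ * (∑ r : Fin d → Fin L, ∑ i ∈ Finset.range L, ∑ j ∈ Finset.range L,
          asum A (z + boxVec L r + (i : ℤ) • e μ + (j : ℤ) • e ν) (plaqWord μ ν)) ^ 2
      ≤ ((L : ℝ) ^ d)⁻¹ * ((L : ℝ) ^ d * ∑ r : Fin d → Fin L, (∑ i ∈ Finset.range L, ∑ j ∈ Finset.range L,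
          asum A (z + boxVec L r + (i : ℤ) • e μ + (j : ℤ) • e ν) (plaqWord μ ν)) ^ 2) :=
        mul_le_mul_of_nonneg_left h1 (inv_nonneg.mpr hLd.le)
    _ = ∑ r : Fin d → Fin L, (∑ i ∈ Finset.range L, ∑ j ∈ Finset.range L,
          asum A (z + boxVec L r + (i : ℤ) • e μ + (j : ℤ) • e ν) (plaqWord μ ν)) ^ 2 := by
        rw [← mul_assoc, inv_mul_cancel₀ hLd.ne', one_mul]
    _ ≤ _ := h3

/-- `L^{d−4} = L^d / L⁴` (real powers of the block side). [folklore] -/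
theorem zpow_sub_four_eq (L : ℕ) (hL : 1 ≤ L) : (L : ℝ) ^ ((d : ℤ) - 4) = (L : ℝ) ^ d / (L : ℝ) ^ 4 := by
  have h0 : (L : ℝ) ≠ 0 := by exact_mod_cast (by omega : L ≠ 0)
  rw [zpow_sub₀ h0, zpow_natCast, show (4 : ℤ) = ((4 : ℕ) : ℤ) from rfl, zpow_natCast]

/-- **THE COARSE QUADRATIC TERM IS DOMINATED BY THE FINE ONE, POINTWISE**:
`L^{d−4}·Θ_P²/2 ≤ L^{−2}/2 · Σ_{r,i,j} θ²_{Lz+r+ie_μ+je_ν}` — each of the `L^{d}·L²` fine plaquettes of the stencil enters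
with weight `L^{−2}/2`, so a fine plaquette covered by all its `L²` stencil positions contributes at most `θ²/2`, the fine
action density: summed over a window this is `quadDeficit ≤ (overhang boundary terms)`, and `≤ 0` on a torus. [folklore] -/
theorem coarse_quad_term_le (L : ℕ) (hL : 1 ≤ L) (A : Site d → Fin d → ℝ) (z : Site d) (μ ν : Fin d) :
    (L : ℝ) ^ ((d : ℤ) - 4) * (stencilAngle L A z μ ν) ^ 2 / 2 ≤ ((L : ℝ) ^ 2)⁻¹ / 2 * ∑ r : Fin d → Fin L,
      ∑ i ∈ Finset.range L, ∑ j ∈ Finset.range L,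
        (asum A (z + boxVec L r + (i : ℤ) • e μ + (j : ℤ) • e ν) (plaqWord μ ν)) ^ 2 := by
  have h0 : (0 : ℝ) < (L : ℝ) := by exact_mod_cast (by omega : 0 < L)
  have h4 : (0 : ℝ) < (L : ℝ) ^ 4 := by positivity
  have h := sq_stencilAngle_le L hL A z μ ν
  rw [zpow_sub_four_eq L hL]
  rw [show (L : ℝ) ^ d / (L : ℝ) ^ 4 * stencilAngle L A z μ ν ^ 2 / 2
      = ((L : ℝ) ^ 4)⁻¹ / 2 * ((L : ℝ) ^ d * stencilAngle L A z μ ν ^ 2) by field_simp,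
    show ((L : ℝ) ^ 2)⁻¹ / 2 * ∑ r : Fin d → Fin L, ∑ i ∈ Finset.range L, ∑ j ∈ Finset.range L,
        (asum A (z + boxVec L r + (i : ℤ) • e μ + (j : ℤ) • e ν) (plaqWord μ ν)) ^ 2
      = ((L : ℝ) ^ 4)⁻¹ / 2 * ((L : ℝ) ^ 2 * ∑ r : Fin d → Fin L, ∑ i ∈ Finset.range L, ∑ j ∈ Finset.range L,
        (asum A (z + boxVec L r + (i : ℤ) • e μ + (j : ℤ) • e ν) (plaqWord μ ν)) ^ 2) by field_simp]
  exact mul_le_mul_of_nonneg_left h (by positivity)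

end QuadQuartic

/-! ## §7 [v1.3] WINDOW-LEVEL JENSEN: on every block window the quadratic stencil deficit is bounded above by the fine
quadratic action of the OVERHANG plaquettes (those reached by the stencils of `Y` but not based in the blocks of `Y`) —
a one-sided, boundary-located bound replacing the false two-sided β′ on the abelian class at quadratic order (in the
coarser currency `Σ_{overhang} θ²`; the torus version §8 is sharp: `≤ 0`) -/

section WindowJensen

/-- The block decomposition `(y, r) ↦ L•y + r` of `ℤ^d` (`r ∈ [0,L)^d`) is injective — division with remainder,
coordinate by coordinate. [folklore] -/
theorem blockMap_injective (L : ℕ) (hL : 1 ≤ L) :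
    Function.Injective (fun yr : Site d × (Fin d → Fin L) => (L : ℤ) • yr.1 + boxVec L yr.2) := by
  rintro ⟨y, r⟩ ⟨y', r'⟩ h
  have hL0 : (L : ℤ) ≠ 0 := by exact_mod_cast (by omega : L ≠ 0)
  have hc : ∀ κ, (L : ℤ) * y κ + ((r κ : ℕ) : ℤ) = (L : ℤ) * y' κ + ((r' κ : ℕ) : ℤ) := by
    intro κ
    have := congr_fun h κ
    simpa only [boxVec, Pi.add_apply, Pi.smul_apply, smul_eq_mul] using this
  have hdiv : ∀ (a : ℤ) (s : Fin L), ((L : ℤ) * a + ((s : ℕ) : ℤ)) / L = a := by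
    intro a s
    rw [add_comm, Int.add_mul_ediv_left _ _ hL0,
      Int.ediv_eq_zero_of_lt (by positivity) (by exact_mod_cast s.isLt), zero_add]
  have hy : y = y' := by
    funext κ
    have := congrArg (· / (L : ℤ)) (hc κ)
    simpa only [hdiv] using this
  subst hy
  have hr : r = r' := by
    funext κ
    exact Fin.ext (by exact_mod_cast (add_left_cancel (hc κ)))
  subst hr
  rfl

/-- The block sites of `Y` are the image of the block map on `Y × [0,L)^d`. [folklore] -/
theorem blockSites_eq_image (L : ℕ) (Y : Finset (Site d)) :
    blockSites L Y = (Y ×ˢ (Finset.univ : Finset (Fin d → Fin L))).image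
      (fun yr : Site d × (Fin d → Fin L) => (L : ℤ) • yr.1 + boxVec L yr.2) := by
  ext x
  unfold blockSites T4AveragingDeficitWall.block
  simp only [Finset.mem_biUnion, Finset.mem_image, Finset.mem_univ, true_and, Finset.mem_product, and_true,
    Prod.exists]
  constructor
  · rintro ⟨y, hy, r, hr⟩
    exact ⟨y, r, hy, hr⟩
  · rintro ⟨y, r, hy, hr⟩
    exact ⟨y, hy, r, hr⟩

/-- **BLOCK-BY-BLOCK SUMMATION** = summation over the block sites (blocks of distinct coarse sites are disjoint and each
block is an injective image of `[0,L)^d`). [folklore] -/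
theorem sum_blocks_eq (L : ℕ) (hL : 1 ≤ L) (Y : Finset (Site d)) (g : Site d → ℝ) :
    ∑ y ∈ Y, ∑ r : Fin d → Fin L, g ((L : ℤ) • y + boxVec L r) = ∑ x ∈ blockSites L Y, g x := by
  rw [blockSites_eq_image, Finset.sum_image (fun a _ b _ h => blockMap_injective L hL h), Finset.sum_product]

/-- THE REACH of the stencils of `Y` in the plane `(μ,ν)`: all fine corners `x + ie_μ + je_ν`, `x` a block site of `Y`,
`i, j < L`. [folklore] -/
def reach (L : ℕ) (Y : Finset (Site d)) (μ ν : Fin d) : Finset (Site d) :=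
  (blockSites L Y ×ˢ (Finset.range L ×ˢ Finset.range L)).image
    (fun q : Site d × (ℕ × ℕ) => q.1 + (q.2.1 : ℤ) • e μ + (q.2.2 : ℤ) • e ν)

/-- Shifted block sites lie in the reach. [folklore] -/
theorem shift_mem_reach (L : ℕ) (Y : Finset (Site d)) (μ ν : Fin d) {x : Site d} (hx : x ∈ blockSites L Y)
    {i j : ℕ} (hi : i ∈ Finset.range L) (hj : j ∈ Finset.range L) :
    x + (i : ℤ) • e μ + (j : ℤ) • e ν ∈ reach L Y μ ν :=
  Finset.mem_image.mpr ⟨(x, (i, j)), Finset.mem_product.mpr ⟨hx, Finset.mem_product.mpr ⟨hi, hj⟩⟩, rfl⟩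

/-- The block sites themselves lie in the reach (`i = j = 0`). [folklore] -/
theorem blockSites_subset_reach (L : ℕ) (hL : 1 ≤ L) (Y : Finset (Site d)) (μ ν : Fin d) :
    blockSites L Y ⊆ reach L Y μ ν := by
  intro x hx
  have h := shift_mem_reach L Y μ ν hx (i := 0) (j := 0) (Finset.mem_range.mpr (by omega))
    (Finset.mem_range.mpr (by omega))
  simp only [Nat.cast_zero, zero_smul, add_zero] at h
  exact h

/-- A shifted sum of a non-negative function over the block sites is at most its sum over the reach. [folklore] -/
theorem sum_shift_le_sum_reach (L : ℕ) (Y : Finset (Site d)) (μ ν : Fin d) (h : Site d → ℝ)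
    (hh : ∀ x, 0 ≤ h x) {i j : ℕ} (hi : i ∈ Finset.range L) (hj : j ∈ Finset.range L) :
    ∑ x ∈ blockSites L Y, h (x + (i : ℤ) • e μ + (j : ℤ) • e ν) ≤ ∑ x ∈ reach L Y μ ν, h x := by
  have hinj : Set.InjOn (fun x : Site d => x + (i : ℤ) • e μ + (j : ℤ) • e ν)
      ((blockSites L Y : Finset (Site d)) : Set (Site d)) := by
    intro a _ b _ hab
    have : a + ((i : ℤ) • e μ + (j : ℤ) • e ν) = b + ((i : ℤ) • e μ + (j : ℤ) • e ν) := by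
      simpa only [add_assoc] using hab
    exact add_right_cancel this
  calc ∑ x ∈ blockSites L Y, h (x + (i : ℤ) • e μ + (j : ℤ) • e ν)
      = ∑ x ∈ (blockSites L Y).image (fun x : Site d => x + (i : ℤ) • e μ + (j : ℤ) • e ν), h x :=
        (Finset.sum_image hinj).symm
    _ ≤ ∑ x ∈ reach L Y μ ν, h x := by
        refine Finset.sum_le_sum_of_subset_of_nonneg ?_ (fun x _ _ => hh x)
        intro x hx
        obtain ⟨a, ha, rfl⟩ := Finset.mem_image.mp hx
        exact shift_mem_reach L Y μ ν ha hi hj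

/-- Reordering `Σ_r Σ_{i<L} Σ_{j<L}` into `Σ_{(i,j)} Σ_r`. [folklore] -/
theorem sum_rij_eq (L : ℕ) (f : (Fin d → Fin L) → ℕ → ℕ → ℝ) :
    ∑ r : Fin d → Fin L, ∑ i ∈ Finset.range L, ∑ j ∈ Finset.range L, f r i j
      = ∑ p ∈ Finset.range L ×ˢ Finset.range L, ∑ r : Fin d → Fin L, f r p.1 p.2 := by
  rw [Finset.sum_product, Finset.sum_comm]
  refine Finset.sum_congr rfl fun i _ => ?_
  rw [Finset.sum_comm]

/-- **THE COARSE QUADRATIC ACTION OF A WINDOW, AFTER JENSEN AND BLOCK SUMMATION**: for every finite `Y` and plane,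
`Σ_{y∈Y} L^{d−4}Θ²_{(y,μν)}/2 ≤ (L^{−2}/2)·Σ_{(i,j)∈[0,L)²} Σ_{x∈B(Y)} θ²_{(x+ie_μ+je_ν, μν)}` — `L²` shifted copies of
the fine quadratic action of the blocks, each with weight `L^{−2}/2`. [folklore] -/
theorem coarse_plane_le (L : ℕ) (hL : 1 ≤ L) (A : Site d → Fin d → ℝ) (Y : Finset (Site d)) (μ ν : Fin d) :
    ∑ y ∈ Y, (L : ℝ) ^ ((d : ℤ) - 4) * (stencilAngle L A ((L : ℤ) • y) μ ν) ^ 2 / 2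
      ≤ ((L : ℝ) ^ 2)⁻¹ / 2 * ∑ p ∈ Finset.range L ×ˢ Finset.range L,
          ∑ x ∈ blockSites L Y, (asum A (x + (p.1 : ℤ) • e μ + (p.2 : ℤ) • e ν) (plaqWord μ ν)) ^ 2 := by
  -- step 1: pointwise Jensen, summed over the blocks
  have step1 : ∑ y ∈ Y, (L : ℝ) ^ ((d : ℤ) - 4) * (stencilAngle L A ((L : ℤ) • y) μ ν) ^ 2 / 2
      ≤ ∑ y ∈ Y, ((L : ℝ) ^ 2)⁻¹ / 2 * ∑ r : Fin d → Fin L, ∑ i ∈ Finset.range L, ∑ j ∈ Finset.range L,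
          (asum A ((L : ℤ) • y + boxVec L r + (i : ℤ) • e μ + (j : ℤ) • e ν) (plaqWord μ ν)) ^ 2 :=
    Finset.sum_le_sum fun y _ => coarse_quad_term_le L hL A _ μ ν
  -- step 2: reorder and sum block by block: Σ_y Σ_r g(L•y + r + v) = Σ_{x ∈ B(Y)} g(x + v)
  have step2 : ∑ y ∈ Y, ((L : ℝ) ^ 2)⁻¹ / 2 * ∑ r : Fin d → Fin L, ∑ i ∈ Finset.range L, ∑ j ∈ Finset.range L,
          (asum A ((L : ℤ) • y + boxVec L r + (i : ℤ) • e μ + (j : ℤ) • e ν) (plaqWord μ ν)) ^ 2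
      = ((L : ℝ) ^ 2)⁻¹ / 2 * ∑ p ∈ Finset.range L ×ˢ Finset.range L,
          ∑ x ∈ blockSites L Y, (asum A (x + (p.1 : ℤ) • e μ + (p.2 : ℤ) • e ν) (plaqWord μ ν)) ^ 2 := by
    rw [← Finset.mul_sum]
    congr 1
    simp_rw [sum_rij_eq L]
    rw [Finset.sum_comm]
    refine Finset.sum_congr rfl fun p _ => ?_
    exact sum_blocks_eq L hL Y (fun x => (asum A (x + (p.1 : ℤ) • e μ + (p.2 : ℤ) • e ν) (plaqWord μ ν)) ^ 2)
  exact step1.trans (le_of_eq step2)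

/-- **PER-PLANE WINDOW JENSEN**: for every finite `Y` and plane `(μ,ν)`,
`Σ_{y∈Y} L^{d−4}Θ²_{(y,μν)}/2 − Σ_{x∈B(Y)} θ²_{(x,μν)}/2 ≤ ½ Σ_{x ∈ reach ∖ B(Y)} θ²_{(x,μν)}` — the coarse quadratic action
of the window exceeds the fine one by at most the fine quadratic action of the OVERHANG. [folklore] -/
theorem plane_quad_le (L : ℕ) (hL : 1 ≤ L) (A : Site d → Fin d → ℝ) (Y : Finset (Site d)) (μ ν : Fin d) :
    ∑ y ∈ Y, (L : ℝ) ^ ((d : ℤ) - 4) * (stencilAngle L A ((L : ℤ) • y) μ ν) ^ 2 / 2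
        - ∑ x ∈ blockSites L Y, (asum A x (plaqWord μ ν)) ^ 2 / 2
      ≤ 1 / 2 * ∑ x ∈ reach L Y μ ν \ blockSites L Y, (asum A x (plaqWord μ ν)) ^ 2 := by
  set h : Site d → ℝ := fun x => (asum A x (plaqWord μ ν)) ^ 2 with hdef
  have hh : ∀ x, 0 ≤ h x := fun x => by rw [hdef]; positivity
  have hL2 : (0 : ℝ) < (L : ℝ) ^ 2 := by
    have : (0 : ℝ) < (L : ℝ) := by exact_mod_cast (by omega : 0 < L)
    positivity
  have step12 := coarse_plane_le L hL A Y μ ν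
  -- step 3: each shifted sum is at most the sum over the reach; there are L² shifts
  have step3 : ∑ p ∈ Finset.range L ×ˢ Finset.range L,
          ∑ x ∈ blockSites L Y, h (x + (p.1 : ℤ) • e μ + (p.2 : ℤ) • e ν)
      ≤ (L : ℝ) ^ 2 * ∑ x ∈ reach L Y μ ν, h x := by
    have : ∀ p ∈ Finset.range L ×ˢ Finset.range L,
        ∑ x ∈ blockSites L Y, h (x + (p.1 : ℤ) • e μ + (p.2 : ℤ) • e ν) ≤ ∑ x ∈ reach L Y μ ν, h x := by
      intro p hp
      obtain ⟨hi, hj⟩ := Finset.mem_product.mp hp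
      exact sum_shift_le_sum_reach L Y μ ν h hh hi hj
    refine (Finset.sum_le_sum this).trans (le_of_eq ?_)
    rw [Finset.sum_const, Finset.card_product, Finset.card_range, nsmul_eq_mul]
    push_cast
    ring
  -- step 4: split the reach sum into the block part and the overhang
  have step4 : ∑ x ∈ reach L Y μ ν, h x
      = ∑ x ∈ blockSites L Y, h x + ∑ x ∈ reach L Y μ ν \ blockSites L Y, h x := by
    rw [← Finset.sum_sdiff (blockSites_subset_reach L hL Y μ ν), add_comm]
  -- assemble
  have hfine : ∑ x ∈ blockSites L Y, (asum A x (plaqWord μ ν)) ^ 2 / 2 = 1 / 2 * ∑ x ∈ blockSites L Y, h x := by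
    rw [Finset.mul_sum]
    refine Finset.sum_congr rfl fun x _ => ?_
    rw [hdef]; ring
  rw [hfine]
  have key : ((L : ℝ) ^ 2)⁻¹ / 2 * ∑ p ∈ Finset.range L ×ˢ Finset.range L,
          ∑ x ∈ blockSites L Y, h (x + (p.1 : ℤ) • e μ + (p.2 : ℤ) • e ν)
      ≤ 1 / 2 * ∑ x ∈ reach L Y μ ν, h x := by
    have := mul_le_mul_of_nonneg_left step3 (show (0 : ℝ) ≤ ((L : ℝ) ^ 2)⁻¹ / 2 by positivity)
    refine this.trans (le_of_eq ?_)
    field_simp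
  have : ∑ x ∈ reach L Y μ ν \ blockSites L Y, (asum A x (plaqWord μ ν)) ^ 2
      = ∑ x ∈ reach L Y μ ν \ blockSites L Y, h x := Finset.sum_congr rfl fun x _ => by rw [hdef]
  rw [this]
  linarith [step12, step4]

/-- **WINDOW-LEVEL JENSEN (abelian one-sided β′ at quadratic order)**: for every finite set `Y` of coarse sites,
`quadDeficit L A (blockWindow L Y) ≤ ½ Σ_π Σ_{x ∈ reach_π(Y) ∖ B(Y)} θ²_{(x,π)}` — the quadratic stencil deficit of a
block window is at most the fine quadratic action of its OVERHANG plaquettes (a boundary-located quantity,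
`≤ ½·#overhang·max θ²`, i.e. of order `a²·#overhang` under `|θ| ≤ a`: CRUDER than the `a·‖∇F‖_{ℓ¹}` slot of β′-loc, which
would follow from pairing the overhang mass `L^{−2}N_Y` against the equal deficit mass `1 − L^{−2}N_Y` of the inner boundary
layer at distance `≤ 2L` — not done here); in particular it is `≤ 0` whenever the overhang angles vanish. [folklore] -/
theorem quadDeficit_blockWindow_le (L : ℕ) (hL : 1 ≤ L) (A : Site d → Fin d → ℝ) (Y : Finset (Site d)) :
    quadDeficit L A (blockWindow L Y)
      ≤ 1 / 2 * ∑ π : Plane d, ∑ x ∈ reach L Y π.1.1 π.1.2 \ blockSites L Y, (plaqAngle A (x, π)) ^ 2 := by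
  unfold quadDeficit blockWindow
  simp only []
  rw [Finset.sum_product_right, Finset.sum_product_right, Finset.mul_sum, Finset.mul_sum, ← Finset.sum_sub_distrib]
  refine Finset.sum_le_sum fun π _ => ?_
  have h := plane_quad_le L hL A Y π.1.1 π.1.2
  simp only [plaqAngle]
  rw [Finset.mul_sum]
  refine le_trans (le_of_eq ?_) h
  congr 1
  refine Finset.sum_congr rfl fun y _ => ?_
  ring

/-- **THE ABELIAN ONE-SIDED VALUE BOUND ON BLOCK WINDOWS** (stencil functional): if the fine angles of the window are
`≤ 1` in modulus, `stencilDeficit L A (blockWindow L Y) ≤ ½ Σ_π Σ_{overhang} θ² + (5/96) Σ_{B(Y)} θ⁴`. [folklore] -/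
theorem stencilDeficit_blockWindow_le (L : ℕ) (hL : 1 ≤ L) (A : Site d → Fin d → ℝ) (Y : Finset (Site d))
    (hθ : ∀ p ∈ (blockWindow L Y).2, |plaqAngle A p| ≤ 1) :
    stencilDeficit L A (blockWindow L Y)
      ≤ 1 / 2 * ∑ π : Plane d, ∑ x ∈ reach L Y π.1.1 π.1.2 \ blockSites L Y, (plaqAngle A (x, π)) ^ 2
        + 5 / 96 * fineQuartic A (blockWindow L Y) :=
  (stencilDeficit_le_quad L A _ hθ).trans (by linarith [quadDeficit_blockWindow_le L hL A Y])

/-- **… AND FOR THE TRUE AVERAGING DEFICIT of a small-exponent abelian configuration** (`deficit_imCfg`): Bałaban's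
non-linear averaging deficit of `e^{iA}·1` on any block window is at most the overhang's fine quadratic action plus the
quartic budget — one-sided, boundary-located, with NO bulk first-order term (contrast: the false two-sided β′ of §3).
[folklore] -/
theorem deficit_imCfg_blockWindow_le [Nonempty n] (L : ℕ) (hL : 1 ≤ L) {A : Site d → Fin d → ℝ}
    (hA : SmallExp L (imCfg A)) (Y : Finset (Site d)) (hθ : ∀ p ∈ (blockWindow L Y).2, |plaqAngle A p| ≤ 1) :
    deficit L (scalarCfg (n := n) (imCfg A)) (blockWindow L Y)
      ≤ 1 / 2 * ∑ π : Plane d, ∑ x ∈ reach L Y π.1.1 π.1.2 \ blockSites L Y, (plaqAngle A (x, π)) ^ 2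
        + 5 / 96 * fineQuartic A (blockWindow L Y) := by
  rw [deficit_imCfg L hL hA]
  exact stencilDeficit_blockWindow_le L hL A Y hθ

end WindowJensen

/-! ## §8 [v1.3] TORUS-LEVEL JENSEN: for a PERIODIC abelian configuration the quadratic stencil deficit of the full
period window is `≤ 0` (the torus has no overhang), so Bałaban's averaging deficit of `e^{iA}·1` on the torus is at most
the quartic budget `(5/96)·Σθ⁴` — the abelian β′-per, upper half, with NO first-, second- or third-order positive part -/

section TorusJensen

/-- Periodicity of a real 1-form with period `P` in every coordinate direction. [folklore] -/
def IsPeriodicForm (A : Site d → Fin d → ℝ) (P : ℤ) : Prop :=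
  ∀ (x : Site d) (κ μ : Fin d), A (x + P • e κ) μ = A x μ

/-- A periodic form gives a periodic abelian configuration `e^{iA}·1`. [folklore] -/
theorem isPeriodicCfg_imCfg {A : Site d → Fin d → ℝ} {P : ℤ} (hA : IsPeriodicForm A P) :
    IsPeriodicCfg (scalarCfg (n := n) (imCfg A)) P := by
  intro x κ μ
  unfold scalarCfg imCfg
  rw [hA]

/-- Membership in the period box `[0,N)^d`. [folklore] -/
theorem mem_periodBox {N : ℕ} {x : Site d} : x ∈ periodBox N ↔ ∀ κ, 0 ≤ x κ ∧ x κ < N := by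
  unfold periodBox
  rw [Finset.mem_image]
  constructor
  · rintro ⟨t, -, rfl⟩ κ
    exact ⟨by simp [boxVec], by simp [boxVec]⟩
  · intro h
    refine ⟨fun κ => ⟨(x κ).toNat, ?_⟩, Finset.mem_univ _, ?_⟩
    · have h1 := (h κ).1; have h2 := (h κ).2; omega
    · funext κ
      have h1 := (h κ).1
      simp only [boxVec]
      omega

/-- **THE BLOCKS OF THE COARSE PERIOD BOX TILE THE FINE PERIOD BOX**: `B([0,M)^d) = [0,LM)^d`. [folklore] -/
theorem blockSites_periodBox (L M : ℕ) (hL : 1 ≤ L) :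
    blockSites L (periodBox (d := d) M) = periodBox (L * M) := by
  ext x
  rw [blockSites_eq_image, Finset.mem_image, mem_periodBox]
  constructor
  · rintro ⟨⟨y, r⟩, hyr, rfl⟩ κ
    obtain ⟨hy, -⟩ := Finset.mem_product.mp hyr
    have hy' := (mem_periodBox.mp hy) κ
    have hr : ((r κ : ℕ) : ℤ) < L := by exact_mod_cast (r κ).isLt
    have hr0 : (0 : ℤ) ≤ ((r κ : ℕ) : ℤ) := by positivity
    simp only [Pi.add_apply, Pi.smul_apply, smul_eq_mul, boxVec]
    push_cast
    constructor
    · nlinarith [hy'.1, hy'.2]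
    · nlinarith [hy'.1, hy'.2]
  · intro h
    have hL0 : (0 : ℤ) < L := by exact_mod_cast (by omega : 0 < L)
    refine ⟨(fun κ => x κ / L, fun κ => ⟨(x κ % L).toNat, ?_⟩), ?_, ?_⟩
    · have h1 := Int.emod_nonneg (x κ) hL0.ne'
      have h2 := Int.emod_lt_of_pos (x κ) hL0
      omega
    · refine Finset.mem_product.mpr ⟨mem_periodBox.mpr fun κ => ⟨?_, ?_⟩, Finset.mem_univ _⟩
      · exact Int.ediv_nonneg (h κ).1 hL0.le
      · have h2 := (h κ).2
        push_cast at h2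
        exact (Int.ediv_lt_iff_lt_mul hL0).mpr (by linarith [mul_comm (L : ℤ) M])
    · funext κ
      simp only [Pi.add_apply, Pi.smul_apply, smul_eq_mul, boxVec]
      have h1 := Int.emod_nonneg (x κ) hL0.ne'
      rw [Int.toNat_of_nonneg h1]
      exact Int.mul_ediv_add_emod (x κ) L

/-- Translating the base point by a period of the form leaves every transport sum unchanged. [folklore] -/
theorem asum_add_period {A : Site d → Fin d → ℝ} {P : Site d} (hA : ∀ (x : Site d) (μ : Fin d), A (x + P) μ = A x μ)
    (x : Site d) (w : List (Letter d)) : asum A (x + P) w = asum A x w := by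
  induction w generalizing x with
  | nil => simp
  | cons l w ih =>
      rw [asum_cons, asum_cons, add_right_comm x P l.vec, ih (x + l.vec)]
      congr 1
      simp only [stepA, add_right_comm x P l.vec, hA]

/-- Single-direction periodicity extends to all integer multiples of the period. [folklore] -/
theorem periodic_zmul {g : Site d → ℝ} {N : ℤ} (hg : ∀ (x : Site d) (κ : Fin d), g (x + N • e κ) = g x)
    (x : Site d) (κ : Fin d) (m : ℤ) : g (x + (m * N) • e κ) = g x := by
  induction m using Int.induction_on generalizing x with
  | zero => simp
  | succ m ih => rw [add_mul, one_mul, add_smul, ← add_assoc, hg, ih]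
  | pred m ih =>
      have h1 := hg (x + ((-(m : ℤ) - 1) * N) • e κ) κ
      rw [add_assoc, ← add_smul, show (-(m : ℤ) - 1) * N + N = -(m : ℤ) * N by ring] at h1
      rw [← h1, ih]

/-- Coordinates: `N • k = Σ_κ (k_κ N) e_κ`. [folklore] -/
theorem smul_eq_sum_e (N : ℤ) (k : Site d) : N • k = ∑ κ : Fin d, (k κ * N) • e κ := by
  funext ι
  simp only [Pi.smul_apply, smul_eq_mul, Finset.sum_apply, e_apply, mul_ite, mul_one, mul_zero,
    Finset.sum_ite_eq, Finset.mem_univ, if_true]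
  ring

/-- … and to all period vectors: `g(x + N·k) = g(x)` for every `k ∈ ℤ^d`. [folklore] -/
theorem periodic_vec {g : Site d → ℝ} {N : ℤ} (hg : ∀ (x : Site d) (κ : Fin d), g (x + N • e κ) = g x)
    (x k : Site d) : g (x + N • k) = g x := by
  have key : ∀ (s : Finset (Fin d)) (x : Site d), g (x + ∑ κ ∈ s, (k κ * N) • e κ) = g x := by
    intro s
    induction s using Finset.induction_on with
    | empty => intro x; simp
    | insert κ s hκ ih =>
        intro x
        rw [Finset.sum_insert hκ, ← add_assoc, ih, periodic_zmul hg]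
  rw [smul_eq_sum_e]
  exact key Finset.univ x

/-- **SHIFT-INVARIANCE OF PERIODIC SUMS OVER THE PERIOD BOX**: for `g` of period `N` in every direction and every
`v ∈ ℤ^d`, `Σ_{x∈[0,N)^d} g(x + v) = Σ_{x∈[0,N)^d} g(x)` (wrap-around: `x ↦ (x + v) mod N` permutes the box). [folklore] -/
theorem sum_periodBox_shift (N : ℕ) (hN : 1 ≤ N) {g : Site d → ℝ}
    (hg : ∀ (x : Site d) (κ : Fin d), g (x + (N : ℤ) • e κ) = g x) (v : Site d) :
    ∑ x ∈ periodBox N, g (x + v) = ∑ x ∈ periodBox N, g x := by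
  have hN0 : (0 : ℤ) < N := by exact_mod_cast (by omega : 0 < N)
  -- the wrap map
  let wrap : Site d → Site d := fun y κ => y κ % N
  have hwrapS : ∀ y, wrap y ∈ periodBox (d := d) N := fun y =>
    mem_periodBox.mpr fun κ => ⟨Int.emod_nonneg _ hN0.ne', Int.emod_lt_of_pos _ hN0⟩
  have hgwrap : ∀ y, g (wrap y) = g y := by
    intro y
    have hy : y = wrap y + (N : ℤ) • (fun κ => y κ / N) := by
      funext κ
      simp only [wrap, Pi.add_apply, Pi.smul_apply, smul_eq_mul]
      exact (Int.emod_add_mul_ediv (y κ) N).symm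
    conv_rhs => rw [hy]
    exact (periodic_vec hg (wrap y) _).symm
  have hinj : Set.InjOn (fun x => wrap (x + v)) ((periodBox (d := d) N : Finset (Site d)) : Set (Site d)) := by
    intro x hx x' hx' hxx'
    have hxm := mem_periodBox.mp (Finset.mem_coe.mp hx)
    have hxm' := mem_periodBox.mp (Finset.mem_coe.mp hx')
    funext κ
    have hκ := congr_fun hxx' κ
    simp only [wrap, Pi.add_apply] at hκ
    have h2 : x κ % N = x' κ % N := (Int.emod_add_cancel_right (v κ)).mp hκ
    rwa [Int.emod_eq_of_lt (hxm κ).1 (hxm κ).2, Int.emod_eq_of_lt (hxm' κ).1 (hxm' κ).2] at h2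
  have himage : (periodBox (d := d) N).image (fun x => wrap (x + v)) = periodBox N := by
    refine Finset.eq_of_subset_of_card_le (fun y hy => ?_) ?_
    · obtain ⟨x, -, rfl⟩ := Finset.mem_image.mp hy
      exact hwrapS _
    · rw [Finset.card_image_of_injOn hinj]
  calc ∑ x ∈ periodBox N, g (x + v) = ∑ x ∈ periodBox N, g (wrap (x + v)) :=
        Finset.sum_congr rfl fun x _ => (hgwrap _).symm
    _ = ∑ y ∈ (periodBox (d := d) N).image (fun x => wrap (x + v)), g y := (Finset.sum_image hinj).symm
    _ = ∑ x ∈ periodBox N, g x := by rw [himage]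

/-- **PER-PLANE TORUS JENSEN**: for a form of period `LM` and the full period window, the coarse quadratic action is at
most the fine one: `Σ_{y∈[0,M)^d} L^{d−4}Θ²/2 − Σ_{x∈[0,LM)^d} θ²/2 ≤ 0`. [folklore] -/
theorem plane_quad_torus_le (L M : ℕ) (hL : 1 ≤ L) (hM : 1 ≤ M) {A : Site d → Fin d → ℝ}
    (hA : IsPeriodicForm A ((L : ℤ) * M)) (μ ν : Fin d) :
    ∑ y ∈ periodBox M, (L : ℝ) ^ ((d : ℤ) - 4) * (stencilAngle L A ((L : ℤ) • y) μ ν) ^ 2 / 2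
        - ∑ x ∈ blockSites L (periodBox M), (asum A x (plaqWord μ ν)) ^ 2 / 2 ≤ 0 := by
  set h : Site d → ℝ := fun x => (asum A x (plaqWord μ ν)) ^ 2 with hdef
  have hLM : 1 ≤ L * M := Nat.one_le_iff_ne_zero.mpr (Nat.mul_ne_zero (by omega) (by omega))
  have hper : ∀ (x : Site d) (κ : Fin d), h (x + ((L * M : ℕ) : ℤ) • e κ) = h x := by
    intro x κ
    simp only [hdef]
    rw [asum_add_period (P := ((L * M : ℕ) : ℤ) • e κ) (fun y μ' => ?_)]
    have := hA y κ μ'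
    push_cast at this ⊢
    exact this
  have step12 := coarse_plane_le L hL A (periodBox M) μ ν
  have step3 : ∑ p ∈ Finset.range L ×ˢ Finset.range L,
          ∑ x ∈ blockSites L (periodBox M), h (x + (p.1 : ℤ) • e μ + (p.2 : ℤ) • e ν)
      = (L : ℝ) ^ 2 * ∑ x ∈ blockSites L (periodBox M), h x := by
    have : ∀ p ∈ Finset.range L ×ˢ Finset.range L,
        ∑ x ∈ blockSites L (periodBox M), h (x + (p.1 : ℤ) • e μ + (p.2 : ℤ) • e ν)
          = ∑ x ∈ blockSites L (periodBox M), h x := by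
      intro p _
      rw [blockSites_periodBox L M hL]
      have := sum_periodBox_shift (L * M) hLM hper ((p.1 : ℤ) • e μ + (p.2 : ℤ) • e ν)
      simpa only [add_assoc] using this
    rw [Finset.sum_congr rfl this, Finset.sum_const, Finset.card_product, Finset.card_range, nsmul_eq_mul]
    push_cast
    ring
  have hL2 : (0 : ℝ) < (L : ℝ) ^ 2 := by
    have : (0 : ℝ) < (L : ℝ) := by exact_mod_cast (by omega : 0 < L)
    positivity
  have hfine : ∑ x ∈ blockSites L (periodBox M), (asum A x (plaqWord μ ν)) ^ 2 / 2
      = 1 / 2 * ∑ x ∈ blockSites L (periodBox M), h x := by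
    rw [Finset.mul_sum]
    refine Finset.sum_congr rfl fun x _ => ?_
    rw [hdef]; ring
  rw [hfine]
  have key : ((L : ℝ) ^ 2)⁻¹ / 2 * ∑ p ∈ Finset.range L ×ˢ Finset.range L,
          ∑ x ∈ blockSites L (periodBox M), h (x + (p.1 : ℤ) • e μ + (p.2 : ℤ) • e ν)
      = 1 / 2 * ∑ x ∈ blockSites L (periodBox M), h x := by
    rw [step3]
    field_simp
  linarith [step12]

/-- **TORUS-LEVEL JENSEN (abelian β′-per at quadratic order)**: for a form of period `LM`,
`quadDeficit L A (blockWindow L [0,M)^d) ≤ 0` — block averaging does not increase the quadratic action on the torus.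
[folklore] -/
theorem quadDeficit_torus_le (L M : ℕ) (hL : 1 ≤ L) (hM : 1 ≤ M) {A : Site d → Fin d → ℝ}
    (hA : IsPeriodicForm A ((L : ℤ) * M)) : quadDeficit L A (blockWindow L (periodBox M)) ≤ 0 := by
  unfold quadDeficit blockWindow
  simp only []
  rw [Finset.sum_product_right, Finset.sum_product_right, Finset.mul_sum, ← Finset.sum_sub_distrib]
  refine Finset.sum_nonpos fun π _ => ?_
  have h := plane_quad_torus_le L M hL hM hA π.1.1 π.1.2
  simp only [plaqAngle]
  refine le_trans (le_of_eq ?_) h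
  congr 1
  rw [Finset.mul_sum]
  refine Finset.sum_congr rfl fun y _ => ?_
  ring

/-- **THE ABELIAN β′-per, UPPER HALF (stencil functional)**: for a form of period `LM` whose fine angles on the period
window are `≤ 1` in modulus, `stencilDeficit L A (blockWindow L [0,M)^d) ≤ (5/96)·Σ_{[0,LM)^d} θ⁴`. [folklore] -/
theorem stencilDeficit_torus_le (L M : ℕ) (hL : 1 ≤ L) (hM : 1 ≤ M) {A : Site d → Fin d → ℝ}
    (hA : IsPeriodicForm A ((L : ℤ) * M)) (hθ : ∀ p ∈ (blockWindow L (periodBox (d := d) M)).2, |plaqAngle A p| ≤ 1) :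
    stencilDeficit L A (blockWindow L (periodBox M)) ≤ 5 / 96 * fineQuartic A (blockWindow L (periodBox M)) :=
  (stencilDeficit_le_quad L A _ hθ).trans (by linarith [quadDeficit_torus_le L M hL hM hA])

/-- **THE ABELIAN β′-per, UPPER HALF, FOR BAŁABAN'S DEFICIT**: for a small-exponent periodic abelian configuration
`e^{iA}·1` (period `LM`, fine angles `≤ 1`), the non-linear averaging deficit of the full period window — the toroidal
action difference `A^{L^{d−4}}(avg U) − A(U)` of `DeficitValueWallPer` — is at most `(5/96)·Σθ⁴`: NO positive part of
order `a`, `a²` or `a³` (contrast §3: on block windows in `ℤ^d` the positive part is of order `a·#overhang`).  This is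
the periodic value wall's inequality on the abelian class with room to spare (`Σθ⁴ ≤ a·(a³·#plaquettes)`); the
non-abelian statement `DeficitValueWallPer` itself remains [analysis], asserted nowhere. [folklore] -/
theorem deficit_imCfg_torus_le [Nonempty n] (L M : ℕ) (hL : 1 ≤ L) (hM : 1 ≤ M) {A : Site d → Fin d → ℝ}
    (hA : IsPeriodicForm A ((L : ℤ) * M)) (hs : SmallExp L (imCfg A))
    (hθ : ∀ p ∈ (blockWindow L (periodBox (d := d) M)).2, |plaqAngle A p| ≤ 1) :
    deficit L (scalarCfg (n := n) (imCfg A)) (blockWindow L (periodBox M))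
      ≤ 5 / 96 * fineQuartic A (blockWindow L (periodBox M)) := by
  rw [deficit_imCfg L hL hs]
  exact stencilDeficit_torus_le L M hL hM hA hθ

/-- … with the quartic budget evaluated: if all fine angles are `≤ a ≤ 1` in modulus, the torus deficit of `e^{iA}·1`
is `≤ (5/96)·#(fine plaquettes of the period window)·a⁴`. [folklore] -/
theorem deficit_imCfg_torus_le_quartic [Nonempty n] (L M : ℕ) (hL : 1 ≤ L) (hM : 1 ≤ M) {A : Site d → Fin d → ℝ}
    (hA : IsPeriodicForm A ((L : ℤ) * M)) (hs : SmallExp L (imCfg A)) {a : ℝ} (ha : a ≤ 1)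
    (hθ : ∀ (x : Site d) (μ ν : Fin d), |asum A x (plaqWord μ ν)| ≤ a) :
    deficit L (scalarCfg (n := n) (imCfg A)) (blockWindow L (periodBox M))
      ≤ 5 / 96 * (((blockWindow L (periodBox (d := d) M)).2.card : ℝ) * a ^ 4) := by
  have hθ1 : ∀ p ∈ (blockWindow L (periodBox (d := d) M)).2, |plaqAngle A p| ≤ 1 :=
    fun p _ => (hθ p.1 p.2.1.1 p.2.1.2).trans ha
  refine (deficit_imCfg_torus_le L M hL hM hA hs hθ1).trans ?_
  exact mul_le_mul_of_nonneg_left (fineQuartic_le A _ hθ) (by norm_num)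

end TorusJensen

/-! ## §9 [v1.4] THE EXACT VARIANCE FORM: on the torus the quadratic stencil deficit of a periodic form IS minus the
stencil pair-variance of the fine angles (Federbush's abelian identity (0.12), here for Bałaban's own average on the
abelian class via §5) — the lower, Poincaré-type half of the abelian β′-per is thereby a statement about pair variances -/

section VarianceForm

/-- The finite variance identity: `Σ_{k,k'∈s}(a_k − a_{k'})² = 2·#s·Σ_k a_k² − 2·(Σ_k a_k)²`. [folklore] -/
theorem sum_sum_sub_sq {ι : Type*} (s : Finset ι) (a : ι → ℝ) :
    ∑ k ∈ s, ∑ k' ∈ s, (a k - a k') ^ 2 = 2 * s.card * ∑ k ∈ s, (a k) ^ 2 - 2 * (∑ k ∈ s, a k) ^ 2 := by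
  have h : ∀ k ∈ s, ∑ k' ∈ s, (a k - a k') ^ 2
      = s.card * (a k) ^ 2 - 2 * a k * ∑ k' ∈ s, a k' + ∑ k' ∈ s, (a k') ^ 2 := by
    intro k _
    have : ∀ k' ∈ s, (a k - a k') ^ 2 = (a k) ^ 2 - 2 * a k * a k' + (a k') ^ 2 := fun k' _ => by ring
    rw [Finset.sum_congr rfl this, Finset.sum_add_distrib, Finset.sum_sub_distrib, Finset.sum_const, nsmul_eq_mul,
      ← Finset.mul_sum]
  rw [Finset.sum_congr rfl h, Finset.sum_add_distrib, Finset.sum_sub_distrib, Finset.sum_const, nsmul_eq_mul,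
    ← Finset.mul_sum, ← Finset.sum_mul, ← Finset.mul_sum]
  ring

/-- THE STENCIL INDEX SET of a coarse plaquette: `(r, i, j) ∈ [0,L)^d × [0,L) × [0,L)`, `L^{d+2}` elements. [folklore] -/
def stencilIdx (d L : ℕ) : Finset ((Fin d → Fin L) × (ℕ × ℕ)) :=
  (Finset.univ : Finset (Fin d → Fin L)) ×ˢ (Finset.range L ×ˢ Finset.range L)

/-- `#stencilIdx = L^{d+2}`. [folklore] -/
theorem card_stencilIdx (d L : ℕ) : (stencilIdx d L).card = L ^ (d + 2) := by
  unfold stencilIdx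
  rw [Finset.card_product, Finset.card_product, Finset.card_range, Finset.card_univ, Fintype.card_fun,
    Fintype.card_fin, Fintype.card_fin]
  ring

/-- The fine corner of the stencil index `(r,i,j)` relative to the block base: `r + ie_μ + je_ν`. [folklore] -/
def stencilOff (L : ℕ) (μ ν : Fin d) (k : (Fin d → Fin L) × (ℕ × ℕ)) : Site d :=
  boxVec L k.1 + (k.2.1 : ℤ) • e μ + (k.2.2 : ℤ) • e ν

/-- The stencil average as a flat sum over the stencil index set: `Θ_P = Σ_{k} L^{−d}·θ_{z + off(k)}`. [folklore] -/
theorem stencilAngle_eq_sum_idx (L : ℕ) (A : Site d → Fin d → ℝ) (z : Site d) (μ ν : Fin d) :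
    stencilAngle L A z μ ν
      = ((L : ℝ) ^ d)⁻¹ * ∑ k ∈ stencilIdx d L, asum A (z + stencilOff L μ ν k) (plaqWord μ ν) := by
  rw [stencilAngle_eq_sum_plaq, ← Finset.mul_sum]
  congr 1
  unfold stencilIdx
  rw [Finset.sum_product]
  refine Finset.sum_congr rfl fun r _ => ?_
  rw [Finset.sum_product]
  refine Finset.sum_congr rfl fun i _ => Finset.sum_congr rfl fun j _ => ?_
  simp only [stencilOff, add_assoc]

/-- THE STENCIL PAIR VARIANCE of the fine angles of a coarse plaquette based at `z` (fine coordinates):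
`Σ_{k,k'}(θ_{z+off k} − θ_{z+off k'})²`. [folklore] -/
def stencilPVar (L : ℕ) (A : Site d → Fin d → ℝ) (z : Site d) (μ ν : Fin d) : ℝ :=
  ∑ k ∈ stencilIdx d L, ∑ k' ∈ stencilIdx d L,
    (asum A (z + stencilOff L μ ν k) (plaqWord μ ν) - asum A (z + stencilOff L μ ν k') (plaqWord μ ν)) ^ 2

/-- `stencilPVar ≥ 0`. [folklore] -/
theorem stencilPVar_nonneg (L : ℕ) (A : Site d → Fin d → ℝ) (z : Site d) (μ ν : Fin d) :
    0 ≤ stencilPVar L A z μ ν := by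
  unfold stencilPVar; positivity

/-- **THE EXACT VARIANCE FORM OF THE COARSE QUADRATIC TERM**:
`L^{d−4}Θ_P²/2 = (L^{−2}/2)·Σ_k θ²_{z+off k} − (L^{−(d+4)}/4)·stencilPVar` — Jensen's slack made explicit. [folklore] -/
theorem coarse_quad_term_eq (L : ℕ) (hL : 1 ≤ L) (A : Site d → Fin d → ℝ) (z : Site d) (μ ν : Fin d) :
    (L : ℝ) ^ ((d : ℤ) - 4) * (stencilAngle L A z μ ν) ^ 2 / 2
      = ((L : ℝ) ^ 2)⁻¹ / 2 * ∑ k ∈ stencilIdx d L, (asum A (z + stencilOff L μ ν k) (plaqWord μ ν)) ^ 2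
        - ((L : ℝ) ^ (d + 4))⁻¹ / 4 * stencilPVar L A z μ ν := by
  have h0 : (0 : ℝ) < (L : ℝ) := by exact_mod_cast (by omega : 0 < L)
  have hv := sum_sum_sub_sq (stencilIdx d L) (fun k => asum A (z + stencilOff L μ ν k) (plaqWord μ ν))
  rw [card_stencilIdx, Nat.cast_pow] at hv
  unfold stencilPVar
  rw [hv, stencilAngle_eq_sum_idx, zpow_sub_four_eq L hL]
  field_simp
  ring

/-- Block-and-shift resummation on the torus: for an `LM`-periodic site function `G`,
`Σ_{y∈[0,M)^d} Σ_{k∈stencilIdx} G(L•y + off k) = L²·Σ_{x∈[0,LM)^d} G(x)` (blocks tile the period box; each of the `L²`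
shifts permutes it). [folklore] -/
theorem sum_periodBox_stencilIdx (L M : ℕ) (hL : 1 ≤ L) (hM : 1 ≤ M) {G : Site d → ℝ}
    (hG : ∀ (x : Site d) (κ : Fin d), G (x + ((L * M : ℕ) : ℤ) • e κ) = G x) (μ ν : Fin d) :
    ∑ y ∈ periodBox M, ∑ k ∈ stencilIdx d L, G ((L : ℤ) • y + stencilOff L μ ν k)
      = (L : ℝ) ^ 2 * ∑ x ∈ periodBox (L * M), G x := by
  have hLM : 1 ≤ L * M := Nat.one_le_iff_ne_zero.mpr (Nat.mul_ne_zero (by omega) (by omega))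
  have e1 : ∀ y ∈ periodBox (d := d) M, ∑ k ∈ stencilIdx d L, G ((L : ℤ) • y + stencilOff L μ ν k)
      = ∑ p ∈ Finset.range L ×ˢ Finset.range L, ∑ r : Fin d → Fin L,
          G ((L : ℤ) • y + boxVec L r + ((p.1 : ℤ) • e μ + (p.2 : ℤ) • e ν)) := by
    intro y _
    unfold stencilIdx
    rw [Finset.sum_product, Finset.sum_comm]
    refine Finset.sum_congr rfl fun p _ => Finset.sum_congr rfl fun r _ => ?_
    simp only [stencilOff, add_assoc]
  rw [Finset.sum_congr rfl e1, Finset.sum_comm]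
  have e2 : ∀ p ∈ Finset.range L ×ˢ Finset.range L,
      ∑ y ∈ periodBox M, ∑ r : Fin d → Fin L, G ((L : ℤ) • y + boxVec L r + ((p.1 : ℤ) • e μ + (p.2 : ℤ) • e ν))
        = ∑ x ∈ periodBox (L * M), G x := by
    intro p _
    rw [sum_blocks_eq L hL (periodBox M) (fun x => G (x + ((p.1 : ℤ) • e μ + (p.2 : ℤ) • e ν))),
      blockSites_periodBox L M hL]
    exact sum_periodBox_shift (L * M) hLM hG _
  rw [Finset.sum_congr rfl e2, Finset.sum_const, Finset.card_product, Finset.card_range, nsmul_eq_mul]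
  push_cast
  ring

/-- **THE EXACT TORUS DEFICIT FORMULA (abelian class, quadratic order)**: for a form of period `LM`,
`quadDeficit L A (blockWindow L [0,M)^d) = −(L^{−(d+4)}/4)·Σ_π Σ_{y∈[0,M)^d} stencilPVar L A (L•y) π` — minus the total
stencil pair variance; in particular `≤ 0` (§8) with equality iff every stencil sees constant angles. [folklore] -/
theorem quadDeficit_torus_eq (L M : ℕ) (hL : 1 ≤ L) (hM : 1 ≤ M) {A : Site d → Fin d → ℝ}
    (hA : IsPeriodicForm A ((L : ℤ) * M)) :
    quadDeficit L A (blockWindow L (periodBox M))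
      = -(((L : ℝ) ^ (d + 4))⁻¹ / 4) * ∑ π : Plane d, ∑ y ∈ periodBox M,
          stencilPVar L A ((L : ℤ) • y) π.1.1 π.1.2 := by
  have h0 : (0 : ℝ) < (L : ℝ) := by exact_mod_cast (by omega : 0 < L)
  -- per plane: the first (mean-square) part of the variance form sums to the fine action
  have plane : ∀ μ ν : Fin d,
      ∑ y ∈ periodBox M, (L : ℝ) ^ ((d : ℤ) - 4) * (stencilAngle L A ((L : ℤ) • y) μ ν) ^ 2 / 2
          - ∑ x ∈ blockSites L (periodBox M), (asum A x (plaqWord μ ν)) ^ 2 / 2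
        = -(((L : ℝ) ^ (d + 4))⁻¹ / 4) * ∑ y ∈ periodBox M, stencilPVar L A ((L : ℤ) • y) μ ν := by
    intro μ ν
    set h : Site d → ℝ := fun x => (asum A x (plaqWord μ ν)) ^ 2 with hdef
    have hper : ∀ (x : Site d) (κ : Fin d), h (x + ((L * M : ℕ) : ℤ) • e κ) = h x := by
      intro x κ
      simp only [hdef]
      rw [asum_add_period (P := ((L * M : ℕ) : ℤ) • e κ) (fun y μ' => ?_)]
      have := hA y κ μ'
      push_cast at this ⊢
      exact this
    -- the mean-square part, block by block and shift by shift, equals L² × the fine action (resummation lemma)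
    have hms : ∑ y ∈ periodBox M, ∑ k ∈ stencilIdx d L, h ((L : ℤ) • y + stencilOff L μ ν k)
        = (L : ℝ) ^ 2 * ∑ x ∈ blockSites L (periodBox M), h x := by
      rw [blockSites_periodBox L M hL]
      exact sum_periodBox_stencilIdx L M hL hM hper μ ν
    -- assemble with the exact variance form per coarse plaquette
    have e3 : ∀ y ∈ periodBox (d := d) M,
        (L : ℝ) ^ ((d : ℤ) - 4) * (stencilAngle L A ((L : ℤ) • y) μ ν) ^ 2 / 2
          = ((L : ℝ) ^ 2)⁻¹ / 2 * ∑ k ∈ stencilIdx d L, h ((L : ℤ) • y + stencilOff L μ ν k)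
            - ((L : ℝ) ^ (d + 4))⁻¹ / 4 * stencilPVar L A ((L : ℤ) • y) μ ν :=
      fun y _ => coarse_quad_term_eq L hL A _ μ ν
    rw [Finset.sum_congr rfl e3, Finset.sum_sub_distrib, ← Finset.mul_sum, ← Finset.mul_sum, hms]
    have hfine : ∑ x ∈ blockSites L (periodBox M), (asum A x (plaqWord μ ν)) ^ 2 / 2
        = 1 / 2 * ∑ x ∈ blockSites L (periodBox M), h x := by
      rw [Finset.mul_sum]
      refine Finset.sum_congr rfl fun x _ => ?_
      rw [hdef]; ring
    rw [hfine]
    field_simp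
    ring
  unfold quadDeficit blockWindow
  simp only []
  rw [Finset.sum_product_right, Finset.sum_product_right, Finset.mul_sum, ← Finset.sum_sub_distrib,
    Finset.mul_sum]
  refine Finset.sum_congr rfl fun π _ => ?_
  rw [← plane π.1.1 π.1.2, Finset.mul_sum]
  simp only [plaqAngle]
  congr 1
  refine Finset.sum_congr rfl fun y _ => ?_
  ring

end VarianceForm

/-! ## §10 [v1.4] THE STENCIL POINCARÉ INEQUALITY AND THE LOWER HALF OF THE ABELIAN β′-per: the stencil pair variance is
bounded by the nearest-neighbour gradient energy of the fine angles over the stencil (explicit polynomial constant in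
`L`, `2^d`), hence on the torus `quadDeficit ≥ −C(d,L)·Σ_x Σ_κ (θ(x+e_κ) − θ(x))²` and Bałaban's deficit of a periodic
abelian `e^{iA}·1` is bounded BELOW by minus the gradient energy of the plaquette angles minus the coarse quartic budget —
with §8, the TWO-SIDED abelian β′-per -/

section StencilPoincare

/-- Forward difference of a site function in direction `κ`: `(∂_κ g)(x) = g(x + e_κ) − g(x)`. [folklore] -/
def fdiff (g : Site d → ℝ) (κ : Fin d) (x : Site d) : ℝ := g (x + e κ) - g x

/-- 1-D telescoping + Cauchy–Schwarz: `(g(x + m e_κ) − g(x))² ≤ m·Σ_{t<m} (∂_κ g(x + t e_κ))²`. [folklore] -/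
theorem sq_sub_le_line (g : Site d → ℝ) (κ : Fin d) (x : Site d) (m : ℕ) :
    (g (x + (m : ℤ) • e κ) - g x) ^ 2
      ≤ (m : ℝ) * ∑ t ∈ Finset.range m, (fdiff g κ (x + (t : ℤ) • e κ)) ^ 2 := by
  have hstep : ∀ t : ℕ, fdiff g κ (x + (t : ℤ) • e κ)
      = g (x + ((t + 1 : ℕ) : ℤ) • e κ) - g (x + (t : ℤ) • e κ) := by
    intro t
    simp only [fdiff]
    congr 2
    push_cast
    rw [add_smul, one_smul, add_assoc]
  have htel : g (x + (m : ℤ) • e κ) - g x = ∑ t ∈ Finset.range m, fdiff g κ (x + (t : ℤ) • e κ) := by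
    simp_rw [hstep]
    rw [Finset.sum_range_sub (fun t : ℕ => g (x + (t : ℤ) • e κ)) m]
    simp
  rw [htel]
  exact sq_sum_range_le m _

/-- A shifted line sum of squares inside the block is dominated by the block sum. [folklore] -/
theorem sum_line_le_periodBox (L : ℕ) (F : Site d → ℝ) (hF : ∀ u, 0 ≤ F u) (κ₀ : Fin d) (r : Fin d → Fin L)
    (hr : (r κ₀ : ℕ) = 0) (m : ℕ) (hm : m ≤ L) :
    ∑ t ∈ Finset.range m, F (boxVec L r + (t : ℤ) • e κ₀) ≤ ∑ u ∈ periodBox L, F u := by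
  have hinj : Set.InjOn (fun t : ℕ => boxVec L r + (t : ℤ) • e κ₀)
      ((Finset.range m : Finset ℕ) : Set ℕ) := by
    intro t _ t' _ h
    have := congr_fun h κ₀
    simp only [Pi.add_apply, Pi.smul_apply, smul_eq_mul, e_apply, if_true, mul_one, add_right_inj] at this
    exact_mod_cast this
  calc ∑ t ∈ Finset.range m, F (boxVec L r + (t : ℤ) • e κ₀)
      = ∑ u ∈ (Finset.range m).image (fun t : ℕ => boxVec L r + (t : ℤ) • e κ₀), F u :=
        (Finset.sum_image hinj).symm
    _ ≤ ∑ u ∈ periodBox L, F u := by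
        refine Finset.sum_le_sum_of_subset_of_nonneg (fun u hu => ?_) (fun u _ _ => hF u)
        obtain ⟨t, ht, rfl⟩ := Finset.mem_image.mp hu
        have htm : t < m := Finset.mem_range.mp ht
        refine mem_periodBox.mpr fun ι => ?_
        by_cases hι : ι = κ₀
        · subst hι
          simp only [Pi.add_apply, boxVec, hr, Nat.cast_zero, zero_add, Pi.smul_apply, smul_eq_mul, e_apply,
            if_true, mul_one]
          constructor
          · positivity
          · exact_mod_cast (lt_of_lt_of_le htm hm)
        · simp only [Pi.add_apply, boxVec, Pi.smul_apply, smul_eq_mul, e_apply, if_neg hι, mul_zero, add_zero]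
          exact ⟨by positivity, by exact_mod_cast (r ι).isLt⟩

/-- Splitting off one coordinate of a block vector: `r = r[κ₀ ↦ 0] + r_{κ₀} e_{κ₀}`. [folklore] -/
theorem boxVec_update_add (L : ℕ) (hL : 1 ≤ L) (r : Fin d → Fin L) (κ₀ : Fin d) :
    boxVec L r = boxVec L (Function.update r κ₀ ⟨0, by omega⟩) + ((r κ₀ : ℕ) : ℤ) • e κ₀ := by
  funext ι
  by_cases hι : ι = κ₀
  · subst hι
    simp [boxVec, e_apply]
  · simp [boxVec, e_apply, hι]

/-- **BLOCK TELESCOPING**: for `r` supported in `s`, `(g(r) − g(0))² ≤ 2^{#s}·L·Σ_{κ∈s}Σ_{u∈[0,L)^d}(∂_κ g(u))²`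
(induction on the support, one coordinate line at a time). [folklore] -/
theorem sq_sub_block_le (L : ℕ) (hL : 1 ≤ L) (g : Site d → ℝ) :
    ∀ (s : Finset (Fin d)) (r : Fin d → Fin L), (∀ κ, κ ∉ s → (r κ : ℕ) = 0) →
      (g (boxVec L r) - g 0) ^ 2
        ≤ 2 ^ s.card * (L : ℝ) * ∑ κ ∈ s, ∑ u ∈ periodBox L, (fdiff g κ u) ^ 2 := by
  intro s
  induction s using Finset.induction_on with
  | empty =>
      intro r hr
      have h0 : boxVec L r = 0 := by
        funext ι
        simp [boxVec, hr ι (by simp)]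
      simp [h0]
  | insert κ₀ s hκ₀ ih =>
      intro r hr
      set r' : Fin d → Fin L := Function.update r κ₀ ⟨0, by omega⟩ with hr'def
      have hr'0 : (r' κ₀ : ℕ) = 0 := by simp [hr'def]
      have hr' : ∀ κ, κ ∉ s → (r' κ : ℕ) = 0 := by
        intro κ hκ
        by_cases h : κ = κ₀
        · subst h; exact hr'0
        · rw [hr'def, Function.update_of_ne h]
          exact hr κ (by simp [h, hκ])
      have hdec : boxVec L r = boxVec L r' + ((r κ₀ : ℕ) : ℤ) • e κ₀ := boxVec_update_add L hL r κ₀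
      have h1 := ih r' hr'
      have h2 : (g (boxVec L r' + ((r κ₀ : ℕ) : ℤ) • e κ₀) - g (boxVec L r')) ^ 2
          ≤ (L : ℝ) * ∑ u ∈ periodBox L, (fdiff g κ₀ u) ^ 2 := by
        refine (sq_sub_le_line g κ₀ (boxVec L r') (r κ₀)).trans ?_
        have hm : ((r κ₀ : ℕ) : ℝ) ≤ L := by exact_mod_cast (r κ₀).isLt.le
        refine (mul_le_mul_of_nonneg_right hm (Finset.sum_nonneg fun _ _ => sq_nonneg _)).trans ?_
        refine mul_le_mul_of_nonneg_left ?_ (Nat.cast_nonneg L)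
        exact sum_line_le_periodBox L (fun u => (fdiff g κ₀ u) ^ 2) (fun u => sq_nonneg _) κ₀ r' hr'0 _
          (r κ₀).isLt.le
      have hE : 0 ≤ (L : ℝ) * ∑ u ∈ periodBox L, (fdiff g κ₀ u) ^ 2 :=
        mul_nonneg (Nat.cast_nonneg L) (Finset.sum_nonneg fun _ _ => sq_nonneg _)
      have hpow : (1 : ℝ) ≤ 2 ^ s.card := one_le_pow₀ (by norm_num)
      have h3 : (L : ℝ) * ∑ u ∈ periodBox L, (fdiff g κ₀ u) ^ 2
          ≤ 2 ^ s.card * ((L : ℝ) * ∑ u ∈ periodBox L, (fdiff g κ₀ u) ^ 2) := le_mul_of_one_le_left hE hpow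
      have hsq : ∀ a b : ℝ, (a + b) ^ 2 ≤ 2 * a ^ 2 + 2 * b ^ 2 := fun a b => by nlinarith [sq_nonneg (a - b)]
      have hsplit : g (boxVec L r) - g 0
          = (g (boxVec L r' + ((r κ₀ : ℕ) : ℤ) • e κ₀) - g (boxVec L r')) + (g (boxVec L r') - g 0) := by
        rw [hdec]; ring
      rw [hsplit, Finset.card_insert_of_notMem hκ₀, Finset.sum_insert hκ₀]
      refine (hsq _ _).trans ?_
      have hexp : (2 : ℝ) ^ (s.card + 1) * (L : ℝ)
            * (∑ u ∈ periodBox L, (fdiff g κ₀ u) ^ 2 + ∑ κ ∈ s, ∑ u ∈ periodBox L, (fdiff g κ u) ^ 2)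
          = 2 * (2 ^ s.card * ((L : ℝ) * ∑ u ∈ periodBox L, (fdiff g κ₀ u) ^ 2))
            + 2 * (2 ^ s.card * (L : ℝ) * ∑ κ ∈ s, ∑ u ∈ periodBox L, (fdiff g κ u) ^ 2) := by ring
      rw [hexp]
      linarith [h1, h2, h3]

/-- The gradient energy density of a site function: `Σ_κ (∂_κ g)²`. [folklore] -/
def gradSq (g : Site d → ℝ) (x : Site d) : ℝ := ∑ κ : Fin d, (fdiff g κ x) ^ 2

/-- `gradSq ≥ 0`. [folklore] -/
theorem gradSq_nonneg (g : Site d → ℝ) (x : Site d) : 0 ≤ gradSq g x := by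
  unfold gradSq; positivity

/-- `(∂_κ g)² ≤ gradSq`. [folklore] -/
theorem fdiff_sq_le_gradSq (g : Site d → ℝ) (κ : Fin d) (x : Site d) : (fdiff g κ x) ^ 2 ≤ gradSq g x := by
  unfold gradSq
  exact Finset.single_le_sum (f := fun κ => (fdiff g κ x) ^ 2) (fun _ _ => sq_nonneg _) (Finset.mem_univ κ)

/-- THE STENCIL POINCARÉ CONSTANT `C_P(d,L) = 12·L^{d+2}·(L² + L³ + 2^d·L^{d+3})`. [folklore] -/
def poincareConst (d L : ℕ) : ℝ := 12 * (L : ℝ) ^ (d + 2) * ((L : ℝ) ^ 2 + (L : ℝ) ^ 3 + 2 ^ d * (L : ℝ) ^ (d + 3))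

/-- `C_P ≥ 0`. [folklore] -/
theorem poincareConst_nonneg (d L : ℕ) : 0 ≤ poincareConst d L := by unfold poincareConst; positivity

/-- **THE CORNER BOUND**: for every stencil index `k = (r,i,j)`,
`(g(off k) − g(0))² ≤ 3·[L·Σ_{t<L}(∂_ν g(r+ie_μ+te_ν))² + L·Σ_{t<L}(∂_μ g(r+te_μ))² + 2^d·L·Σ_κΣ_{u∈[0,L)^d}(∂_κ g(u))²]`.
[folklore] -/
theorem sq_sub_corner_le (L : ℕ) (hL : 1 ≤ L) (g : Site d → ℝ) (μ ν : Fin d)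
    (k : (Fin d → Fin L) × (ℕ × ℕ)) (hk : k ∈ stencilIdx d L) :
    (g (stencilOff L μ ν k) - g 0) ^ 2
      ≤ 3 * ((L : ℝ) * ∑ t ∈ Finset.range L, (fdiff g ν (boxVec L k.1 + (k.2.1 : ℤ) • e μ + (t : ℤ) • e ν)) ^ 2
          + (L : ℝ) * ∑ t ∈ Finset.range L, (fdiff g μ (boxVec L k.1 + (t : ℤ) • e μ)) ^ 2
          + 2 ^ d * (L : ℝ) * ∑ κ : Fin d, ∑ u ∈ periodBox L, (fdiff g κ u) ^ 2) := by
  obtain ⟨r, i, j⟩ := k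
  obtain ⟨-, hij⟩ := Finset.mem_product.mp hk
  obtain ⟨hi, hj⟩ := Finset.mem_product.mp hij
  have hiL : i ≤ L := (Finset.mem_range.mp hi).le
  have hjL : j ≤ L := (Finset.mem_range.mp hj).le
  simp only [stencilOff]
  -- the three legs
  have Tν : (g (boxVec L r + (i : ℤ) • e μ + (j : ℤ) • e ν) - g (boxVec L r + (i : ℤ) • e μ)) ^ 2
      ≤ (L : ℝ) * ∑ t ∈ Finset.range L, (fdiff g ν (boxVec L r + (i : ℤ) • e μ + (t : ℤ) • e ν)) ^ 2 := by
    refine (sq_sub_le_line g ν _ j).trans ?_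
    have h1 : (j : ℝ) ≤ L := by exact_mod_cast hjL
    have h2 : ∑ t ∈ Finset.range j, (fdiff g ν (boxVec L r + (i : ℤ) • e μ + (t : ℤ) • e ν)) ^ 2
        ≤ ∑ t ∈ Finset.range L, (fdiff g ν (boxVec L r + (i : ℤ) • e μ + (t : ℤ) • e ν)) ^ 2 :=
      Finset.sum_le_sum_of_subset_of_nonneg
        (fun x hx => Finset.mem_range.mpr (lt_of_lt_of_le (Finset.mem_range.mp hx) hjL)) (fun _ _ _ => sq_nonneg _)
    have h3 : 0 ≤ ∑ t ∈ Finset.range j, (fdiff g ν (boxVec L r + (i : ℤ) • e μ + (t : ℤ) • e ν)) ^ 2 :=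
      Finset.sum_nonneg fun _ _ => sq_nonneg _
    nlinarith
  have Tμ : (g (boxVec L r + (i : ℤ) • e μ) - g (boxVec L r)) ^ 2
      ≤ (L : ℝ) * ∑ t ∈ Finset.range L, (fdiff g μ (boxVec L r + (t : ℤ) • e μ)) ^ 2 := by
    refine (sq_sub_le_line g μ _ i).trans ?_
    have h1 : (i : ℝ) ≤ L := by exact_mod_cast hiL
    have h2 : ∑ t ∈ Finset.range i, (fdiff g μ (boxVec L r + (t : ℤ) • e μ)) ^ 2
        ≤ ∑ t ∈ Finset.range L, (fdiff g μ (boxVec L r + (t : ℤ) • e μ)) ^ 2 :=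
      Finset.sum_le_sum_of_subset_of_nonneg
        (fun x hx => Finset.mem_range.mpr (lt_of_lt_of_le (Finset.mem_range.mp hx) hiL)) (fun _ _ _ => sq_nonneg _)
    have h3 : 0 ≤ ∑ t ∈ Finset.range i, (fdiff g μ (boxVec L r + (t : ℤ) • e μ)) ^ 2 :=
      Finset.sum_nonneg fun _ _ => sq_nonneg _
    nlinarith
  have Tr : (g (boxVec L r) - g 0) ^ 2
      ≤ 2 ^ d * (L : ℝ) * ∑ κ : Fin d, ∑ u ∈ periodBox L, (fdiff g κ u) ^ 2 := by
    have h := sq_sub_block_le L hL g Finset.univ r (fun κ hκ => absurd (Finset.mem_univ κ) hκ)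
    rwa [Finset.card_univ, Fintype.card_fin] at h
  have hsq3 : ∀ a b c : ℝ, (a + b + c) ^ 2 ≤ 3 * (a ^ 2 + b ^ 2 + c ^ 2) := fun a b c => by
    nlinarith [sq_nonneg (a - b), sq_nonneg (b - c), sq_nonneg (a - c)]
  have hsplit : g (boxVec L r + (i : ℤ) • e μ + (j : ℤ) • e ν) - g 0
      = (g (boxVec L r + (i : ℤ) • e μ + (j : ℤ) • e ν) - g (boxVec L r + (i : ℤ) • e μ))
        + (g (boxVec L r + (i : ℤ) • e μ) - g (boxVec L r)) + (g (boxVec L r) - g 0) := by ring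
  rw [hsplit]
  refine (hsq3 _ _ _).trans ?_
  linarith [Tν, Tμ, Tr]

end StencilPoincare

section StencilPoincare2

/-- Pair variance against a reference value: `Σ_{k,k'}(a_k − a_{k'})² ≤ 4·#s·Σ_k (a_k − c)²`. [folklore] -/
theorem sum_sum_sub_sq_le {ι : Type*} (s : Finset ι) (a : ι → ℝ) (c : ℝ) :
    ∑ k ∈ s, ∑ k' ∈ s, (a k - a k') ^ 2 ≤ 4 * s.card * ∑ k ∈ s, (a k - c) ^ 2 := by
  have h : ∀ k ∈ s, ∑ k' ∈ s, (a k - a k') ^ 2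
      ≤ ∑ k' ∈ s, (2 * (a k - c) ^ 2 + 2 * (a k' - c) ^ 2) := fun k _ =>
    Finset.sum_le_sum fun k' _ => by nlinarith [sq_nonneg (a k + a k' - 2 * c)]
  refine (Finset.sum_le_sum h).trans (le_of_eq ?_)
  simp only [Finset.sum_add_distrib, Finset.sum_const, nsmul_eq_mul, ← Finset.mul_sum]
  ring

/-- Flattening a sum over the stencil index set into the nested `(r, i, j)` sums. [folklore] -/
theorem sum_stencilIdx_eq (L : ℕ) (Ψ : (Fin d → Fin L) → ℕ → ℕ → ℝ) :
    ∑ k ∈ stencilIdx d L, Ψ k.1 k.2.1 k.2.2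
      = ∑ r : Fin d → Fin L, ∑ i ∈ Finset.range L, ∑ j ∈ Finset.range L, Ψ r i j := by
  unfold stencilIdx
  rw [Finset.sum_product]
  refine Finset.sum_congr rfl fun r _ => ?_
  rw [Finset.sum_product]

/-- The `ν`-leg sum: `Σ_k L·Σ_{t<L}(∂_ν g(r+ie_μ+te_ν))² = L²·Σ_k (∂_ν g(off k))²`. [folklore] -/
theorem sumK_nu_eq (L : ℕ) (g : Site d → ℝ) (μ ν : Fin d) :
    ∑ k ∈ stencilIdx d L, (L : ℝ) * ∑ t ∈ Finset.range L,
        (fdiff g ν (boxVec L k.1 + (k.2.1 : ℤ) • e μ + (t : ℤ) • e ν)) ^ 2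
      = (L : ℝ) ^ 2 * ∑ k ∈ stencilIdx d L, (fdiff g ν (stencilOff L μ ν k)) ^ 2 := by
  rw [← Finset.mul_sum]
  have e1 := sum_stencilIdx_eq L
    (fun r i _ => ∑ t ∈ Finset.range L, (fdiff g ν (boxVec L r + (i : ℤ) • e μ + (t : ℤ) • e ν)) ^ 2)
  have e2 := sum_stencilIdx_eq L (fun r i j => (fdiff g ν (boxVec L r + (i : ℤ) • e μ + (j : ℤ) • e ν)) ^ 2)
  simp only [stencilOff]
  rw [e1, e2]
  simp only [Finset.sum_const, Finset.card_range, nsmul_eq_mul]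
  rw [Finset.mul_sum, Finset.mul_sum]
  refine Finset.sum_congr rfl fun r _ => ?_
  rw [Finset.mul_sum, Finset.mul_sum]
  refine Finset.sum_congr rfl fun i _ => ?_
  ring

/-- The `μ`-leg sum: `Σ_k L·Σ_{t<L}(∂_μ g(r+te_μ))² ≤ L³·Σ_k (∂_μ g(off k))²` (the leg is the `j = 0` slice). [folklore] -/
theorem sumK_mu_le (L : ℕ) (hL : 1 ≤ L) (g : Site d → ℝ) (μ ν : Fin d) :
    ∑ k ∈ stencilIdx d L, (L : ℝ) * ∑ t ∈ Finset.range L, (fdiff g μ (boxVec L k.1 + (t : ℤ) • e μ)) ^ 2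
      ≤ (L : ℝ) ^ 3 * ∑ k ∈ stencilIdx d L, (fdiff g μ (stencilOff L μ ν k)) ^ 2 := by
  rw [← Finset.mul_sum]
  have e1 := sum_stencilIdx_eq L
    (fun r _ _ => ∑ t ∈ Finset.range L, (fdiff g μ (boxVec L r + (t : ℤ) • e μ)) ^ 2)
  have e2 := sum_stencilIdx_eq L (fun r i j => (fdiff g μ (boxVec L r + (i : ℤ) • e μ + (j : ℤ) • e ν)) ^ 2)
  simp only [stencilOff]
  rw [e1, e2]
  simp only [Finset.sum_const, Finset.card_range, nsmul_eq_mul]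
  have h0 : (0 : ℕ) ∈ Finset.range L := Finset.mem_range.mpr (by omega)
  have key : ∀ r : Fin d → Fin L,
      ∑ t ∈ Finset.range L, (fdiff g μ (boxVec L r + (t : ℤ) • e μ)) ^ 2
        ≤ ∑ i ∈ Finset.range L, ∑ j ∈ Finset.range L,
            (fdiff g μ (boxVec L r + (i : ℤ) • e μ + (j : ℤ) • e ν)) ^ 2 := by
    intro r
    refine Finset.sum_le_sum fun i _ => ?_
    have := Finset.single_le_sum
      (f := fun j : ℕ => (fdiff g μ (boxVec L r + (i : ℤ) • e μ + (j : ℤ) • e ν)) ^ 2)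
      (fun _ _ => sq_nonneg _) h0
    simpa using this
  have hsum := Finset.sum_le_sum fun r (_ : r ∈ (Finset.univ : Finset (Fin d → Fin L))) => key r
  have hL0 : (0 : ℝ) ≤ L := Nat.cast_nonneg L
  calc (L : ℝ) * ∑ r : Fin d → Fin L, (L : ℝ) * ((L : ℝ) *
          ∑ t ∈ Finset.range L, (fdiff g μ (boxVec L r + (t : ℤ) • e μ)) ^ 2)
      = (L : ℝ) ^ 3 * ∑ r : Fin d → Fin L,
          ∑ t ∈ Finset.range L, (fdiff g μ (boxVec L r + (t : ℤ) • e μ)) ^ 2 := by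
        rw [← Finset.mul_sum, ← Finset.mul_sum]; ring
    _ ≤ (L : ℝ) ^ 3 * ∑ r : Fin d → Fin L, ∑ i ∈ Finset.range L, ∑ j ∈ Finset.range L,
          (fdiff g μ (boxVec L r + (i : ℤ) • e μ + (j : ℤ) • e ν)) ^ 2 :=
        mul_le_mul_of_nonneg_left hsum (by positivity)

/-- The block-leg sum: `Σ_k 2^d·L·Σ_κΣ_{u∈[0,L)^d}(∂_κ g(u))² ≤ 2^d·L^{d+3}·Σ_k gradSq g (off k)` (the block is the
`(i,j) = (0,0)` slice). [folklore] -/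
theorem sumK_block_le (L : ℕ) (hL : 1 ≤ L) (g : Site d → ℝ) (μ ν : Fin d) :
    ∑ _k ∈ stencilIdx d L, (2 : ℝ) ^ d * (L : ℝ) * ∑ κ : Fin d, ∑ u ∈ periodBox L, (fdiff g κ u) ^ 2
      ≤ 2 ^ d * (L : ℝ) ^ (d + 3) * ∑ k ∈ stencilIdx d L, gradSq g (stencilOff L μ ν k) := by
  rw [Finset.sum_const, card_stencilIdx, nsmul_eq_mul, Finset.sum_comm]
  have hZ : ∑ u ∈ periodBox L, ∑ κ : Fin d, (fdiff g κ u) ^ 2 = ∑ r : Fin d → Fin L, gradSq g (boxVec L r) := by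
    unfold periodBox
    rw [Finset.sum_image fun (r : Fin d → Fin L) _ r' _ (h : boxVec L r = boxVec L r') =>
      funext fun κ => Fin.ext (by have := congr_fun h κ; simp only [boxVec, Nat.cast_inj] at this; exact this)]
    rfl
  rw [hZ]
  have h0 : (0 : ℕ) ∈ Finset.range L := Finset.mem_range.mpr (by omega)
  have e2 := sum_stencilIdx_eq L (fun r i j => gradSq g (boxVec L r + (i : ℤ) • e μ + (j : ℤ) • e ν))
  simp only [stencilOff]
  rw [e2]
  have key : ∀ r : Fin d → Fin L, gradSq g (boxVec L r)
      ≤ ∑ i ∈ Finset.range L, ∑ j ∈ Finset.range L, gradSq g (boxVec L r + (i : ℤ) • e μ + (j : ℤ) • e ν) := by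
    intro r
    have h1 := Finset.single_le_sum
      (f := fun j : ℕ => gradSq g (boxVec L r + ((0 : ℕ) : ℤ) • e μ + (j : ℤ) • e ν))
      (fun _ _ => gradSq_nonneg _ _) h0
    have h2 := Finset.single_le_sum
      (f := fun i : ℕ => ∑ j ∈ Finset.range L, gradSq g (boxVec L r + (i : ℤ) • e μ + (j : ℤ) • e ν))
      (fun _ _ => Finset.sum_nonneg fun _ _ => gradSq_nonneg _ _) h0
    simp only [Nat.cast_zero, zero_smul, add_zero] at h1 h2 ⊢
    exact h1.trans h2
  have hsum := Finset.sum_le_sum fun r (_ : r ∈ (Finset.univ : Finset (Fin d → Fin L))) => key r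
  calc ((L ^ (d + 2) : ℕ) : ℝ) * (2 ^ d * (L : ℝ) * ∑ r : Fin d → Fin L, gradSq g (boxVec L r))
      = 2 ^ d * (L : ℝ) ^ (d + 3) * ∑ r : Fin d → Fin L, gradSq g (boxVec L r) := by push_cast; ring
    _ ≤ 2 ^ d * (L : ℝ) ^ (d + 3) * ∑ r : Fin d → Fin L, ∑ i ∈ Finset.range L, ∑ j ∈ Finset.range L,
          gradSq g (boxVec L r + (i : ℤ) • e μ + (j : ℤ) • e ν) :=
        mul_le_mul_of_nonneg_left hsum (by positivity)

/-- **THE STENCIL POINCARÉ INEQUALITY**: the pair variance of a site function over the averaging stencil of a coarse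
plaquette is at most `C_P(d,L)` times its nearest-neighbour gradient energy sampled over the stencil:
`Σ_{k,k'}(g(off k) − g(off k'))² ≤ C_P(d,L)·Σ_k gradSq g (off k)`, `C_P = 12·L^{d+2}·(L² + L³ + 2^d L^{d+3})`
(crude but explicit; staircase telescoping). [folklore] -/
theorem stencil_poincare (L : ℕ) (hL : 1 ≤ L) (g : Site d → ℝ) (μ ν : Fin d) :
    ∑ k ∈ stencilIdx d L, ∑ k' ∈ stencilIdx d L, (g (stencilOff L μ ν k) - g (stencilOff L μ ν k')) ^ 2
      ≤ poincareConst d L * ∑ k ∈ stencilIdx d L, gradSq g (stencilOff L μ ν k) := by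
  -- reference corner
  have s1 := sum_sum_sub_sq_le (stencilIdx d L) (fun k => g (stencilOff L μ ν k)) (g 0)
  rw [card_stencilIdx] at s1
  -- corner bound, summed
  have s2 : ∑ k ∈ stencilIdx d L, (g (stencilOff L μ ν k) - g 0) ^ 2
      ≤ 3 * (∑ k ∈ stencilIdx d L, (L : ℝ) * ∑ t ∈ Finset.range L,
              (fdiff g ν (boxVec L k.1 + (k.2.1 : ℤ) • e μ + (t : ℤ) • e ν)) ^ 2
            + ∑ k ∈ stencilIdx d L, (L : ℝ) * ∑ t ∈ Finset.range L, (fdiff g μ (boxVec L k.1 + (t : ℤ) • e μ)) ^ 2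
            + ∑ _k ∈ stencilIdx d L, (2 : ℝ) ^ d * (L : ℝ) * ∑ κ : Fin d, ∑ u ∈ periodBox L, (fdiff g κ u) ^ 2) := by
    rw [← Finset.sum_add_distrib, ← Finset.sum_add_distrib, Finset.mul_sum]
    exact Finset.sum_le_sum fun k hk => sq_sub_corner_le L hL g μ ν k hk
  have s3 := sumK_nu_eq L g μ ν
  have s4 := sumK_mu_le L hL g μ ν
  have s5 := sumK_block_le L hL g μ ν
  -- legs ≤ gradient energy
  have gν : ∑ k ∈ stencilIdx d L, (fdiff g ν (stencilOff L μ ν k)) ^ 2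
      ≤ ∑ k ∈ stencilIdx d L, gradSq g (stencilOff L μ ν k) :=
    Finset.sum_le_sum fun k _ => fdiff_sq_le_gradSq g ν _
  have gμ : ∑ k ∈ stencilIdx d L, (fdiff g μ (stencilOff L μ ν k)) ^ 2
      ≤ ∑ k ∈ stencilIdx d L, gradSq g (stencilOff L μ ν k) :=
    Finset.sum_le_sum fun k _ => fdiff_sq_le_gradSq g μ _
  have hG : 0 ≤ ∑ k ∈ stencilIdx d L, gradSq g (stencilOff L μ ν k) :=
    Finset.sum_nonneg fun k _ => gradSq_nonneg _ _
  have hL0 : (1 : ℝ) ≤ L := by exact_mod_cast hL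
  have hL2 : (0 : ℝ) ≤ (L : ℝ) ^ 2 := by positivity
  have hL3 : (0 : ℝ) ≤ (L : ℝ) ^ 3 := by positivity
  have hLd : (0 : ℝ) ≤ (L : ℝ) ^ (d + 2) := by positivity
  have t1 := mul_le_mul_of_nonneg_left gν hL2
  have t2 := mul_le_mul_of_nonneg_left gμ hL3
  -- collect
  have s6 : ∑ k ∈ stencilIdx d L, (g (stencilOff L μ ν k) - g 0) ^ 2
      ≤ 3 * ((L : ℝ) ^ 2 + (L : ℝ) ^ 3 + 2 ^ d * (L : ℝ) ^ (d + 3))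
          * ∑ k ∈ stencilIdx d L, gradSq g (stencilOff L μ ν k) := by
    nlinarith [s2, s3, s4, s5, t1, t2, hG]
  have s7 := mul_le_mul_of_nonneg_left s6 (show (0 : ℝ) ≤ 4 * (L : ℝ) ^ (d + 2) by positivity)
  unfold poincareConst
  push_cast at s1
  nlinarith [s1, s7, hG, hLd]

/-- Shifting the base point: `gradSq (g(z + ·)) x = gradSq g (z + x)`. [folklore] -/
theorem gradSq_shift (g : Site d → ℝ) (z x : Site d) :
    gradSq (fun u => g (z + u)) x = gradSq g (z + x) := by
  simp only [gradSq, fdiff, add_assoc]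

/-- **THE STENCIL PAIR VARIANCE IS BOUNDED BY THE GRADIENT ENERGY OF THE FINE ANGLES OVER THE STENCIL**. [folklore] -/
theorem stencilPVar_le (L : ℕ) (hL : 1 ≤ L) (A : Site d → Fin d → ℝ) (z : Site d) (μ ν : Fin d) :
    stencilPVar L A z μ ν
      ≤ poincareConst d L * ∑ k ∈ stencilIdx d L,
          gradSq (fun x => asum A x (plaqWord μ ν)) (z + stencilOff L μ ν k) := by
  have h := stencil_poincare L hL (fun u => asum A (z + u) (plaqWord μ ν)) μ ν
  have e : ∀ x : Site d, gradSq (fun u => asum A (z + u) (plaqWord μ ν)) x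
      = gradSq (fun y => asum A y (plaqWord μ ν)) (z + x) :=
    fun x => gradSq_shift (fun y => asum A y (plaqWord μ ν)) z x
  simp only [e] at h
  exact h

end StencilPoincare2

section TorusLower

/-- THE LOWER CONSTANT `C_low(d,L) = 3·(L² + L³ + 2^d·L^{d+3})` (`= C_P(d,L)·L^{−(d+2)}/4`). [folklore] -/
def lowerConst (d L : ℕ) : ℝ := 3 * ((L : ℝ) ^ 2 + (L : ℝ) ^ 3 + 2 ^ d * (L : ℝ) ^ (d + 3))

/-- `C_low ≥ 0`. [folklore] -/
theorem lowerConst_nonneg (d L : ℕ) : 0 ≤ lowerConst d L := by unfold lowerConst; positivity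

/-- The gradient energy of the plaquette angles of a `P`-periodic form is `P`-periodic. [folklore] -/
theorem gradSq_periodic {A : Site d → Fin d → ℝ} {P : ℤ} (hA : IsPeriodicForm A P) (μ ν : Fin d)
    (x : Site d) (κ : Fin d) :
    gradSq (fun y => asum A y (plaqWord μ ν)) (x + P • e κ) = gradSq (fun y => asum A y (plaqWord μ ν)) x := by
  have hA' : ∀ (y : Site d) (μ' : Fin d), A (y + P • e κ) μ' = A y μ' := fun y μ' => hA y κ μ'
  simp only [gradSq, fdiff]
  refine Finset.sum_congr rfl fun κ' _ => ?_
  rw [add_right_comm, asum_add_period hA', asum_add_period hA']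

/-- **THE LOWER HALF ON THE TORUS (abelian class, quadratic order)**: for a form of period `LM`,
`quadDeficit L A (blockWindow L [0,M)^d) ≥ −C_low(d,L)·Σ_π Σ_{x∈[0,LM)^d} Σ_κ (θ_π(x+e_κ) − θ_π(x))²` — minus the
nearest-neighbour gradient energy of the plaquette angles (§9 exact variance form + the stencil Poincaré inequality + torus
resummation). [folklore] -/
theorem quadDeficit_torus_ge (L M : ℕ) (hL : 1 ≤ L) (hM : 1 ≤ M) {A : Site d → Fin d → ℝ}
    (hA : IsPeriodicForm A ((L : ℤ) * M)) :
    -lowerConst d L * ∑ π : Plane d, ∑ x ∈ periodBox (L * M), gradSq (fun y => asum A y (plaqWord π.1.1 π.1.2)) x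
      ≤ quadDeficit L A (blockWindow L (periodBox M)) := by
  have hL0 : (L : ℝ) ≠ 0 := by exact_mod_cast (by omega : L ≠ 0)
  rw [quadDeficit_torus_eq L M hL hM hA]
  have plane : ∀ μ ν : Fin d, ∑ y ∈ periodBox M, stencilPVar L A ((L : ℤ) • y) μ ν
      ≤ poincareConst d L * ((L : ℝ) ^ 2
          * ∑ x ∈ periodBox (L * M), gradSq (fun y => asum A y (plaqWord μ ν)) x) := by
    intro μ ν
    have hper : ∀ (x : Site d) (κ : Fin d),
        gradSq (fun y => asum A y (plaqWord μ ν)) (x + ((L * M : ℕ) : ℤ) • e κ)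
          = gradSq (fun y => asum A y (plaqWord μ ν)) x := by
      intro x κ
      have := gradSq_periodic hA μ ν x κ
      push_cast at this ⊢
      exact this
    rw [← sum_periodBox_stencilIdx L M hL hM hper μ ν, Finset.mul_sum]
    exact Finset.sum_le_sum fun y _ => stencilPVar_le L hL A _ μ ν
  set S := ∑ π : Plane d, ∑ x ∈ periodBox (L * M), gradSq (fun y => asum A y (plaqWord π.1.1 π.1.2)) x
    with hS
  have hsum : ∑ π : Plane d, ∑ y ∈ periodBox M, stencilPVar L A ((L : ℤ) • y) π.1.1 π.1.2
      ≤ poincareConst d L * ((L : ℝ) ^ 2 * S) := by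
    rw [hS, Finset.mul_sum, Finset.mul_sum]
    exact Finset.sum_le_sum fun π _ => plane π.1.1 π.1.2
  have hC : (0 : ℝ) ≤ ((L : ℝ) ^ (d + 4))⁻¹ / 4 := by positivity
  have h := mul_le_mul_of_nonneg_left hsum hC
  have hid : ((L : ℝ) ^ (d + 4))⁻¹ / 4 * (poincareConst d L * ((L : ℝ) ^ 2 * S)) = lowerConst d L * S := by
    unfold poincareConst lowerConst
    field_simp
    ring
  rw [hid] at h
  linarith

/-- **BAŁABAN'S DEFICIT OF A PERIODIC ABELIAN CONFIGURATION IS BOUNDED BELOW** by minus the gradient energy of its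
plaquette angles minus the coarse quartic budget: under `|θ| ≤ a`, `L²a ≤ 1`,
`𝓓_{(42)}(e^{iA}·1; [0,M)^d) ≥ −C_low(d,L)·Σ|∇θ|² − (5/96)·L^{d−4}·#W_c·(L²a)⁴`. [folklore] -/
theorem deficit_imCfg_torus_ge [Nonempty n] (L M : ℕ) (hL : 1 ≤ L) (hM : 1 ≤ M) {A : Site d → Fin d → ℝ}
    (hA : IsPeriodicForm A ((L : ℤ) * M)) (hs : SmallExp L (imCfg A)) {a : ℝ}
    (hθ : ∀ (x : Site d) (μ ν : Fin d), |asum A x (plaqWord μ ν)| ≤ a) (ha : (L : ℝ) ^ 2 * a ≤ 1) :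
    -lowerConst d L * ∑ π : Plane d, ∑ x ∈ periodBox (L * M), gradSq (fun y => asum A y (plaqWord π.1.1 π.1.2)) x
        - 5 / 96 * ((L : ℝ) ^ ((d : ℤ) - 4)
            * (((blockWindow L (periodBox (d := d) M)).1.card : ℝ) * ((L : ℝ) ^ 2 * a) ^ 4))
      ≤ deficit L (scalarCfg (n := n) (imCfg A)) (blockWindow L (periodBox M)) := by
  rw [deficit_imCfg L hL hs]
  have h1 := quad_sub_le_stencilDeficit L A (blockWindow L (periodBox M))
    (fun P _ => abs_stencilAngle_le_one L hL A hθ ha _ _ _)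
  have h2 := quadDeficit_torus_ge L M hL hM hA
  have h3 := coarseQuartic_le L hL A (blockWindow L (periodBox M)) hθ
  linarith

/-- **THE TWO-SIDED ABELIAN β′-per**: for a form `A` of period `LM` with `|θ| ≤ a`, `0 ≤ a`, `L²a ≤ 1` and small
exponents, `|𝓓_{(42)}(e^{iA}·1; [0,M)^d)| ≤ C_low(d,L)·Σ_πΣ_{x∈[0,LM)^d}Σ_κ(θ_π(x+e_κ) − θ_π(x))²
+ (5/96)·(#W_f·a⁴ + L^{d−4}·#W_c·(L²a)⁴)` — gradient energy of the plaquette angles plus quartic budgets, NO term of order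
`a`, `a²`, `a³` in the field: the shape of `DeficitValueWallPer` on the abelian class (its `gradFluxSq` is, on this class and
for the principal logarithm, exactly the gradient energy of the angles — a dictionary NOT formalised here). [folklore] -/
theorem abs_deficit_imCfg_torus_le [Nonempty n] (L M : ℕ) (hL : 1 ≤ L) (hM : 1 ≤ M) {A : Site d → Fin d → ℝ}
    (hA : IsPeriodicForm A ((L : ℤ) * M)) (hs : SmallExp L (imCfg A)) {a : ℝ} (ha₀ : 0 ≤ a)
    (hθ : ∀ (x : Site d) (μ ν : Fin d), |asum A x (plaqWord μ ν)| ≤ a) (ha : (L : ℝ) ^ 2 * a ≤ 1) :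
    |deficit L (scalarCfg (n := n) (imCfg A)) (blockWindow L (periodBox M))|
      ≤ lowerConst d L * ∑ π : Plane d, ∑ x ∈ periodBox (L * M), gradSq (fun y => asum A y (plaqWord π.1.1 π.1.2)) x
        + 5 / 96 * ((((blockWindow L (periodBox (d := d) M)).2.card : ℝ) * a ^ 4)
          + (L : ℝ) ^ ((d : ℤ) - 4) * (((blockWindow L (periodBox (d := d) M)).1.card : ℝ) * ((L : ℝ) ^ 2 * a) ^ 4)) := by
  have hL1 : (1 : ℝ) ≤ (L : ℝ) ^ 2 := one_le_pow₀ (by exact_mod_cast hL)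
  have ha1 : a ≤ 1 := by nlinarith
  have hlo := deficit_imCfg_torus_ge (n := n) L M hL hM hA hs hθ ha
  have hup := deficit_imCfg_torus_le_quartic (n := n) L M hL hM hA hs ha1 hθ
  have hX : 0 ≤ lowerConst d L * ∑ π : Plane d, ∑ x ∈ periodBox (L * M),
      gradSq (fun y => asum A y (plaqWord π.1.1 π.1.2)) x :=
    mul_nonneg (lowerConst_nonneg d L)
      (Finset.sum_nonneg fun _ _ => Finset.sum_nonneg fun _ _ => gradSq_nonneg _ _)
  have hF : 0 ≤ (((blockWindow L (periodBox (d := d) M)).2.card : ℝ) * a ^ 4) := by positivity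
  have hCq : 0 ≤ (L : ℝ) ^ ((d : ℤ) - 4)
      * (((blockWindow L (periodBox (d := d) M)).1.card : ℝ) * ((L : ℝ) ^ 2 * a) ^ 4) :=
    mul_nonneg (zpow_weight_nonneg L) (by positivity)
  rw [abs_le]
  constructor <;> linarith

end TorusLower

/-! ## §11 [v1.4] THE DICTIONARY TO THE WALL'S CURRENCY: on the abelian class (principal branch) `gradFluxSq` IS the
gradient energy of the plaquette angles, so §8 + §10 give the inequality of `DeficitValueWallPer` for every periodic
small abelian configuration, with the explicit constant `C_{β′}(d,L)` -/

section Dictionary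

/-- `#[0,N)^d = N^d`. [folklore] -/
theorem card_periodBox (N : ℕ) : (periodBox (d := d) N).card = N ^ d := by
  unfold periodBox
  have hinj : Function.Injective (boxVec (d := d) N) := fun r r' h =>
    funext fun κ => Fin.ext (by have := congr_fun h κ; simp only [boxVec, Nat.cast_inj] at this; exact this)
  rw [Finset.card_image_of_injective _ hinj, Finset.card_univ, Fintype.card_fun, Fintype.card_fin,
    Fintype.card_fin]

/-- THE FLUX OF AN ABELIAN CONFIGURATION on the principal branch `|θ| < ln 2`: `F(p′) = log(e^{iθ}·1) = iθ·1`. [folklore] -/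
theorem flux_imCfg [Nonempty n] (A : Site d → Fin d → ℝ) (p : Plaq d) (hθ : |plaqAngle A p| < Real.log 2) :
    flux (scalarCfg (n := n) (imCfg A)) p = ((((plaqAngle A p : ℝ) : ℂ)) * Complex.I) • (1 : Matrix n n ℂ) := by
  rw [flux, fhol, hol_scalarCfg, asum_imCfg, val_expUnit]
  apply mlog_exp_smul_one
  rw [norm_real_mul_I]
  exact hθ

/-- THE COVARIANT GRADIENT OF THE FLUX on the abelian class: `(∇_V F)(x,κ;π) = i(θ_π(x+e_κ) − θ_π(x))·1` (`Ad` of a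
scalar is the scalar). [folklore] -/
theorem covGrad_flux_imCfg [Nonempty n] (A : Site d → Fin d → ℝ) (hθ : ∀ p : Plaq d, |plaqAngle A p| < Real.log 2)
    (x : Site d) (κ : Fin d) (π : Plane d) :
    covGrad (scalarCfg (n := n) (imCfg A)) (flux (scalarCfg (n := n) (imCfg A))) x κ π
      = ((((fdiff (fun y => asum A y (plaqWord π.1.1 π.1.2)) κ x : ℝ) : ℂ)) * Complex.I) • (1 : Matrix n n ℂ) := by
  rw [covGrad, flux_imCfg A _ (hθ _), flux_imCfg A _ (hθ _), Ad_smul_one, ← sub_smul]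
  congr 1
  simp only [plaqAngle, fdiff]
  push_cast
  ring

/-- **THE DICTIONARY**: on the abelian class (principal branch), the wall's `gradFluxSq V N` is the nearest-neighbour
gradient energy of the plaquette angles, `Σ_π Σ_{x∈N} Σ_κ (θ_π(x+e_κ) − θ_π(x))²`. [folklore] -/
theorem gradFluxSq_imCfg [Nonempty n] (A : Site d → Fin d → ℝ) (hθ : ∀ p : Plaq d, |plaqAngle A p| < Real.log 2)
    (N : Finset (Site d)) :
    gradFluxSq (scalarCfg (n := n) (imCfg A)) N
      = ∑ π : Plane d, ∑ x ∈ N, gradSq (fun y => asum A y (plaqWord π.1.1 π.1.2)) x := by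
  unfold gradFluxSq gradSq
  simp_rw [covGrad_flux_imCfg A hθ, norm_smul_one_eq, norm_real_mul_I, sq_abs]
  calc ∑ x ∈ N, ∑ κ : Fin d, ∑ π : Plane d, (fdiff (fun y => asum A y (plaqWord π.1.1 π.1.2)) κ x) ^ 2
      = ∑ x ∈ N, ∑ π : Plane d, ∑ κ : Fin d, (fdiff (fun y => asum A y (plaqWord π.1.1 π.1.2)) κ x) ^ 2 :=
        Finset.sum_congr rfl fun x _ => Finset.sum_comm
    _ = ∑ π : Plane d, ∑ x ∈ N, ∑ κ : Fin d, (fdiff (fun y => asum A y (plaqWord π.1.1 π.1.2)) κ x) ^ 2 :=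
        Finset.sum_comm

/-- THE ABELIAN β′-per CONSTANT `C_{β′}(d,L) = C_low(d,L) + (5/96)·#planes·(L^d + L^{d+4})`. [folklore] -/
def wallConst (d L : ℕ) : ℝ :=
  lowerConst d L + 5 / 96 * (Fintype.card (Plane d) : ℝ) * ((L : ℝ) ^ d + (L : ℝ) ^ (d + 4))

/-- **THE INEQUALITY OF `DeficitValueWallPer` HOLDS ON THE ABELIAN CLASS, WITH AN EXPLICIT CONSTANT**: for every
`L, M ≥ 1`, every real form `A` of period `LM` with small exponents, `|θ| ≤ a` for all fine plaquette angles,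
`0 ≤ a`, `L²a ≤ 1`, `a < ln 2` (principal branch of the flux):
`|𝓓_{(42)}(e^{iA}·1; blockWindow L [0,M)^d)| ≤ C_{β′}(d,L)·(gradFluxSq (e^{iA}·1) (blockSites L [0,M)^d) + a³·M^d)` —
the wall's own functional, the wall's own shape (`a⁴ ≤ a³` absorbs the quartic budgets).  Nothing is claimed about
non-abelian configurations: the commutator corrections of (42) are the remaining [analysis]. [folklore] -/
theorem deficit_imCfg_wallPer [Nonempty n] (L M : ℕ) (hL : 1 ≤ L) (hM : 1 ≤ M) {A : Site d → Fin d → ℝ}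
    (hA : IsPeriodicForm A ((L : ℤ) * M)) (hs : SmallExp L (imCfg A)) {a : ℝ} (ha₀ : 0 ≤ a)
    (hθ : ∀ (x : Site d) (μ ν : Fin d), |asum A x (plaqWord μ ν)| ≤ a) (ha : (L : ℝ) ^ 2 * a ≤ 1)
    (hlog : a < Real.log 2) :
    |deficit L (scalarCfg (n := n) (imCfg A)) (blockWindow L (periodBox M))|
      ≤ wallConst d L
        * (gradFluxSq (scalarCfg (n := n) (imCfg A)) (blockSites L (periodBox M)) + a ^ 3 * (M : ℝ) ^ d) := by
  have hθ' : ∀ p : Plaq d, |plaqAngle A p| < Real.log 2 := fun p => (hθ p.1 p.2.1.1 p.2.1.2).trans_lt hlog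
  have h := abs_deficit_imCfg_torus_le (n := n) L M hL hM hA hs ha₀ hθ ha
  rw [gradFluxSq_imCfg A hθ', blockSites_periodBox L M hL]
  have hcf : (((blockWindow L (periodBox (d := d) M)).2.card : ℕ) : ℝ)
      = ((L : ℝ) * M) ^ d * (Fintype.card (Plane d) : ℝ) := by
    simp only [blockWindow]
    rw [Finset.card_product, blockSites_periodBox L M hL, card_periodBox, Finset.card_univ]
    push_cast
    ring
  have hcc : (((blockWindow L (periodBox (d := d) M)).1.card : ℕ) : ℝ)
      = (M : ℝ) ^ d * (Fintype.card (Plane d) : ℝ) := by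
    simp only [blockWindow]
    rw [Finset.card_product, card_periodBox, Finset.card_univ]
    push_cast
    ring
  rw [hcf, hcc, zpow_sub_four_eq L hL] at h
  have hL0 : (L : ℝ) ≠ 0 := by exact_mod_cast (by omega : L ≠ 0)
  set Pl : ℝ := (Fintype.card (Plane d) : ℝ) with hPl
  set G : ℝ := ∑ π : Plane d, ∑ x ∈ periodBox (L * M), gradSq (fun y => asum A y (plaqWord π.1.1 π.1.2)) x
    with hG
  have e : 5 / 96 * (((L : ℝ) * M) ^ d * Pl * a ^ 4
        + (L : ℝ) ^ d / (L : ℝ) ^ 4 * ((M : ℝ) ^ d * Pl * ((L : ℝ) ^ 2 * a) ^ 4))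
      = 5 / 96 * Pl * ((L : ℝ) ^ d + (L : ℝ) ^ (d + 4)) * (a ^ 4 * (M : ℝ) ^ d) := by
    field_simp
    ring
  rw [e] at h
  have hL1 : (1 : ℝ) ≤ (L : ℝ) ^ 2 := one_le_pow₀ (by exact_mod_cast hL)
  have ha1 : a ≤ 1 := by nlinarith
  have ha43 : a ^ 4 ≤ a ^ 3 := by nlinarith [pow_nonneg ha₀ 3]
  have hMd : (0 : ℝ) ≤ (M : ℝ) ^ d := by positivity
  have hK : (0 : ℝ) ≤ 5 / 96 * Pl * ((L : ℝ) ^ d + (L : ℝ) ^ (d + 4)) := by positivity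
  have hq : 5 / 96 * Pl * ((L : ℝ) ^ d + (L : ℝ) ^ (d + 4)) * (a ^ 4 * (M : ℝ) ^ d)
      ≤ 5 / 96 * Pl * ((L : ℝ) ^ d + (L : ℝ) ^ (d + 4)) * (a ^ 3 * (M : ℝ) ^ d) :=
    mul_le_mul_of_nonneg_left (mul_le_mul_of_nonneg_right ha43 hMd) hK
  have hG0 : 0 ≤ G := Finset.sum_nonneg fun _ _ => Finset.sum_nonneg fun _ _ => gradSq_nonneg _ _
  have hn1 : 0 ≤ lowerConst d L * (a ^ 3 * (M : ℝ) ^ d) := mul_nonneg (lowerConst_nonneg d L) (by positivity)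
  have hn2 : 0 ≤ 5 / 96 * Pl * ((L : ℝ) ^ d + (L : ℝ) ^ (d + 4)) * G := mul_nonneg hK hG0
  have expand : wallConst d L * (G + a ^ 3 * (M : ℝ) ^ d)
      = lowerConst d L * G + lowerConst d L * (a ^ 3 * (M : ℝ) ^ d)
        + 5 / 96 * Pl * ((L : ℝ) ^ d + (L : ℝ) ^ (d + 4)) * G
        + 5 / 96 * Pl * ((L : ℝ) ^ d + (L : ℝ) ^ (d + 4)) * (a ^ 3 * (M : ℝ) ^ d) := by
    rw [wallConst, hPl]
    ring
  rw [expand]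
  linarith

end Dictionary

end

end Literature.MathematicalPhysics.QuantumFieldTheory.Balaban1983to89.T4AveragingDeficitWallBoundary
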